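import Literature.AlgebraicGeometry.Motives.HodgeThetaAnnihilatorTimesNonCMCurve
import Literature.AlgebraicGeometry.Motives.HodgeThetaSubalgebraSymplecticRankSixHodge
import HarnessLib

/-!
# Rational tensors on `V₁ ⊕ V₂` killed by `Θ` are killed by `0 ⊕ 𝔰𝔭(V₂)` and by `Θ₁ ⊕ 0` when EVERY admissible algebra of `V₂` is `𝔰𝔭(V₂)` and there is no non-zero morphism of Hodge structures `V₂ → V₁` (Moonen–Zarhin 1999 Lemma (3.4) with (3.3) for a rigid symplectic factor of any rank: `Hg(X₁ × X₂) = Hg(X₁) × Hg(X₂)` or `Hom(X₂, X₁) ≠ 0` — the Lie step, Goursat WITHOUT a size bound, the standard representation as the only length-one representation)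

Family `hodge`, layer `Literature/AlgebraicGeometry/Motives` (abstract polarizable `ℚ`-Hodge structures and
complex symplectic linear algebra; no geometry). Research context: cell `pub-hodge-ring2` (HONEST FRAMING:
research route conditional on HC_CM; not a corollary; Q11.4-sentence-2 already refuted in dim ≥ 3), Literature
lane, programme R23 («`X × S` for `S` a generic abelian surface or threefold — `End⁰(S) = ℚ` — and ANY `X` with
`Hom(X, S) = 0`»). UNCONDITIONAL linear algebra; theorems only, no definition, no named fact (D-0026); no step
towards a summit statement. It is the fourth member of the family `HodgeThetaAnnihilatorSemisimpleTimesAbelian`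
(R4: second factor CM), `HodgeThetaAnnihilatorRealBlocksTimesSymplectic` (R14: second factor rigid symplectic
and LARGER than the first — graph excluded by a SIZE bound), `HodgeThetaAnnihilatorTimesNonCMCurve` (R22: second
factor a non-CM elliptic curve, first factor arbitrary — graph excluded by `Hom = 0` through the
`𝔰𝔩₂`-relations): here the second factor is rigid symplectic OF ANY RANK (`hg(X₂) ⊗ ℂ = 𝔰𝔭(V₂ ⊗ ℂ)` for every
admissible algebra — the tree's theorems for `dim V₂ = 2, 4, 6` with `End_Hdg(V₂) = ℚ`) and the FIRST factor is
ARBITRARY, the graph `Γ_φ` of Moonen–Zarhin's (3.1) being excluded by `Hom_Hdg(V₂, V₁) = 0` through the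
representation-theoretic input of their Lemma (3.4): the standard representation of `𝔰𝔭_{2g}` is its only
irreducible length-one representation — proved here in elementary form (§3), without highest weights.

THE PRINTED RESULT. B. Moonen, Yu. G. Zarhin, *Hodge classes on abelian varieties of low dimension*, Math. Ann.
**315** (1999) 711–733 [corpus: paper:arxiv-math_9901113 p. 6 L60–L140, p. 7 L1–L8]. (3.1): «`hg(X₁ × X₂) ≅
𝔤₁ ⊕ 𝔤₂ ⊕ Γ_φ … where `Γ_φ ⊆ 𝔤₃ ⊕ 𝔤₃` is the graph of the automorphism `φ`». Lemma (3.3): «… The assumption that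
`V_X` is the only length 1 irreducible `𝔤`-module of non-compact type therefore implies that `V_Y ≅ V_X^q` as
`𝔤`-modules … If `λ` is an eigenvalue of `J₂` on `U_j^{dq}` then we find that both `i + λ` and `-i + λ` occur as
eigenvalues of `J_Y` … this is possible only if `λ = 0`.» **Lemma (3.4)**: «Let `X₁` and `X₂` be nonzero complex
abelian varieties. Write `X = X₁ × X₂`. Assume that `hg(X₂)` is a `ℚ`-simple Lie algebra of non-compact type and
that, up to isomorphism, `V_{X₂}` is the only irreducible `hg(X₂)`-module which is a length 1 representation of
non-compact type. Then either `Hg(X) = Hg(X₁) × Hg(X₂)` or `Hom(X₂, X₁) ≠ 0`.» (1.7): «a simple Lie algebra of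
type `C_ℓ` (`ℓ ≥ 1`) over `ℂ` has a unique irreducible representation with miniscule highest weight, see
[Bourbaki], Chap. 8, §7, n° 3». (2.4)(3): «Suppose `X` [simple, `dim X ≤ 3`] is not of CM-type. … If `Hg(X)` is
`ℚ`-simple then (up to isomorphism) there is exactly one faithful irreducible representation of `hg(X)` over `ℚ`
which is of length 1.» (5.4): «… If `dim(X₂) < 3` then the desired equality `Hg(X) = Hg(X₁) × Hg(X₂)` follows
from (2.4) and (3.4).»

THIS FILE: THE LIE STEP OF LEMMA (3.4) FOR `hg(X₂) ⊗ ℂ = 𝔰𝔭(V₂ ⊗ ℂ)` WITHOUT ALGEBRAIC GROUPS AND WITHOUT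
HIGHEST-WEIGHT THEORY, in the tree's word model (`HodgeThetaAnnihilatorLieAlgebra`, THEOREM L), with the SAME
output shape as the R5/R22 Lie steps (`wordDerAt_incl_proj_eq_zero_of_forall_lie`,
`wordDerAt_incl_proj_theta_eq_zero_of_times_nonCMCurve`), so that the geometric evaluation pipeline
(`TimesNonCMCurve{Invariance, ProductSpan}`) runs verbatim. SETTING: a `ℚ`-space `U` presented as `V₁ ⊕ V₂`;
EFFECTIVE WEIGHT-ONE Hodge structures `H_U`, `H₁`, `H₂` with `ι₁`, `ι₂` compatible with the Hodge pieces;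
polarizations `ψ₁`, `ψ₂`; on `V₂ ≠ 0`: (RIGID) every bracket-closed rational `ψ₂`-skew `𝔤₂ ⊆ End_ℚ(V₂)` with
`Θ₂ ∈ (𝔤₂)_ℂ` complexifies onto ALL `ψ₂ ⊗ ℂ`-skew operators (a hypothesis; theorems of the tree for rank `2`
(`RankTwoTheta.mem_spanC_of_skew`), `4` (`SymplecticTheta.mem_spanC_of_skew`), `6`
(`SymplecticThetaSix.mem_spanC_of_skew`) when `End_Hdg(V₂) = ℚ` — §6); and (HOM) every `ℚ`-linear
`f : V₂ → V₁` mapping `V₂^{p,q}` into `V₁^{p,q}` vanishes («`Hom(X₂, X₁) = 0`», through Riemann's theorem).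

PROOF (Moonen–Zarhin (3.1), (3.3), (3.4) in Lie form, on the annihilator algebra `𝔞` of a rational `Θ_U`-killed
tensor). `𝔞` is bracket-closed, block diagonal, `Θ_U ∈ 𝔞_ℂ`. By (RIGID) `c₂(𝔞)_ℂ = 𝔰𝔭(V₂ ⊗ ℂ)`. If the kernel
`K = 𝔞 ∩ ker c₁` is non-zero it contains `Θ₂` after `⊗ ℂ` ((IDEAL): `SymplecticIdeal.theta_mem_of_ne_bot_hodge`,
«`𝔰𝔭` is simple») and is everything by (RIGID), which gives the theorem (Hazama's Goursat argument, the tree's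
`goursat_incl_corner_mem`). THE GRAPH CASE `K = 0` (§4) is impossible: `c₁` is injective on `𝔞_ℂ`; the ideal
`𝔨₁ = c₁(𝔞 ∩ ker c₂)` of the `Θ₁`-subalgebra `𝔤₁ = c₁(𝔞)` has a complementary ideal `𝔤₃` (`exists_ideal_compl`:
Deligne I 3.6 «`Hg` is reductive» in Lie form); `𝔞₃ = 𝔞 ∩ c₁⁻¹(𝔤₃)` is an ideal of `𝔞` with `c₂ : (𝔞₃)_ℂ ≅
𝔰𝔭(V₂ ⊗ ℂ)`; `ρ = c₁ ∘ c₂⁻¹ : 𝔰𝔭(V₂ ⊗ ℂ) → End(V₁ ⊗ ℂ)` is linear, bracket-preserving, injective, with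
`ρ[Θ₂, Y] = [Θ₁, ρY]`. §3 (THE STANDARD REPRESENTATION OCCURS) produces a NON-ZERO `ρ`-equivariant
`F : V₂ ⊗ ℂ → V₁ ⊗ ℂ`; then `Z' = ι₁ F π₂ ≠ 0` commutes with `(𝔞₃)_ℂ`, so by DESCENT OF COMMUTANTS
(`mem_span_baseChange_of_forall_commute`) it lies in the complex span of the RATIONAL `Z` commuting with `𝔞₃`, all
of which have `π₁Zι₂ = 0`: such a corner is `ρ`-equivariant, hence intertwines `Θ₂` and `Θ₁` (§3,
`theta_comp_eq_of_equivariant`: «the `𝔤₃`-equivariant part of `Hom(V_{X₂}, V_{X₁})` consists of Hodge classes»)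
and (HOM) applies — contradiction.

§2–§3, THE REPRESENTATION-THEORETIC INPUT IN ELEMENTARY FORM (complex symplectic linear algebra in the Siegel block
form `𝔰𝔭(M, ω) = 𝔲⁻ ⊕ 𝔤𝔩(P) ⊕ 𝔲⁺` of the tree's `HodgeThetaSymplecticIdeal`: `ω` nondegenerate alternating,
`T` an `ω`-skew involution with Lagrangian eigenspaces `P`, `Q`; root vectors `R_a = ω(a,·) ⊗ a`, pair operators
`Y_{a,b} = ω(a,·) ⊗ b + ω(b,·) ⊗ a`). For `ρ : 𝔰𝔭(M, ω) → End(W)` linear, bracket-preserving, with `ρ[T,Y] =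
[Θ, ρY]` (`Θ² = 1` on `W`): `ρ` maps `𝔲^±` to `Θ`-raising/lowering operators (`Θ A = ±A = ∓AΘ`), so products of
two raising (or two lowering) images vanish — the `J`-eigenvalue bookkeeping of Lemma (3.3). KEY LEMMA (§2,
`SymplecticWitness.mul_rankOne_eq_zero_of_apply_eq_zero`): for `x₁ ∈ P`, `y₁ ∈ Q`, `ω(x₁,y₁) = 1`, every
`Z ∈ 𝔰𝔭(M,ω)` with `Z x₁ = 0` has `ρ(Z) ρ(R_{x₁}) = 0` (grade `Z` by `ad T`; the Levi part splits as `Y_{x₁,q} +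
Z₀₀` with `[h, Y_{x₁,q}] = Y_{x₁,q}` for `h = [R_{x₁}, -R_{y₁}]` acting by `1` on `Im ρR_{x₁}`, and
`Z₀₀ = -∑ Y_{Z₀₀ c_i, p_i}` along a basis of `Q` and its dual family — `levi_eq_neg_sum_pairOp` — each term a
combination of `[R_p, Y_{q,q''}]`, `[R_p, R_{q''}]`). WITNESS (§3, `SymplecticWitness.exists_equivariant_ne_zero`):
`F v = ρ(X_v) a` with `a = ρ(R_{x₁})u ≠ 0`, `X_v = -Y_{v,y₁} + ω(v,x₁) f`, `X_v x₁ = v`; equivariant for the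
stabiliser of `x₁` by the key lemma, for `f = -R_{y₁}` by `ρ(f)ρ(Y_{v,y₁})ρ(R_{x₁}) = ω(y₁,v)ρ(f)ρ(R_{x₁})` (the
`h`-weight `-2` is impossible since `(ρh)² = ρeρf + ρfρe` is idempotent), and `𝔰𝔭 = 𝔰𝔭_{x₁} + [𝔰𝔭_{x₁}, f] +
ℂf`; `F x₁ = a ≠ 0`.

CONTENTS (all proved; no definition, no named fact):
* §0 operator lemmas for an involution `Θ` (`SymplecticWitness.theta_mul_of_bracket_eq_two_smul`, `…_neg_two_smul`,
  `mul_eq_zero_of_raise/lower/commute`); §1 pair-operator calculus (`pairOp_add_left`, `…_smul_left`, `…_comm`,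
  `…_zero_left`, `[R_p, Y_{q,q'}]`, `[R_p, R_q]`, `[Z, R_y]`) and the Levi expansion `levi_eq_neg_sum_pairOp`;
* §2 the key lemma; §3 `theta_comp_eq_of_equivariant`, `exists_equivariant_ne_zero`;
* §4 the Goursat step `goursat_incl_corner_mem_of_hom_eq_zero_of_rigid`;
* §5 the MAIN THEOREMS `incl_corner_mem_annLie_of_times_rigidSymplectic`,
  `incl₂_comp_proj_mem_spanC_annLie_of_times_rigidSymplectic`, `wordDerAt_incl₂_eq_zero_of_times_rigidSymplectic`,
  `incl₁_theta_proj_mem_spanC_annLie_of_times_rigidSymplectic`,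
  `wordDerAt_incl_proj_theta_eq_zero_of_times_rigidSymplectic` ((RIGID) a hypothesis, `V₂ ≠ 0`);
* §6 LOW RANK: `LowRankGeneric.mem_spanC_of_skew` ((RIGID) for `dim V₂ ∈ {2,4,6}`, `End_Hdg = ℚ`),
  `wordDerAt_incl₂_eq_zero_of_times_lowRankGeneric`, `wordDerAt_incl_proj_theta_eq_zero_of_times_lowRankGeneric`
  (the statements of the R22 theorems with `dim V₂ = 2` replaced by `dim V₂ ∈ {2, 4, 6}`).

## References

* [MoonenZarhin1999LowDim] B. Moonen, Yu. G. Zarhin, Math. Ann. 315 (1999) 711–733, §1 (1.6)–(1.7), §2 (2.4),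
  §3 (3.1), Lemma (3.3), Lemma (3.4), Remark (3.5), §5 (5.4) (held: `paper:arxiv-math_9901113` pp. 3–7, 9).
  [cite: MoonenZarhin1999LowDim, §3 Lemma (3.3) and Lemma (3.4)]
* [Bourbaki2008LieGroups79] N. Bourbaki, *Lie Groups and Lie Algebras, Chapters 7–9*, Ch. VIII §7 no. 3
  (minuscule weights; `C_ℓ`: the standard representation) and §13 (`𝔰𝔭_{2ℓ}`). [cite: Bourbaki2008LieGroups79, Ch. VIII §7 no. 3]
* [Deligne1982HodgeCycles] P. Deligne, *Hodge cycles on abelian varieties*, LNM 900 (1982), I §3 (proof of Prop.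
  3.4: rational structures, base change), Prop. 3.6 (`Hg` reductive). [cite: Deligne1982HodgeCycles, I §3 Prop. 3.4 and Prop. 3.6]
* [Hazama1989] F. Hazama, Duke Math. J. 58 (1989) 31–37 (Goursat for Hodge Lie algebras).
  [cite: Hazama1989, Thm. (= Gordon 7.6.2)]
* [GoodmanWallachGTM255] R. Goodman, N. R. Wallach, GTM 255 (2009), §1.1.2, §2.1.2 (`𝔰𝔭` in block form, root
  vectors), §4.1.1. [cite: GoodmanWallachGTM255, §2.1.2 and §4.1.1]
* [Humphreys1972] J. E. Humphreys, GTM 9 (1972), §1.2 (`𝔰𝔭_{2ℓ}`), §7.2 (`𝔰𝔩₂`-modules). [cite: Humphreys1972, §1.2 and §7.2]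
-/

noncomputable section

open scoped TensorProduct
open CategoryTheory Module

namespace Literature.AlgebraicGeometry.Motives

namespace HodgeStructure

open Literature.RepresentationTheory.GeneralLinear

/-! ### §0 Operator lemmas for an involution `Θ` -/

section OperatorLemmas

variable {W : Type*} [AddCommGroup W] [Module ℂ W]

/-- If `Θ² = 1` and `[Θ, A] = 2A` then `ΘA = A = -AΘ` (a raising operator for the grading of an involution).
[cite: GoodmanWallachGTM255, §4.1.1] -/
theorem SymplecticWitness.theta_mul_of_bracket_eq_two_smul {Θ A : Module.End ℂ W} (hΘΘ : Θ * Θ = 1)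
    (h : Θ * A - A * Θ = (2 : ℂ) • A) : Θ * A = A ∧ A * Θ = -A := by
  have h1 : Θ * (Θ * A - A * Θ) = (2 : ℂ) • (Θ * A) := by rw [h, mul_smul_comm]
  have h2 : (Θ * A - A * Θ) * Θ = (2 : ℂ) • (A * Θ) := by rw [h, smul_mul_assoc]
  rw [mul_sub, ← mul_assoc, hΘΘ, one_mul, ← mul_assoc] at h1
  rw [sub_mul, mul_assoc A Θ Θ, hΘΘ, mul_one] at h2
  -- `h1 : A - ΘAΘ = 2 ΘA`, `h2 : ΘAΘ - A = 2 AΘ`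
  have h3 : (2 : ℂ) • (Θ * A + A * Θ) = 0 := by
    rw [smul_add, ← h1, ← h2]; abel
  have h4 : Θ * A + A * Θ = 0 := (smul_eq_zero.1 h3).resolve_left two_ne_zero
  have h5 : A * Θ = -(Θ * A) := eq_neg_of_add_eq_zero_right h4
  have h6 : (2 : ℂ) • (Θ * A) = (2 : ℂ) • A := by
    rw [← h, h5, sub_neg_eq_add, two_smul]
  have h7 : Θ * A = A := smul_right_injective _ (two_ne_zero (α := ℂ)) h6
  refine ⟨h7, ?_⟩
  rw [h5, h7]

/-- If `Θ² = 1` and `[Θ, A] = -2A` then `ΘA = -A`, `AΘ = A` (a lowering operator). [cite: GoodmanWallachGTM255, §4.1.1] -/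
theorem SymplecticWitness.theta_mul_of_bracket_eq_neg_two_smul {Θ A : Module.End ℂ W} (hΘΘ : Θ * Θ = 1)
    (h : Θ * A - A * Θ = -((2 : ℂ) • A)) : Θ * A = -A ∧ A * Θ = A := by
  have hΘΘ' : (-Θ) * (-Θ) = 1 := by rw [neg_mul_neg, hΘΘ]
  have h' : (-Θ) * A - A * (-Θ) = (2 : ℂ) • A := by
    rw [neg_mul, mul_neg, neg_sub_neg, ← neg_sub, h, neg_neg]
  obtain ⟨h1, h2⟩ := SymplecticWitness.theta_mul_of_bracket_eq_two_smul hΘΘ' h'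
  rw [neg_mul, neg_eq_iff_eq_neg] at h1
  rw [mul_neg, neg_inj] at h2
  exact ⟨h1, h2⟩

/-- `A A' = 0` when `A Θ = -A` and `Θ A' = A'` (two raising operators compose to zero; in particular a raising
operator has square zero). [cite: GoodmanWallachGTM255, §4.1.1] -/
theorem SymplecticWitness.mul_eq_zero_of_raise {Θ A A' : Module.End ℂ W} (hA : A * Θ = -A)
    (hA' : Θ * A' = A') : A * A' = 0 := by
  have h : A * A' = -(A * A') := by
    conv_lhs => rw [← hA', ← mul_assoc, hA, neg_mul]
  have h2 : (2 : ℂ) • (A * A') = 0 := by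
    rw [two_smul]
    nth_rewrite 2 [h]
    exact add_neg_cancel _
  exact (smul_eq_zero.1 h2).resolve_left two_ne_zero

/-- `A A' = 0` when `A Θ = A` and `Θ A' = -A'` (two lowering operators compose to zero).
[cite: GoodmanWallachGTM255, §4.1.1] -/
theorem SymplecticWitness.mul_eq_zero_of_lower {Θ A A' : Module.End ℂ W} (hA : A * Θ = A)
    (hA' : Θ * A' = -A') : A * A' = 0 := by
  have h : A * A' = -(A * A') := by
    conv_lhs => rw [← hA, mul_assoc, hA', mul_neg]
  have h2 : (2 : ℂ) • (A * A') = 0 := by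
    rw [two_smul]
    nth_rewrite 2 [h]
    exact add_neg_cancel _
  exact (smul_eq_zero.1 h2).resolve_left two_ne_zero

/-- `E A = 0` when `A` commutes with `E`, `Θ E = E` and `Θ A = -A` (`E A` has image in the `+1`- and the
`-1`-eigenspace of the involution `Θ`). [cite: GoodmanWallachGTM255, §4.1.1] -/
theorem SymplecticWitness.mul_eq_zero_of_commute {Θ A E : Module.End ℂ W} (hc : A * E = E * A)
    (hE : Θ * E = E) (hA : Θ * A = -A) : E * A = 0 := by
  have h : E * A = -(E * A) := by
    conv_lhs => rw [← hE, mul_assoc, ← hc, ← mul_assoc, hA, neg_mul, hc]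
  have h2 : (2 : ℂ) • (E * A) = 0 := by
    rw [two_smul]
    nth_rewrite 2 [h]
    exact add_neg_cancel _
  exact (smul_eq_zero.1 h2).resolve_left two_ne_zero

end OperatorLemmas

/-! ### §1 Pair operators, root vectors, and the expansion of a Levi element along a dual system -/

section PairOps

variable {M : Type*} [AddCommGroup M] [Module ℂ M]

/-- `Y_{a,b}` is additive in its first argument. [cite: GoodmanWallachGTM255, §2.1.2] -/
theorem SymplecticWitness.pairOp_add_left (ω : LinearMap.BilinForm ℂ M) (a a' b : M) :
    (ω (a + a')).smulRight b + (ω b).smulRight (a + a') =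
      ((ω a).smulRight b + (ω b).smulRight a) + ((ω a').smulRight b + (ω b).smulRight a') := by
  apply LinearMap.ext
  intro v
  simp only [LinearMap.add_apply, LinearMap.smulRight_apply, map_add, smul_add, add_smul]
  abel

/-- `Y_{c a, b} = c Y_{a,b}`. [cite: GoodmanWallachGTM255, §2.1.2] -/
theorem SymplecticWitness.pairOp_smul_left (ω : LinearMap.BilinForm ℂ M) (c : ℂ) (a b : M) :
    (ω (c • a)).smulRight b + (ω b).smulRight (c • a) = c • ((ω a).smulRight b + (ω b).smulRight a) := by
  apply LinearMap.ext
  intro v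
  simp only [LinearMap.add_apply, LinearMap.smulRight_apply, LinearMap.smul_apply, map_smul, smul_eq_mul,
    smul_add, smul_smul, mul_comm (ω b v) c]

/-- `Y_{a,b} = Y_{b,a}`. [cite: GoodmanWallachGTM255, §2.1.2] -/
theorem SymplecticWitness.pairOp_comm (ω : LinearMap.BilinForm ℂ M) (a b : M) :
    (ω a).smulRight b + (ω b).smulRight a = (ω b).smulRight a + (ω a).smulRight b := add_comm _ _

/-- `Y_{0,b} = 0`. [cite: GoodmanWallachGTM255, §2.1.2] -/
theorem SymplecticWitness.pairOp_zero_left (ω : LinearMap.BilinForm ℂ M) (b : M) :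
    (ω (0 : M)).smulRight b + (ω b).smulRight (0 : M) = 0 := by
  apply LinearMap.ext
  intro v
  simp only [LinearMap.add_apply, LinearMap.smulRight_apply, map_zero, LinearMap.zero_apply, zero_smul,
    smul_zero, add_zero]

/-- **`[R_p, Y_{q,q'}] = ω(p,q') Y_{p,q} + ω(p,q) Y_{p,q'}`** for the rank-one skew `R_p = ω(p, ·) ⊗ p` and `ω`
alternating (a root vector of `𝔲⁺` against one of `𝔲⁻` gives the Levi). [cite: GoodmanWallachGTM255, §2.1.2]
[cite: Humphreys1972, §1.2] -/
theorem SymplecticWitness.smulRight_self_bracket_pairOp (ω : LinearMap.BilinForm ℂ M)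
    (hωalt : ∀ x y, ω x y = -ω y x) (p q q' : M) :
    (ω p).smulRight p * ((ω q).smulRight q' + (ω q').smulRight q) -
        ((ω q).smulRight q' + (ω q').smulRight q) * (ω p).smulRight p =
      ω p q' • ((ω p).smulRight q + (ω q).smulRight p) + ω p q • ((ω p).smulRight q' + (ω q').smulRight p) := by
  apply LinearMap.ext
  intro v
  have h1 : ω q p = -ω p q := hωalt q p
  have h2 : ω q' p = -ω p q' := hωalt q' p
  simp only [LinearMap.sub_apply, Module.End.mul_apply, LinearMap.add_apply, LinearMap.smulRight_apply,
    LinearMap.smul_apply, map_add, map_smul, h1, h2, smul_add, smul_smul]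
  module

/-- **`[R_p, R_q] = ω(p,q) Y_{p,q}`**. [cite: GoodmanWallachGTM255, §2.1.2] [cite: Humphreys1972, §1.2] -/
theorem SymplecticWitness.smulRight_self_bracket_smulRight_self (ω : LinearMap.BilinForm ℂ M)
    (hωalt : ∀ x y, ω x y = -ω y x) (p q : M) :
    (ω p).smulRight p * (ω q).smulRight q - (ω q).smulRight q * (ω p).smulRight p =
      ω p q • ((ω p).smulRight q + (ω q).smulRight p) := by
  apply LinearMap.ext
  intro v
  have h1 : ω q p = -ω p q := hωalt q p
  simp only [LinearMap.sub_apply, Module.End.mul_apply, LinearMap.add_apply, LinearMap.smulRight_apply,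
    LinearMap.smul_apply, map_smul, h1, smul_add, smul_smul]
  module

/-- **`[Z, R_y] = Y_{y, Zy}`** for `ω`-skew `Z` (the derivation rule on rank-one operators).
[cite: GoodmanWallachGTM255, §2.1.2] -/
theorem SymplecticWitness.bracket_smulRight_self (ω : LinearMap.BilinForm ℂ M) {Z : Module.End ℂ M}
    (hZ : ∀ x y, ω (Z x) y + ω x (Z y) = 0) (y : M) :
    Z * (ω y).smulRight y - (ω y).smulRight y * Z = (ω y).smulRight (Z y) + (ω (Z y)).smulRight y := by
  apply LinearMap.ext
  intro v
  have h1 : ω y (Z v) = -ω (Z y) v := by linear_combination hZ y v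
  simp only [LinearMap.sub_apply, Module.End.mul_apply, LinearMap.add_apply, LinearMap.smulRight_apply,
    map_smul, h1, neg_smul, sub_neg_eq_add]

/-- **Expansion of a Levi element along a dual system: `L = -∑ Y_{L b_i, q_i}`** for `L` skew commuting with
`T`, `b` a basis of `P` and `q_i ∈ Q` the `ω`-dual family (`T = L = id|_P` is `theta_eq_neg_sum_pairOp`).
[cite: GoodmanWallachGTM255, §1.1.2 and §2.1.2] -/
theorem SymplecticWitness.levi_eq_neg_sum_pairOp [FiniteDimensional ℂ M] (ω : LinearMap.BilinForm ℂ M)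
    (hωnd : ω.Nondegenerate) (hωalt : ∀ x y, ω x y = -ω y x) {T : Module.End ℂ M}
    (hTskew : ∀ x y, ω (T x) y + ω x (T y) = 0) {P Q : Submodule ℂ M}
    (hP : ∀ x ∈ P, T x = x) (hQ : ∀ x ∈ Q, T x = -x) (hPmem : ∀ v, (2 : ℂ)⁻¹ • (v + T v) ∈ P)
    (hQmem : ∀ v, (2 : ℂ)⁻¹ • (v - T v) ∈ Q) {ι : Type*} [Fintype ι] (b : Module.Basis ι ℂ ↥P)
    {q : ι → M} (hqQ : ∀ i, q i ∈ Q) (hq : ∀ i j, ω (b j : M) (q i) = b.coord i (b j))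
    {L : Module.End ℂ M} (hLskew : ∀ x y, ω (L x) y + ω x (L y) = 0) (hLT : ∀ v, T (L v) = L (T v)) :
    L = -∑ i, ((ω (L (b i : M))).smulRight (q i) + (ω (q i)).smulRight (L (b i : M))) := by
  classical
  have hPP := SymplecticIdeal.isotropic_of_skew_involution ω hTskew hP
  have hQQ := SymplecticIdeal.isotropic_of_skew_involution_neg ω hTskew hQ
  have hTfix : ∀ x, T x = x → x ∈ P := fun x hx => by
    have h := hPmem x
    rwa [hx, ← two_smul ℂ x, smul_smul, inv_mul_cancel₀ (two_ne_zero' ℂ), one_smul] at h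
  have hTneg : ∀ x, T x = -x → x ∈ Q := fun x hx => by
    have h := hQmem x
    rwa [hx, sub_neg_eq_add, ← two_smul ℂ x, smul_smul, inv_mul_cancel₀ (two_ne_zero' ℂ), one_smul] at h
  have hLP : ∀ p ∈ P, L p ∈ P := fun p hp => hTfix _ (by rw [hLT, hP p hp])
  have hLQ : ∀ y ∈ Q, L y ∈ Q := fun y hy => hTneg _ (by rw [hLT, hQ y hy, map_neg])
  have hq' : ∀ i j, ω (b j : M) (q i) = if j = i then 1 else 0 := fun i j => by
    rw [hq, Module.Basis.coord_apply, Module.Basis.repr_self, Finsupp.single_apply]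
  -- expansion of elements of `P` along `b` via the dual family
  have hexpandP : ∀ x ∈ P, x = ∑ i, ω x (q i) • (b i : M) := by
    intro x hx
    have h1 : x = ∑ i, b.repr ⟨x, hx⟩ i • (b i : M) := by
      have h := congrArg Subtype.val (b.sum_repr ⟨x, hx⟩)
      simp only [Submodule.coe_sum, Submodule.coe_smul] at h
      exact h.symm
    have h2 : ∀ i, ω x (q i) = b.repr ⟨x, hx⟩ i := fun i => by
      conv_lhs => rw [h1]
      simp only [map_sum, map_smul, LinearMap.sum_apply, LinearMap.smul_apply, smul_eq_mul, hq']
      rw [Finset.sum_eq_single i]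
      · rw [if_pos rfl, mul_one]
      · intro j _ hji
        rw [if_neg hji, mul_zero]
      · intro hi
        exact absurd (Finset.mem_univ i) hi
    conv_lhs => rw [h1]
    exact Finset.sum_congr rfl fun i _ => by rw [h2 i]
  have hLexpand : ∀ x ∈ P, L x = ∑ i, ω x (q i) • L (b i : M) := by
    intro x hx
    conv_lhs => rw [hexpandP x hx]
    rw [map_sum]
    exact Finset.sum_congr rfl fun i _ => by rw [map_smul]
  set S : Module.End ℂ M := ∑ i, ((ω (L (b i : M))).smulRight (q i) + (ω (q i)).smulRight (L (b i : M)))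
    with hS
  have hSapply : ∀ v, S v = ∑ i, (ω (L (b i : M)) v • q i + ω (q i) v • L (b i : M)) := fun v => by
    rw [hS, LinearMap.sum_apply]
    exact Finset.sum_congr rfl fun i _ => SymplecticIdeal.pairOp_apply ω _ _ v
  have hSP : ∀ p ∈ P, S p = -L p := by
    intro p hp
    rw [hSapply]
    have h : ∀ i, ω (L (b i : M)) p • q i + ω (q i) p • L (b i : M) = -(ω p (q i) • L (b i : M)) := fun i => by
      rw [hPP _ (hLP _ (b i).2) p hp, zero_smul, zero_add, hωalt (q i) p, neg_smul]
    simp only [h, Finset.sum_neg_distrib]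
    rw [← hLexpand p hp]
  have hSQ : ∀ y ∈ Q, S y = -L y := by
    intro y hy
    rw [hSapply]
    have h : ∀ i, ω (L (b i : M)) y • q i + ω (q i) y • L (b i : M) = ω (L (b i : M)) y • q i := fun i => by
      rw [hQQ _ (hqQ i) y hy, zero_smul, add_zero]
    simp only [h]
    -- `∑ ω(L b_i, y) q_i + L y ∈ Q` is `ω`-orthogonal to `P`
    have hmem : (∑ i, ω (L (b i : M)) y • q i) + L y ∈ Q :=
      Submodule.add_mem _ (Submodule.sum_mem _ fun i _ => Submodule.smul_mem _ _ (hqQ i)) (hLQ y hy)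
    have hzero := SymplecticIdeal.eq_zero_of_forall_P ω hωnd hωalt hTskew hQ hPmem hQmem hmem fun p hp => by
      rw [map_add, map_sum]
      simp only [map_smul, smul_eq_mul]
      have h3 : ω p (L y) = -∑ i, ω p (q i) * ω (L (b i : M)) y := by
        have h4 : ω p (L y) = -ω (L p) y := by linear_combination hLskew p y
        rw [h4, hLexpand p hp, map_sum, LinearMap.sum_apply]
        congr 1
        refine Finset.sum_congr rfl fun i _ => ?_
        rw [map_smul, LinearMap.smul_apply, smul_eq_mul]
      rw [h3]
      simp only [mul_comm (ω p (q _)) _, add_neg_cancel]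
    exact eq_neg_of_add_eq_zero_left hzero
  apply LinearMap.ext
  intro v
  have hv : (2 : ℂ)⁻¹ • (v + T v) + (2 : ℂ)⁻¹ • (v - T v) = v := by module
  rw [LinearMap.neg_apply, ← hv, map_add, map_add, hSP _ (hPmem v), hSQ _ (hQmem v), neg_add, neg_neg, neg_neg]

end PairOps

/-! ### §2 The key lemma: the stabiliser of `x₁` kills the highest line `Im ρ(R_{x₁})` -/

section KeyLemma

variable {M W : Type*} [AddCommGroup M] [Module ℂ M] [AddCommGroup W] [Module ℂ W]

/-- **Key lemma (the stabiliser of `x₁` kills the highest line).** Setting: `ω` nondegenerate alternating on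
`M`, `T` an `ω`-skew involution with eigenspaces `P ∋ x₁`, `Q ∋ y₁`, `ω(x₁, y₁) = 1`; `𝔰 = 𝔰𝔭(M, ω)` the skew
operators; `ρ : 𝔰 → End(W)` linear, bracket-preserving, with `ρ[T, Y] = [Θ, ρ Y]` for an involution `Θ` of
`W`. Then for every `Z ∈ 𝔰` with `Z x₁ = 0` one has `ρ(Z) ρ(R_{x₁}) = 0`, `R_{x₁} = ω(x₁, ·) ⊗ x₁` the root
vector of the highest weight of the standard representation: grade `Z = Z₊ + Z₋ + Z₀` by `ad T`; `ρ Z₊` is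
`Θ`-raising like `ρ R_{x₁}` (product zero); `Z₋` commutes with `R_{x₁}`, so `ρ R_{x₁} ρ Z₋` is raising and
lowering at once; `Z₀ = Y_{x₁, Z₀y₁} + Z₀₀` with `[h, Y_{x₁,q}] = Y_{x₁,q}` (`h = [R_{x₁}, -R_{y₁}]` acts by `1`
on the image of `ρ R_{x₁}`, so `ρ Y_{x₁,q}` would double that eigenvalue), and `Z₀₀ ∈ 𝔤𝔩(P ∩ y₁^⊥)` is a sum
`-∑ Y_{Z₀₀ c_i, p_i}` of brackets `[R_p, Y_{q,q''}]`, `[R_p, R_{q''}]` of operators already treated. This is the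
weight bookkeeping of Moonen–Zarhin's Lemma (3.3) («if `λ` is an eigenvalue of `J₂` … both `i + λ` and `-i + λ`
occur as eigenvalues of `J_Y` … possible only if `λ = 0`») in the form needed for an arbitrary first factor.
[cite: MoonenZarhin1999LowDim, §3 Lemma (3.3) and Lemma (3.4)] [cite: GoodmanWallachGTM255, §2.1.2 and §4.1.1]
[cite: Humphreys1972, §7.2] -/
theorem SymplecticWitness.mul_rankOne_eq_zero_of_apply_eq_zero [FiniteDimensional ℂ M]
    (ω : LinearMap.BilinForm ℂ M) (hωnd : ω.Nondegenerate) (hωalt : ∀ x y, ω x y = -ω y x)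
    {T : Module.End ℂ M} (hTT : ∀ v, T (T v) = v) (hTskew : ∀ x y, ω (T x) y + ω x (T y) = 0)
    {P Q : Submodule ℂ M} (hP : ∀ x ∈ P, T x = x) (hQ : ∀ x ∈ Q, T x = -x)
    (hPmem : ∀ v, (2 : ℂ)⁻¹ • (v + T v) ∈ P) (hQmem : ∀ v, (2 : ℂ)⁻¹ • (v - T v) ∈ Q)
    (𝔰 : Submodule ℂ (Module.End ℂ M)) (h𝔰 : ∀ Y, Y ∈ 𝔰 ↔ ∀ x y, ω (Y x) y + ω x (Y y) = 0)
    {Θ : Module.End ℂ W} (hΘΘ : ∀ w, Θ (Θ w) = w) (ρ : Module.End ℂ M →ₗ[ℂ] Module.End ℂ W)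
    (hρbr : ∀ Y ∈ 𝔰, ∀ Y' ∈ 𝔰, ρ (Y * Y' - Y' * Y) = ρ Y * ρ Y' - ρ Y' * ρ Y)
    (hρΘ : ∀ Y ∈ 𝔰, ρ (T * Y - Y * T) = Θ * ρ Y - ρ Y * Θ)
    {x₁ y₁ : M} (hx₁ : x₁ ∈ P) (hy₁ : y₁ ∈ Q) (h11 : ω x₁ y₁ = 1)
    {Z : Module.End ℂ M} (hZ : Z ∈ 𝔰) (hZx : Z x₁ = 0) :
    ρ Z * ρ ((ω x₁).smulRight x₁) = 0 := by
  classical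
  -- preliminaries on `T`, `P`, `Q`
  have hΘ2 : Θ * Θ = 1 := LinearMap.ext fun w => by rw [Module.End.mul_apply, hΘΘ, Module.End.one_apply]
  have hPP := SymplecticIdeal.isotropic_of_skew_involution ω hTskew hP
  have hQQ := SymplecticIdeal.isotropic_of_skew_involution_neg ω hTskew hQ
  have hTfix : ∀ x, T x = x → x ∈ P := fun x hx => by
    have h := hPmem x
    rwa [hx, ← two_smul ℂ x, smul_smul, inv_mul_cancel₀ (two_ne_zero' ℂ), one_smul] at h
  have hTneg : ∀ x, T x = -x → x ∈ Q := fun x hx => by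
    have h := hQmem x
    rwa [hx, sub_neg_eq_add, ← two_smul ℂ x, smul_smul, inv_mul_cancel₀ (two_ne_zero' ℂ), one_smul] at h
  have hdetP : ∀ x ∈ P, (∀ q ∈ Q, ω x q = 0) → x = 0 :=
    fun x hx hxQ => SymplecticIdeal.eq_zero_of_forall_Q ω hωnd hTskew hP hPmem hQmem hx hxQ
  have hdetQ : ∀ y ∈ Q, (∀ p ∈ P, ω p y = 0) → y = 0 :=
    fun y hy hyP => SymplecticIdeal.eq_zero_of_forall_P ω hωnd hωalt hTskew hQ hPmem hQmem hy hyP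
  have hωTP : ∀ a ∈ P, ∀ v, ω a (T v) = -ω a v := fun a ha v => by
    have h := hTskew a v
    rw [hP a ha] at h
    linear_combination h
  have hωTQ : ∀ a ∈ Q, ∀ v, ω a (T v) = ω a v := fun a ha v => by
    have h := hTskew a v
    rw [hQ a ha, map_neg, LinearMap.neg_apply] at h
    linear_combination h
  have hy1x : ω y₁ x₁ = -1 := by rw [hωalt, h11]
  -- the skew operators
  have hsk : ∀ Y ∈ 𝔰, ∀ x y, ω (Y x) y + ω x (Y y) = 0 := fun Y hY => (h𝔰 Y).1 hY
  have h𝔰br : ∀ Y ∈ 𝔰, ∀ Y' ∈ 𝔰, Y * Y' - Y' * Y ∈ 𝔰 := by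
    intro Y hY Y' hY'
    rw [h𝔰] at hY hY' ⊢
    intro x y
    simp only [LinearMap.sub_apply, Module.End.mul_apply, map_sub, LinearMap.sub_apply]
    have h1 := hY (Y' x) y
    have h2 := hY' x (Y y)
    have h3 := hY' (Y x) y
    have h4 := hY x (Y' y)
    linear_combination h1 - h3 + h4 - h2
  have hT𝔰 : T ∈ 𝔰 := (h𝔰 T).2 hTskew
  have hR𝔰 : ∀ a : M, (ω a).smulRight a ∈ 𝔰 := fun a =>
    (h𝔰 _).2 (SymplecticIdeal.smulRight_self_skew ω hωalt a)
  have hY𝔰 : ∀ a b : M, (ω a).smulRight b + (ω b).smulRight a ∈ 𝔰 := fun a b =>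
    (h𝔰 _).2 (SymplecticIdeal.pairOp_skew ω hωalt a b)
  -- `Θ`-grading of `ρ Y` from the `T`-grading of `Y`
  have hraiseρ : ∀ Y ∈ 𝔰, T * Y - Y * T = (2 : ℂ) • Y → Θ * ρ Y = ρ Y ∧ ρ Y * Θ = -ρ Y :=
    fun Y hY h => SymplecticWitness.theta_mul_of_bracket_eq_two_smul hΘ2 (by rw [← hρΘ Y hY, h, map_smul])
  have hlowerρ : ∀ Y ∈ 𝔰, T * Y - Y * T = -((2 : ℂ) • Y) → Θ * ρ Y = -ρ Y ∧ ρ Y * Θ = ρ Y :=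
    fun Y hY h => SymplecticWitness.theta_mul_of_bracket_eq_neg_two_smul hΘ2
      (by rw [← hρΘ Y hY, h, map_neg, map_smul])
  -- the `T`-degrees of root vectors
  have hTR_P : ∀ a ∈ P, T * (ω a).smulRight a - (ω a).smulRight a * T = (2 : ℂ) • (ω a).smulRight a := by
    intro a ha
    apply LinearMap.ext
    intro v
    simp only [LinearMap.sub_apply, Module.End.mul_apply, LinearMap.smul_apply, LinearMap.smulRight_apply,
      map_smul, hP a ha, hωTP a ha]
    module
  have hTR_Q : ∀ a ∈ Q, T * (ω a).smulRight a - (ω a).smulRight a * T = -((2 : ℂ) • (ω a).smulRight a) := by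
    intro a ha
    apply LinearMap.ext
    intro v
    simp only [LinearMap.sub_apply, Module.End.mul_apply, LinearMap.smul_apply, LinearMap.smulRight_apply,
      LinearMap.neg_apply, map_smul, hQ a ha, hωTQ a ha]
    module
  have hTY_QQ : ∀ a ∈ Q, ∀ b ∈ Q, T * ((ω a).smulRight b + (ω b).smulRight a) -
      ((ω a).smulRight b + (ω b).smulRight a) * T = -((2 : ℂ) • ((ω a).smulRight b + (ω b).smulRight a)) := by
    intro a ha b hb
    apply LinearMap.ext
    intro v
    simp only [LinearMap.sub_apply, Module.End.mul_apply, LinearMap.smul_apply, LinearMap.add_apply,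
      LinearMap.smulRight_apply, LinearMap.neg_apply, map_add, map_smul, hQ a ha, hQ b hb, hωTQ a ha, hωTQ b hb]
    module
  -- the root vector `e = R_{x₁}` and `E = ρ e`
  obtain ⟨e, he⟩ : ∃ e : Module.End ℂ M, e = (ω x₁).smulRight x₁ := ⟨_, rfl⟩
  have he𝔰 : e ∈ 𝔰 := he ▸ hR𝔰 x₁
  have heapp : ∀ v, e v = ω x₁ v • x₁ := fun v => by rw [he, LinearMap.smulRight_apply]
  have hTe : T * e - e * T = (2 : ℂ) • e := he ▸ hTR_P x₁ hx₁
  obtain ⟨hΘE, hEΘ⟩ := hraiseρ e he𝔰 hTe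
  rw [← he]
  -- two killing mechanisms: raising partners, and lowering partners commuting with `e`
  have hkillU : ∀ Y ∈ 𝔰, T * Y - Y * T = (2 : ℂ) • Y → ρ Y * ρ e = 0 :=
    fun Y hY h => SymplecticWitness.mul_eq_zero_of_raise (hraiseρ Y hY h).2 hΘE
  have hkillL : ∀ Y ∈ 𝔰, T * Y - Y * T = -((2 : ℂ) • Y) → Y * e = e * Y → ρ Y * ρ e = 0 := by
    intro Y hY h hc
    have hcρ : ρ Y * ρ e = ρ e * ρ Y := by
      have h1 := hρbr Y hY e he𝔰
      rw [hc, sub_self, map_zero] at h1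
      exact (sub_eq_zero.1 h1.symm)
    rw [hcρ]
    exact SymplecticWitness.mul_eq_zero_of_commute hcρ hΘE (hlowerρ Y hY h).1
  -- the lowering operator `f = -R_{y₁}`, `h = [e, f]`, and the `𝔰𝔩₂`-relations of `E, F, H`
  obtain ⟨f, hf⟩ : ∃ f : Module.End ℂ M, f = -((ω y₁).smulRight y₁) := ⟨_, rfl⟩
  have hf𝔰 : f ∈ 𝔰 := hf ▸ 𝔰.neg_mem (hR𝔰 y₁)
  have hfapp : ∀ v, f v = -(ω y₁ v • y₁) := fun v => by rw [hf, LinearMap.neg_apply, LinearMap.smulRight_apply]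
  obtain ⟨h₀, hh₀⟩ : ∃ h₀ : Module.End ℂ M, h₀ = e * f - f * e := ⟨_, rfl⟩
  have hh₀𝔰 : h₀ ∈ 𝔰 := hh₀ ▸ h𝔰br e he𝔰 f hf𝔰
  have hh₀Y : h₀ = -((ω x₁).smulRight y₁ + (ω y₁).smulRight x₁) := by
    rw [hh₀]
    apply LinearMap.ext
    intro v
    simp only [LinearMap.sub_apply, Module.End.mul_apply, LinearMap.neg_apply, LinearMap.add_apply,
      LinearMap.smulRight_apply, heapp, hfapp, map_smul, map_neg, smul_eq_mul, h11, hy1x]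
    module
  have hh₀e : h₀ * e - e * h₀ = (2 : ℂ) • e := by
    apply LinearMap.ext
    intro v
    have h1 : ω x₁ x₁ = 0 := hPP x₁ hx₁ x₁ hx₁
    simp only [hh₀Y, LinearMap.sub_apply, Module.End.mul_apply, LinearMap.neg_apply, LinearMap.add_apply,
      LinearMap.smul_apply, LinearMap.smulRight_apply, heapp, map_smul, map_neg, map_add, smul_eq_mul, h11,
      hy1x, h1]
    module
  have hρh₀ : ρ h₀ = ρ e * ρ f - ρ f * ρ e := by rw [hh₀, hρbr e he𝔰 f hf𝔰]
  have hHE2 : ρ h₀ * ρ e - ρ e * ρ h₀ = (2 : ℂ) • ρ e := by rw [← hρbr h₀ hh₀𝔰 e he𝔰, hh₀e, map_smul]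
  have hEE : ρ e * ρ e = 0 := SymplecticWitness.mul_eq_zero_of_raise hEΘ hΘE
  have hEFE : ρ e * ρ f * ρ e = ρ e := by
    have h := hHE2
    rw [hρh₀] at h
    have h' : (2 : ℂ) • (ρ e * ρ f * ρ e) = (2 : ℂ) • ρ e := by
      rw [← h, two_smul, sub_mul, mul_sub, mul_assoc (ρ f) (ρ e) (ρ e), hEE, mul_zero, sub_zero, ← mul_assoc,
        hEE, zero_mul, zero_sub, sub_neg_eq_add, mul_assoc]
    exact smul_right_injective _ (two_ne_zero (α := ℂ)) h'
  have hHE : ρ h₀ * ρ e = ρ e := by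
    rw [hρh₀, sub_mul, mul_assoc (ρ f) (ρ e) (ρ e), hEE, mul_zero, sub_zero, hEFE]
  -- (S1) `ρ Y_{x₁, q}` kills the image of `E` for `q ∈ Q ∩ x₁^⊥` (the `h`-weight would be `2`)
  have hS1 : ∀ q ∈ Q, ω x₁ q = 0 → ρ ((ω x₁).smulRight q + (ω q).smulRight x₁) * ρ e = 0 := by
    intro q hq hq0
    obtain ⟨B, hB⟩ : ∃ B : Module.End ℂ M, B = (ω x₁).smulRight q + (ω q).smulRight x₁ := ⟨_, rfl⟩
    rw [← hB]
    have hB𝔰 : B ∈ 𝔰 := hB ▸ hY𝔰 x₁ q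
    have hx1x1 : ω x₁ x₁ = 0 := hPP x₁ hx₁ x₁ hx₁
    have hqx1 : ω q x₁ = 0 := by rw [hωalt, hq0, neg_zero]
    -- `[h₀, B] = B`
    have hhB : h₀ * B - B * h₀ = B := by
      have hbr := SymplecticIdeal.pairOp_bracket ω hωalt hPP hQQ hx₁ hx₁ hy₁ hq
      rw [hh₀Y, hB, neg_mul, mul_neg, ← neg_sub', hbr, hq0, zero_smul, h11, one_smul, zero_sub, neg_neg]
    -- `[B, e] = 0`
    have hBe : B * e = e * B := by
      apply LinearMap.ext
      intro v
      simp only [hB, Module.End.mul_apply, LinearMap.add_apply, LinearMap.smulRight_apply, heapp, map_add,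
        map_smul, smul_eq_mul, hx1x1, hq0, hqx1]
      module
    have hHA : ρ h₀ * ρ B = ρ B * ρ h₀ + ρ B := by
      have h1 := hρbr h₀ hh₀𝔰 B hB𝔰
      rw [hhB] at h1
      rw [sub_eq_iff_eq_add.1 h1.symm, add_comm]
    have hAE : ρ B * ρ e = ρ e * ρ B := by
      have h1 := hρbr B hB𝔰 e he𝔰
      rw [hBe, sub_self, map_zero] at h1
      exact sub_eq_zero.1 h1.symm
    have h1 : ρ h₀ * (ρ B * ρ e) = ρ B * ρ e := by rw [hAE, ← mul_assoc, hHE]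
    have h2 : ρ h₀ * (ρ B * ρ e) = ρ B * ρ e + ρ B * ρ e := by
      rw [← mul_assoc, hHA, add_mul, mul_assoc, hHE]
    have h3 : ρ B * ρ e + ρ B * ρ e = ρ B * ρ e + 0 := by rw [add_zero]; exact h2.symm.trans h1
    exact add_left_cancel h3
  -- (S2) `ρ Y_{p, q}` kills the image of `E` for `p ∈ P`, `q ∈ Q ∩ x₁^⊥` (brackets of root vectors)
  have hS2 : ∀ p ∈ P, ∀ q ∈ Q, ω x₁ q = 0 → ρ ((ω p).smulRight q + (ω q).smulRight p) * ρ e = 0 := by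
    intro p hp q hq hq0
    -- split `p = p' + ω(p, y₁) x₁` with `p' ⊥ y₁`
    obtain ⟨p', hp'⟩ : ∃ p' : M, p' = p - ω p y₁ • x₁ := ⟨_, rfl⟩
    have hp'P : p' ∈ P := hp' ▸ P.sub_mem hp (P.smul_mem _ hx₁)
    have hp'y : ω p' y₁ = 0 := by
      rw [hp', map_sub, map_smul, LinearMap.sub_apply, LinearMap.smul_apply, h11, smul_eq_mul, mul_one, sub_self]
    have hdec : (ω p).smulRight q + (ω q).smulRight p =
        ((ω p').smulRight q + (ω q).smulRight p') + ω p y₁ • ((ω x₁).smulRight q + (ω q).smulRight x₁) := by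
      have hpeq : p = p' + ω p y₁ • x₁ := by rw [hp', sub_add_cancel]
      conv_lhs => rw [hpeq]
      rw [SymplecticWitness.pairOp_add_left, SymplecticWitness.pairOp_smul_left]
    rw [hdec, map_add, map_smul, add_mul, smul_mul_assoc, hS1 q hq hq0, smul_zero, add_zero]
    -- the `p'`-part: `Y_{p',q} = [R_{p'}, Y_{q,q''}] - ω(p',q) [R_{p'}, R_{q''}]` with `ω(p', q'') = 1`, `q'' ⊥ x₁`
    by_cases hp'0 : p' = 0
    · rw [hp'0, SymplecticWitness.pairOp_zero_left, map_zero, zero_mul]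
    obtain ⟨q₀, hq₀, hq₀ne⟩ : ∃ q₀ ∈ Q, ω p' q₀ ≠ 0 := by
      by_contra h
      push Not at h
      exact hp'0 (hdetP p' hp'P h)
    obtain ⟨q'', hq''⟩ : ∃ q'' : M, q'' = (ω p' q₀)⁻¹ • q₀ - ((ω p' q₀)⁻¹ * ω x₁ q₀) • y₁ := ⟨_, rfl⟩
    have hq''Q : q'' ∈ Q := hq'' ▸ Q.sub_mem (Q.smul_mem _ hq₀) (Q.smul_mem _ hy₁)
    have hp'q'' : ω p' q'' = 1 := by
      rw [hq'', map_sub, map_smul, map_smul, hp'y, smul_eq_mul, smul_eq_mul, mul_zero, sub_zero,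
        inv_mul_cancel₀ hq₀ne]
    have hx1q'' : ω x₁ q'' = 0 := by
      rw [hq'', map_sub, map_smul, map_smul, h11, smul_eq_mul, smul_eq_mul, mul_one, mul_comm, sub_self]
    have hI1 := SymplecticWitness.smulRight_self_bracket_pairOp ω hωalt p' q q''
    have hI2 := SymplecticWitness.smulRight_self_bracket_smulRight_self ω hωalt p' q''
    rw [hp'q'', one_smul] at hI1 hI2
    have hexpr : (ω p').smulRight q + (ω q).smulRight p' =
        ((ω p').smulRight p' * ((ω q).smulRight q'' + (ω q'').smulRight q) -
          ((ω q).smulRight q'' + (ω q'').smulRight q) * (ω p').smulRight p') -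
        ω p' q • ((ω p').smulRight p' * (ω q'').smulRight q'' - (ω q'').smulRight q'' * (ω p').smulRight p') := by
      rw [hI1, hI2, add_sub_cancel_right]
    -- the three partners kill `Im E`
    have hk1 : ρ ((ω p').smulRight p') * ρ e = 0 := hkillU _ (hR𝔰 p') (hTR_P p' hp'P)
    have hk2 : ρ ((ω q).smulRight q'' + (ω q'').smulRight q) * ρ e = 0 := by
      refine hkillL _ (hY𝔰 q q'') (hTY_QQ q hq q'' hq''Q) ?_
      have h := SymplecticWitness.smulRight_self_bracket_pairOp ω hωalt x₁ q q''
      rw [hx1q'', hq0, zero_smul, zero_smul, add_zero, ← he] at h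
      exact (sub_eq_zero.1 h).symm
    have hk3 : ρ ((ω q'').smulRight q'') * ρ e = 0 := by
      refine hkillL _ (hR𝔰 q'') (hTR_Q q'' hq''Q) ?_
      have h := SymplecticWitness.smulRight_self_bracket_smulRight_self ω hωalt x₁ q''
      rw [hx1q'', zero_smul, ← he] at h
      exact (sub_eq_zero.1 h).symm
    rw [hexpr, map_sub, map_smul, hρbr _ (hR𝔰 p') _ (hY𝔰 q q''), hρbr _ (hR𝔰 p') _ (hR𝔰 q''), sub_mul,
      smul_mul_assoc, sub_mul, sub_mul, mul_assoc, hk2, mul_zero, mul_assoc, hk1, mul_zero, sub_zero, mul_assoc,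
      hk3, mul_zero, mul_assoc, hk1, mul_zero, sub_zero, smul_zero, sub_zero]
  -- THE GRADING OF `Z`: `Z = Z₊ + Z₋ + Z₀`
  obtain ⟨Zp, hZp⟩ : ∃ X : Module.End ℂ M, X = (4 : ℂ)⁻¹ • (Z + T * Z - Z * T - T * Z * T) := ⟨_, rfl⟩
  obtain ⟨Zm, hZm⟩ : ∃ X : Module.End ℂ M, X = (4 : ℂ)⁻¹ • (Z - T * Z + Z * T - T * Z * T) := ⟨_, rfl⟩
  obtain ⟨Z₀, hZ₀⟩ : ∃ X : Module.End ℂ M, X = (2 : ℂ)⁻¹ • (Z + T * Z * T) := ⟨_, rfl⟩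
  have hTZT : T * Z * T ∈ 𝔰 := by
    rw [h𝔰]
    intro x y
    simp only [Module.End.mul_apply]
    have h1 := hTskew (Z (T x)) y
    have h2 := hsk Z hZ (T x) (T y)
    have h3 := hTskew x (Z (T y))
    linear_combination h1 - h2 + h3
  have hTZ : T * Z - Z * T ∈ 𝔰 := h𝔰br T hT𝔰 Z hZ
  have hZp𝔰 : Zp ∈ 𝔰 := by
    have h : Zp = (4 : ℂ)⁻¹ • (Z - T * Z * T) + (4 : ℂ)⁻¹ • (T * Z - Z * T) := by rw [hZp]; module
    rw [h]
    exact 𝔰.add_mem (𝔰.smul_mem _ (𝔰.sub_mem hZ hTZT)) (𝔰.smul_mem _ hTZ)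
  have hZm𝔰 : Zm ∈ 𝔰 := by
    have h : Zm = (4 : ℂ)⁻¹ • (Z - T * Z * T) - (4 : ℂ)⁻¹ • (T * Z - Z * T) := by rw [hZm]; module
    rw [h]
    exact 𝔰.sub_mem (𝔰.smul_mem _ (𝔰.sub_mem hZ hTZT)) (𝔰.smul_mem _ hTZ)
  have hZ₀𝔰 : Z₀ ∈ 𝔰 := by
    have h : Z₀ = (2 : ℂ)⁻¹ • (Z + T * Z * T) := hZ₀
    rw [h]
    exact 𝔰.smul_mem _ (𝔰.add_mem hZ hTZT)
  have hZpx : Zp x₁ = 0 := by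
    rw [hZp]
    simp only [LinearMap.smul_apply, LinearMap.sub_apply, LinearMap.add_apply, Module.End.mul_apply, hP x₁ hx₁,
      hZx, map_zero]
    module
  have hZmx : Zm x₁ = 0 := by
    rw [hZm]
    simp only [LinearMap.smul_apply, LinearMap.sub_apply, LinearMap.add_apply, Module.End.mul_apply, hP x₁ hx₁,
      hZx, map_zero]
    module
  have hZ₀x : Z₀ x₁ = 0 := by
    rw [hZ₀]
    simp only [LinearMap.smul_apply, LinearMap.add_apply, Module.End.mul_apply, hP x₁ hx₁, hZx, map_zero]
    module
  have hTZp : T * Zp - Zp * T = (2 : ℂ) • Zp := by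
    apply LinearMap.ext
    intro v
    rw [hZp]
    simp only [LinearMap.sub_apply, Module.End.mul_apply, LinearMap.smul_apply, LinearMap.add_apply, map_sub,
      map_add, map_smul, hTT]
    module
  have hTZm : T * Zm - Zm * T = -((2 : ℂ) • Zm) := by
    apply LinearMap.ext
    intro v
    rw [hZm]
    simp only [LinearMap.sub_apply, Module.End.mul_apply, LinearMap.smul_apply, LinearMap.add_apply,
      LinearMap.neg_apply, map_sub, map_add, map_smul, hTT]
    module
  have hTZ₀ : ∀ v, T (Z₀ v) = Z₀ (T v) := by
    intro v
    rw [hZ₀]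
    simp only [LinearMap.smul_apply, LinearMap.add_apply, Module.End.mul_apply, map_add, map_smul, hTT]
    module
  -- (a) the raising part
  have ha : ρ Zp * ρ e = 0 := hkillU Zp hZp𝔰 hTZp
  -- (b) the lowering part commutes with `e`
  have hb : ρ Zm * ρ e = 0 := by
    refine hkillL Zm hZm𝔰 hTZm (LinearMap.ext fun v => ?_)
    have h1 : ω x₁ (Zm v) = 0 := by
      have h := hsk Zm hZm𝔰 x₁ v
      rw [hZmx, map_zero, LinearMap.zero_apply, zero_add] at h
      exact h
    rw [Module.End.mul_apply, Module.End.mul_apply, heapp, heapp, map_smul, hZmx, smul_zero, h1, zero_smul]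
  -- (c) the Levi part: `q' = Z₀ y₁`, `B₁ = Y_{x₁, q'}`, `Z₀₀ = Z₀ - B₁`
  obtain ⟨q', hq'⟩ : ∃ q' : M, q' = Z₀ y₁ := ⟨_, rfl⟩
  have hq'Q : q' ∈ Q := hTneg _ (by rw [hq', hTZ₀, hQ y₁ hy₁, map_neg])
  have hx1q' : ω x₁ q' = 0 := by
    have h := hsk Z₀ hZ₀𝔰 x₁ y₁
    rw [hZ₀x, map_zero, LinearMap.zero_apply, zero_add] at h
    rw [hq']
    exact h
  obtain ⟨B₁, hB₁⟩ : ∃ B : Module.End ℂ M, B = (ω x₁).smulRight q' + (ω q').smulRight x₁ := ⟨_, rfl⟩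
  have hB₁𝔰 : B₁ ∈ 𝔰 := hB₁ ▸ hY𝔰 x₁ q'
  have hc1 : ρ B₁ * ρ e = 0 := hB₁ ▸ hS1 q' hq'Q hx1q'
  obtain ⟨Z₀₀, hZ₀₀⟩ : ∃ X : Module.End ℂ M, X = Z₀ - B₁ := ⟨_, rfl⟩
  have hZ₀₀𝔰 : Z₀₀ ∈ 𝔰 := hZ₀₀ ▸ 𝔰.sub_mem hZ₀𝔰 hB₁𝔰
  have hx1x1 : ω x₁ x₁ = 0 := hPP x₁ hx₁ x₁ hx₁
  have hq'x1 : ω q' x₁ = 0 := by rw [hωalt, hx1q', neg_zero]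
  have hq'y1 : ω q' y₁ = 0 := hQQ q' hq'Q y₁ hy₁
  have hB₁app : ∀ v, B₁ v = ω x₁ v • q' + ω q' v • x₁ := fun v => by
    rw [hB₁, LinearMap.add_apply, LinearMap.smulRight_apply, LinearMap.smulRight_apply]
  have hZ₀₀x : Z₀₀ x₁ = 0 := by
    rw [hZ₀₀, LinearMap.sub_apply, hZ₀x, hB₁app, hx1x1, hq'x1, zero_smul, zero_smul, add_zero, sub_zero]
  have hZ₀₀y : Z₀₀ y₁ = 0 := by
    rw [hZ₀₀, LinearMap.sub_apply, ← hq', hB₁app, h11, hq'y1, one_smul, zero_smul, add_zero, sub_self]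
  have hTB₁ : ∀ v, T (B₁ v) = B₁ (T v) := fun v => by
    rw [hB₁app, hB₁app, map_add, map_smul, map_smul, hP x₁ hx₁, hQ q' hq'Q, hωTP x₁ hx₁, hωTQ q' hq'Q]
    module
  have hTZ₀₀ : ∀ v, T (Z₀₀ v) = Z₀₀ (T v) := fun v => by
    rw [hZ₀₀, LinearMap.sub_apply, LinearMap.sub_apply, map_sub, hTZ₀, hTB₁]
  -- (c2) expansion of `Z₀₀` along a basis of `Q` and its dual family in `P` (the Levi lemma for `(-T, Q, P)`)
  have hnTskew : ∀ x y, ω ((-T) x) y + ω x ((-T) y) = 0 := fun x y => by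
    rw [LinearMap.neg_apply, LinearMap.neg_apply, map_neg, LinearMap.neg_apply, map_neg, ← neg_add, hTskew,
      neg_zero]
  have hP' : ∀ x ∈ Q, (-T) x = x := fun x hx => by rw [LinearMap.neg_apply, hQ x hx, neg_neg]
  have hQ' : ∀ x ∈ P, (-T) x = -x := fun x hx => by rw [LinearMap.neg_apply, hP x hx]
  have hPmem' : ∀ v, (2 : ℂ)⁻¹ • (v + (-T) v) ∈ Q := fun v => by
    rw [LinearMap.neg_apply, ← sub_eq_add_neg]; exact hQmem v
  have hQmem' : ∀ v, (2 : ℂ)⁻¹ • (v - (-T) v) ∈ P := fun v => by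
    rw [LinearMap.neg_apply, sub_neg_eq_add]; exact hPmem v
  have hdetQ' : ∀ x ∈ Q, (∀ q ∈ P, ω x q = 0) → x = 0 := fun x hx h =>
    hdetQ x hx fun p hp => by rw [hωalt, h p hp, neg_zero]
  have hdetP' : ∀ y ∈ P, (∀ p ∈ Q, ω p y = 0) → y = 0 := fun y hy h =>
    hdetP y hy fun q hq => by rw [hωalt, h q hq, neg_zero]
  set c := Module.finBasis ℂ ↥Q with hc
  obtain ⟨pd, hpdP, hpd⟩ := SymplecticThetaSix.exists_dual_family ω hdetQ' hdetP' c
  have hZ₀₀nT : ∀ v, (-T) (Z₀₀ v) = Z₀₀ ((-T) v) := fun v => by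
    rw [LinearMap.neg_apply, LinearMap.neg_apply, map_neg, hTZ₀₀]
  have hexp := SymplecticWitness.levi_eq_neg_sum_pairOp ω hωnd hωalt hnTskew hP' hQ' hPmem' hQmem' c hpdP hpd
    (hsk Z₀₀ hZ₀₀𝔰) hZ₀₀nT
  have hc2 : ρ Z₀₀ * ρ e = 0 := by
    rw [hexp, map_neg, map_sum, neg_mul, Finset.sum_mul, neg_eq_zero]
    refine Finset.sum_eq_zero fun i _ => ?_
    have hqi : Z₀₀ (c i : M) ∈ Q := hTneg _ (by rw [hTZ₀₀, hQ _ (c i).2, map_neg])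
    have hqi0 : ω x₁ (Z₀₀ (c i : M)) = 0 := by
      have h := hsk Z₀₀ hZ₀₀𝔰 x₁ (c i : M)
      rw [hZ₀₀x, map_zero, LinearMap.zero_apply, zero_add] at h
      exact h
    rw [SymplecticWitness.pairOp_comm]
    exact hS2 (pd i) (hpdP i) _ hqi hqi0
  -- assembling
  have hZ' : Z = Zp + Zm + (B₁ + Z₀₀) := by
    rw [hZ₀₀, add_sub_cancel, hZp, hZm, hZ₀]
    module
  rw [hZ', map_add, map_add, map_add, add_mul, add_mul, add_mul, ha, hb, hc1, hc2, add_zero, add_zero]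

end KeyLemma

/-! ### §3 The standard representation occurs; equivariant maps are morphisms of Hodge structures -/

section Witness

variable {M W : Type*} [AddCommGroup M] [Module ℂ M] [AddCommGroup W] [Module ℂ W]

/-- **Equivariant maps intertwine the gradings.** In the setting of the key lemma (without the bracket
hypothesis), every `ℂ`-linear `f : M → W` with `ρ(Y) ∘ f = f ∘ Y` for all `Y ∈ 𝔰𝔭(M, ω)` satisfies
`Θ ∘ f = f ∘ T`: a non-zero `p ∈ P` is `R_p q` for a dual vector `q ∈ Q`, and `ρ R_p` is `Θ`-raising, so
`f p = ρ(R_p) f(q)` is fixed by `Θ`; dually on `Q`. (Moonen–Zarhin (3.4): the `𝔤₃`-equivariant part of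
`Hom(V_{X₂}, V_{X₁})` consists of Hodge classes, i.e. of morphisms of Hodge structures.)
[cite: MoonenZarhin1999LowDim, §3 Lemma (3.3) and Lemma (3.4)] [cite: GoodmanWallachGTM255, §2.1.2 and §4.1.1] -/
theorem SymplecticWitness.theta_comp_eq_of_equivariant
    (ω : LinearMap.BilinForm ℂ M) (hωnd : ω.Nondegenerate) (hωalt : ∀ x y, ω x y = -ω y x)
    {T : Module.End ℂ M} (hTskew : ∀ x y, ω (T x) y + ω x (T y) = 0)
    {P Q : Submodule ℂ M} (hP : ∀ x ∈ P, T x = x) (hQ : ∀ x ∈ Q, T x = -x)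
    (hPmem : ∀ v, (2 : ℂ)⁻¹ • (v + T v) ∈ P) (hQmem : ∀ v, (2 : ℂ)⁻¹ • (v - T v) ∈ Q)
    (𝔰 : Submodule ℂ (Module.End ℂ M)) (h𝔰 : ∀ Y, Y ∈ 𝔰 ↔ ∀ x y, ω (Y x) y + ω x (Y y) = 0)
    {Θ : Module.End ℂ W} (hΘΘ : ∀ w, Θ (Θ w) = w) (ρ : Module.End ℂ M →ₗ[ℂ] Module.End ℂ W)
    (hρΘ : ∀ Y ∈ 𝔰, ρ (T * Y - Y * T) = Θ * ρ Y - ρ Y * Θ)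
    (f : M →ₗ[ℂ] W) (hf : ∀ Y ∈ 𝔰, ρ Y ∘ₗ f = f ∘ₗ Y) : Θ ∘ₗ f = f ∘ₗ T := by
  have hΘ2 : Θ * Θ = 1 := LinearMap.ext fun w => by rw [Module.End.mul_apply, hΘΘ, Module.End.one_apply]
  have hdetP : ∀ x ∈ P, (∀ q ∈ Q, ω x q = 0) → x = 0 :=
    fun x hx hxQ => SymplecticIdeal.eq_zero_of_forall_Q ω hωnd hTskew hP hPmem hQmem hx hxQ
  have hdetQ : ∀ y ∈ Q, (∀ p ∈ P, ω p y = 0) → y = 0 :=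
    fun y hy hyP => SymplecticIdeal.eq_zero_of_forall_P ω hωnd hωalt hTskew hQ hPmem hQmem hy hyP
  have hωTP : ∀ a ∈ P, ∀ v, ω a (T v) = -ω a v := fun a ha v => by
    have h := hTskew a v
    rw [hP a ha] at h
    linear_combination h
  have hωTQ : ∀ a ∈ Q, ∀ v, ω a (T v) = ω a v := fun a ha v => by
    have h := hTskew a v
    rw [hQ a ha, map_neg, LinearMap.neg_apply] at h
    linear_combination h
  have hR𝔰 : ∀ a : M, (ω a).smulRight a ∈ 𝔰 := fun a =>
    (h𝔰 _).2 (SymplecticIdeal.smulRight_self_skew ω hωalt a)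
  have hTR_P : ∀ a ∈ P, T * (ω a).smulRight a - (ω a).smulRight a * T = (2 : ℂ) • (ω a).smulRight a := by
    intro a ha
    apply LinearMap.ext
    intro v
    simp only [LinearMap.sub_apply, Module.End.mul_apply, LinearMap.smul_apply, LinearMap.smulRight_apply,
      map_smul, hP a ha, hωTP a ha]
    module
  have hTR_Q : ∀ a ∈ Q, T * (ω a).smulRight a - (ω a).smulRight a * T = -((2 : ℂ) • (ω a).smulRight a) := by
    intro a ha
    apply LinearMap.ext
    intro v
    simp only [LinearMap.sub_apply, Module.End.mul_apply, LinearMap.smul_apply, LinearMap.smulRight_apply,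
      LinearMap.neg_apply, map_smul, hQ a ha, hωTQ a ha]
    module
  have hfapply : ∀ Y ∈ 𝔰, ∀ v, ρ Y (f v) = f (Y v) := fun Y hY v => by
    have h := LinearMap.congr_fun (hf Y hY) v
    simpa only [LinearMap.comp_apply] using h
  -- on `P`
  have hPfix : ∀ p ∈ P, Θ (f p) = f p := by
    intro p hp
    by_cases hp0 : p = 0
    · rw [hp0, map_zero, map_zero]
    obtain ⟨q₀, hq₀, hq₀ne⟩ : ∃ q₀ ∈ Q, ω p q₀ ≠ 0 := by
      by_contra h
      push Not at h
      exact hp0 (hdetP p hp h)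
    have hRpq : (ω p).smulRight p ((ω p q₀)⁻¹ • q₀) = p := by
      rw [LinearMap.smulRight_apply, map_smul, smul_eq_mul, inv_mul_cancel₀ hq₀ne, one_smul]
    have hΘR : Θ * ρ ((ω p).smulRight p) = ρ ((ω p).smulRight p) :=
      (SymplecticWitness.theta_mul_of_bracket_eq_two_smul hΘ2
        (by rw [← hρΘ _ (hR𝔰 p), hTR_P p hp, map_smul])).1
    rw [← hRpq, ← hfapply _ (hR𝔰 p), ← Module.End.mul_apply, hΘR]
  -- on `Q`
  have hQneg : ∀ q ∈ Q, Θ (f q) = -f q := by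
    intro q hq
    by_cases hq0 : q = 0
    · rw [hq0, map_zero, map_zero, neg_zero]
    obtain ⟨p₀, hp₀, hp₀ne⟩ : ∃ p₀ ∈ P, ω p₀ q ≠ 0 := by
      by_contra h
      push Not at h
      exact hq0 (hdetQ q hq h)
    have hqp₀ : ω q p₀ ≠ 0 := by rw [hωalt]; exact neg_ne_zero.2 hp₀ne
    have hRqp : (ω q).smulRight q ((ω q p₀)⁻¹ • p₀) = q := by
      rw [LinearMap.smulRight_apply, map_smul, smul_eq_mul, inv_mul_cancel₀ hqp₀, one_smul]
    have hΘR : Θ * ρ ((ω q).smulRight q) = -ρ ((ω q).smulRight q) :=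
      (SymplecticWitness.theta_mul_of_bracket_eq_neg_two_smul hΘ2
        (by rw [← hρΘ _ (hR𝔰 q), hTR_Q q hq, map_neg, map_smul])).1
    rw [← hRqp, ← hfapply _ (hR𝔰 q), ← Module.End.mul_apply, hΘR, LinearMap.neg_apply]
  apply LinearMap.ext
  intro v
  have hv : (2 : ℂ)⁻¹ • (v + T v) + (2 : ℂ)⁻¹ • (v - T v) = v := by module
  rw [LinearMap.comp_apply, LinearMap.comp_apply, ← hv, map_add, map_add, map_add, hPfix _ (hPmem v),
    hQneg _ (hQmem v), hP _ (hPmem v), hQ _ (hQmem v), map_add, map_neg, sub_eq_add_neg]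

/-- **THE STANDARD REPRESENTATION OCCURS (Moonen–Zarhin Lemma (3.4), the representation-theoretic input, in
elementary form).** Let `ω` be nondegenerate alternating on a finite-dimensional complex `M`, `T` an `ω`-skew
involution with eigenspaces `P ≠ 0`, `Q`; `𝔰 = 𝔰𝔭(M, ω)`; `Θ` an involution of `W`; and
`ρ : End(M) → End(W)` linear with `ρ[Y, Y'] = [ρY, ρY']`, `ρ[T, Y] = [Θ, ρY]` for `Y, Y' ∈ 𝔰` and `ρ`
injective on `𝔰`. Then there is a NON-ZERO `ℂ`-linear `F : M → W` with `ρ(Y) ∘ F = F ∘ Y` for all `Y ∈ 𝔰`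
(a copy of the standard representation inside `W`). This is the hypothesis of Lemma (3.4) «up to isomorphism,
`V_{X₂}` is the only irreducible `hg(X₂)`-module which is a length 1 representation of non-compact type» for
`hg(X₂) ⊗ ℂ = 𝔰𝔭_{2g}` (a simple Lie algebra of type `C_g` has a unique minuscule representation) combined with
the `J`-eigenvalue bookkeeping of Lemma (3.3), proved here without highest-weight theory: with `x₁ ∈ P`,
`y₁ ∈ Q`, `ω(x₁,y₁) = 1`, `e = R_{x₁}`, `f = -R_{y₁}`, `h = [e, f]`, a vector `a = ρ(e)u ≠ 0`, and
`X_v = -Y_{v,y₁} + ω(v,x₁) f` (so `X_v x₁ = v`), put `F v = ρ(X_v) a`. By the key lemma `ρ(Z)a = 0` whenever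
`Z x₁ = 0`, which makes `F` equivariant for the stabiliser of `x₁`; equivariance for `f` is the computation
`ρ(f)ρ(Y_{v,y₁})ρ(e) = ω(y₁,v) ρ(f)ρ(e)` (for `v ∈ Q` two lowering operators compose to zero; for `v ⊥ y₁` in
`P` the `h`-weight `-2` is impossible as `(ρ h)² = ρeρf + ρfρe` is idempotent; `v = x₁` gives `ρ(h)a = a`);
and `𝔰 = 𝔰_{x₁} + [𝔰_{x₁}, f] + ℂ f`. Finally `F x₁ = ρ(h) a = a ≠ 0`.
[cite: MoonenZarhin1999LowDim, §1 (1.7), §3 Lemma (3.3) and Lemma (3.4)] [cite: Bourbaki2008LieGroups79, Ch. VIII §7 no. 3]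
[cite: GoodmanWallachGTM255, §2.1.2 and §4.1.1] [cite: Humphreys1972, §7.2] -/
theorem SymplecticWitness.exists_equivariant_ne_zero [FiniteDimensional ℂ M]
    (ω : LinearMap.BilinForm ℂ M) (hωnd : ω.Nondegenerate) (hωalt : ∀ x y, ω x y = -ω y x)
    {T : Module.End ℂ M} (hTT : ∀ v, T (T v) = v) (hTskew : ∀ x y, ω (T x) y + ω x (T y) = 0)
    {P Q : Submodule ℂ M} (hP : ∀ x ∈ P, T x = x) (hQ : ∀ x ∈ Q, T x = -x)
    (hPmem : ∀ v, (2 : ℂ)⁻¹ • (v + T v) ∈ P) (hQmem : ∀ v, (2 : ℂ)⁻¹ • (v - T v) ∈ Q) (hP0 : P ≠ ⊥)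
    (𝔰 : Submodule ℂ (Module.End ℂ M)) (h𝔰 : ∀ Y, Y ∈ 𝔰 ↔ ∀ x y, ω (Y x) y + ω x (Y y) = 0)
    {Θ : Module.End ℂ W} (hΘΘ : ∀ w, Θ (Θ w) = w) (ρ : Module.End ℂ M →ₗ[ℂ] Module.End ℂ W)
    (hρbr : ∀ Y ∈ 𝔰, ∀ Y' ∈ 𝔰, ρ (Y * Y' - Y' * Y) = ρ Y * ρ Y' - ρ Y' * ρ Y)
    (hρΘ : ∀ Y ∈ 𝔰, ρ (T * Y - Y * T) = Θ * ρ Y - ρ Y * Θ) (hinj : ∀ Y ∈ 𝔰, ρ Y = 0 → Y = 0) :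
    ∃ F : M →ₗ[ℂ] W, F ≠ 0 ∧ ∀ Y ∈ 𝔰, ρ Y ∘ₗ F = F ∘ₗ Y := by
  classical
  -- preliminaries on `T`, `P`, `Q`
  have hΘ2 : Θ * Θ = 1 := LinearMap.ext fun w => by rw [Module.End.mul_apply, hΘΘ, Module.End.one_apply]
  have hPP := SymplecticIdeal.isotropic_of_skew_involution ω hTskew hP
  have hQQ := SymplecticIdeal.isotropic_of_skew_involution_neg ω hTskew hQ
  have hdetP : ∀ x ∈ P, (∀ q ∈ Q, ω x q = 0) → x = 0 :=
    fun x hx hxQ => SymplecticIdeal.eq_zero_of_forall_Q ω hωnd hTskew hP hPmem hQmem hx hxQ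
  have hωTP : ∀ a ∈ P, ∀ v, ω a (T v) = -ω a v := fun a ha v => by
    have h := hTskew a v
    rw [hP a ha] at h
    linear_combination h
  have hωTQ : ∀ a ∈ Q, ∀ v, ω a (T v) = ω a v := fun a ha v => by
    have h := hTskew a v
    rw [hQ a ha, map_neg, LinearMap.neg_apply] at h
    linear_combination h
  -- the skew operators
  have hsk : ∀ Y ∈ 𝔰, ∀ x y, ω (Y x) y + ω x (Y y) = 0 := fun Y hY => (h𝔰 Y).1 hY
  have h𝔰br : ∀ Y ∈ 𝔰, ∀ Y' ∈ 𝔰, Y * Y' - Y' * Y ∈ 𝔰 := by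
    intro Y hY Y' hY'
    rw [h𝔰] at hY hY' ⊢
    intro x y
    simp only [LinearMap.sub_apply, Module.End.mul_apply, map_sub, LinearMap.sub_apply]
    have h1 := hY (Y' x) y
    have h2 := hY' x (Y y)
    have h3 := hY' (Y x) y
    have h4 := hY x (Y' y)
    linear_combination h1 - h3 + h4 - h2
  have hR𝔰 : ∀ a : M, (ω a).smulRight a ∈ 𝔰 := fun a =>
    (h𝔰 _).2 (SymplecticIdeal.smulRight_self_skew ω hωalt a)
  have hY𝔰 : ∀ a b : M, (ω a).smulRight b + (ω b).smulRight a ∈ 𝔰 := fun a b =>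
    (h𝔰 _).2 (SymplecticIdeal.pairOp_skew ω hωalt a b)
  have hraiseρ : ∀ Y ∈ 𝔰, T * Y - Y * T = (2 : ℂ) • Y → Θ * ρ Y = ρ Y ∧ ρ Y * Θ = -ρ Y :=
    fun Y hY h => SymplecticWitness.theta_mul_of_bracket_eq_two_smul hΘ2 (by rw [← hρΘ Y hY, h, map_smul])
  have hlowerρ : ∀ Y ∈ 𝔰, T * Y - Y * T = -((2 : ℂ) • Y) → Θ * ρ Y = -ρ Y ∧ ρ Y * Θ = ρ Y :=
    fun Y hY h => SymplecticWitness.theta_mul_of_bracket_eq_neg_two_smul hΘ2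
      (by rw [← hρΘ Y hY, h, map_neg, map_smul])
  have hTR_P : ∀ a ∈ P, T * (ω a).smulRight a - (ω a).smulRight a * T = (2 : ℂ) • (ω a).smulRight a := by
    intro a ha
    apply LinearMap.ext
    intro v
    simp only [LinearMap.sub_apply, Module.End.mul_apply, LinearMap.smul_apply, LinearMap.smulRight_apply,
      map_smul, hP a ha, hωTP a ha]
    module
  have hTR_Q : ∀ a ∈ Q, T * (ω a).smulRight a - (ω a).smulRight a * T = -((2 : ℂ) • (ω a).smulRight a) := by
    intro a ha
    apply LinearMap.ext
    intro v
    simp only [LinearMap.sub_apply, Module.End.mul_apply, LinearMap.smul_apply, LinearMap.smulRight_apply,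
      LinearMap.neg_apply, map_smul, hQ a ha, hωTQ a ha]
    module
  have hTY_QQ : ∀ a ∈ Q, ∀ b ∈ Q, T * ((ω a).smulRight b + (ω b).smulRight a) -
      ((ω a).smulRight b + (ω b).smulRight a) * T = -((2 : ℂ) • ((ω a).smulRight b + (ω b).smulRight a)) := by
    intro a ha b hb
    apply LinearMap.ext
    intro v
    simp only [LinearMap.sub_apply, Module.End.mul_apply, LinearMap.smul_apply, LinearMap.add_apply,
      LinearMap.smulRight_apply, LinearMap.neg_apply, map_add, map_smul, hQ a ha, hQ b hb, hωTQ a ha, hωTQ b hb]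
    module
  -- the base pair `x₁ ∈ P`, `y₁ ∈ Q`, `ω(x₁, y₁) = 1`
  obtain ⟨x₁, hx₁, hx₁0⟩ := (Submodule.ne_bot_iff P).1 hP0
  obtain ⟨q₀, hq₀, hq₀ne⟩ : ∃ q₀ ∈ Q, ω x₁ q₀ ≠ 0 := by
    by_contra h
    push Not at h
    exact hx₁0 (hdetP x₁ hx₁ h)
  obtain ⟨y₁, hy₁def⟩ : ∃ y₁ : M, y₁ = (ω x₁ q₀)⁻¹ • q₀ := ⟨_, rfl⟩
  have hy₁ : y₁ ∈ Q := hy₁def ▸ Q.smul_mem _ hq₀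
  have h11 : ω x₁ y₁ = 1 := by rw [hy₁def, map_smul, smul_eq_mul, inv_mul_cancel₀ hq₀ne]
  have hy1x : ω y₁ x₁ = -1 := by rw [hωalt, h11]
  have hx1x1 : ω x₁ x₁ = 0 := hPP x₁ hx₁ x₁ hx₁
  have hy1y1 : ω y₁ y₁ = 0 := hQQ y₁ hy₁ y₁ hy₁
  -- `e = R_{x₁}`, `f = -R_{y₁}`, `h = [e, f]` and the relations of `E = ρe`, `F = ρf`, `H = ρh`
  obtain ⟨e, he⟩ : ∃ e : Module.End ℂ M, e = (ω x₁).smulRight x₁ := ⟨_, rfl⟩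
  have he𝔰 : e ∈ 𝔰 := he ▸ hR𝔰 x₁
  have heapp : ∀ v, e v = ω x₁ v • x₁ := fun v => by rw [he, LinearMap.smulRight_apply]
  have hTe : T * e - e * T = (2 : ℂ) • e := he ▸ hTR_P x₁ hx₁
  obtain ⟨hΘE, hEΘ⟩ := hraiseρ e he𝔰 hTe
  obtain ⟨f, hf⟩ : ∃ f : Module.End ℂ M, f = -((ω y₁).smulRight y₁) := ⟨_, rfl⟩
  have hf𝔰 : f ∈ 𝔰 := hf ▸ 𝔰.neg_mem (hR𝔰 y₁)
  have hfapp : ∀ v, f v = -(ω y₁ v • y₁) := fun v => by rw [hf, LinearMap.neg_apply, LinearMap.smulRight_apply]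
  have hTf : T * f - f * T = -((2 : ℂ) • f) := by
    apply LinearMap.ext
    intro v
    simp only [LinearMap.sub_apply, Module.End.mul_apply, LinearMap.smul_apply, LinearMap.neg_apply, hfapp,
      map_neg, map_smul, hQ y₁ hy₁, hωTQ y₁ hy₁]
    module
  obtain ⟨hΘF, hFΘ⟩ := hlowerρ f hf𝔰 hTf
  obtain ⟨h₀, hh₀⟩ : ∃ h₀ : Module.End ℂ M, h₀ = e * f - f * e := ⟨_, rfl⟩
  have hh₀𝔰 : h₀ ∈ 𝔰 := hh₀ ▸ h𝔰br e he𝔰 f hf𝔰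
  have hh₀Y : h₀ = -((ω x₁).smulRight y₁ + (ω y₁).smulRight x₁) := by
    rw [hh₀]
    apply LinearMap.ext
    intro v
    simp only [LinearMap.sub_apply, Module.End.mul_apply, LinearMap.neg_apply, LinearMap.add_apply,
      LinearMap.smulRight_apply, heapp, hfapp, map_smul, map_neg, smul_eq_mul, h11, hy1x]
    module
  have hh₀e : h₀ * e - e * h₀ = (2 : ℂ) • e := by
    apply LinearMap.ext
    intro v
    simp only [hh₀Y, LinearMap.sub_apply, Module.End.mul_apply, LinearMap.neg_apply, LinearMap.add_apply,
      LinearMap.smul_apply, LinearMap.smulRight_apply, heapp, map_smul, map_neg, map_add, smul_eq_mul, h11,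
      hy1x, hx1x1]
    module
  have hh₀f : h₀ * f - f * h₀ = -((2 : ℂ) • f) := by
    apply LinearMap.ext
    intro v
    simp only [hh₀Y, LinearMap.sub_apply, Module.End.mul_apply, LinearMap.neg_apply, LinearMap.add_apply,
      LinearMap.smul_apply, LinearMap.smulRight_apply, hfapp, map_smul, map_neg, map_add, smul_eq_mul, h11,
      hy1x, hy1y1]
    module
  have hρh₀ : ρ h₀ = ρ e * ρ f - ρ f * ρ e := by rw [hh₀, hρbr e he𝔰 f hf𝔰]
  have hHE2 : ρ h₀ * ρ e - ρ e * ρ h₀ = (2 : ℂ) • ρ e := by rw [← hρbr h₀ hh₀𝔰 e he𝔰, hh₀e, map_smul]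
  have hHF2 : ρ h₀ * ρ f - ρ f * ρ h₀ = -((2 : ℂ) • ρ f) := by
    rw [← hρbr h₀ hh₀𝔰 f hf𝔰, hh₀f, map_neg, map_smul]
  have hEE : ρ e * ρ e = 0 := SymplecticWitness.mul_eq_zero_of_raise hEΘ hΘE
  have hFF : ρ f * ρ f = 0 := SymplecticWitness.mul_eq_zero_of_lower hFΘ hΘF
  have hEFE : ρ e * ρ f * ρ e = ρ e := by
    have h := hHE2
    rw [hρh₀] at h
    have h' : (2 : ℂ) • (ρ e * ρ f * ρ e) = (2 : ℂ) • ρ e := by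
      rw [← h, two_smul, sub_mul, mul_sub, mul_assoc (ρ f) (ρ e) (ρ e), hEE, mul_zero, sub_zero, ← mul_assoc,
        hEE, zero_mul, zero_sub, sub_neg_eq_add, mul_assoc]
    exact smul_right_injective _ (two_ne_zero (α := ℂ)) h'
  have hFEF : ρ f * ρ e * ρ f = ρ f := by
    have h := hHF2
    rw [hρh₀] at h
    -- `h : (EF - FE) F - F (EF - FE) = -2F`, i.e. `-FEF - FEF = -2F`
    have h1 : (ρ e * ρ f - ρ f * ρ e) * ρ f - ρ f * (ρ e * ρ f - ρ f * ρ e) = -((2 : ℂ) • (ρ f * ρ e * ρ f)) := by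
      rw [sub_mul, mul_sub, mul_assoc (ρ e) (ρ f) (ρ f), hFF, mul_zero, zero_sub, ← mul_assoc (ρ f) (ρ f) (ρ e),
        hFF, zero_mul, sub_zero, ← mul_assoc, two_smul, neg_add]
      abel
    rw [h1, neg_inj] at h
    exact smul_right_injective _ (two_ne_zero (α := ℂ)) h
  have hHE : ρ h₀ * ρ e = ρ e := by
    rw [hρh₀, sub_mul, mul_assoc (ρ f) (ρ e) (ρ e), hEE, mul_zero, sub_zero, hEFE]
  -- `Π = H² = EF + FE` is idempotent
  have e1 : ρ e * ρ f * (ρ e * ρ f) = ρ e * ρ f := by rw [← mul_assoc, hEFE]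
  have e2 : ρ e * ρ f * (ρ f * ρ e) = 0 := by rw [← mul_assoc, mul_assoc (ρ e), hFF, mul_zero, zero_mul]
  have e3 : ρ f * ρ e * (ρ e * ρ f) = 0 := by rw [← mul_assoc, mul_assoc (ρ f), hEE, mul_zero, zero_mul]
  have e4 : ρ f * ρ e * (ρ f * ρ e) = ρ f * ρ e := by rw [← mul_assoc, hFEF]
  have hH2 : ρ h₀ * ρ h₀ = ρ e * ρ f + ρ f * ρ e := by
    rw [hρh₀, sub_mul, mul_sub, mul_sub, e1, e2, e3, e4, sub_zero, zero_sub, sub_neg_eq_add]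
  have hPiPi : (ρ e * ρ f + ρ f * ρ e) * (ρ e * ρ f + ρ f * ρ e) = ρ e * ρ f + ρ f * ρ e := by
    rw [add_mul, mul_add, mul_add, e1, e2, e3, e4, add_zero, zero_add]
  -- `E ≠ 0` (injectivity), `a = E u ≠ 0`
  have hE0 : ρ e ≠ 0 := by
    intro h0
    have he0 : e = 0 := hinj e he𝔰 h0
    have : e y₁ = x₁ := by rw [heapp, h11, one_smul]
    rw [he0, LinearMap.zero_apply] at this
    exact hx₁0 this.symm
  obtain ⟨u, hu⟩ : ∃ u, ρ e u ≠ 0 := by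
    by_contra h
    push Not at h
    exact hE0 (LinearMap.ext h)
  have hHa : ρ h₀ (ρ e u) = ρ e u := by rw [← Module.End.mul_apply, hHE]
  -- THE KEY LEMMA for this base pair
  have hKL : ∀ Z ∈ 𝔰, Z x₁ = 0 → ρ Z * ρ e = 0 := fun Z hZ hZx => by
    rw [he]
    exact SymplecticWitness.mul_rankOne_eq_zero_of_apply_eq_zero ω hωnd hωalt hTT hTskew hP hQ hPmem hQmem 𝔰
      h𝔰 hΘΘ ρ hρbr hρΘ hx₁ hy₁ h11 hZ hZx
  -- the section `v ↦ X_v = -Y_{v,y₁} + ω(v,x₁) f` of `Z ↦ Z x₁`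
  obtain ⟨X, hX⟩ : ∃ X : M →ₗ[ℂ] Module.End ℂ M,
      ∀ v, X v = -((ω v).smulRight y₁ + (ω y₁).smulRight v) + ω v x₁ • f :=
    ⟨{ toFun := fun v => -((ω v).smulRight y₁ + (ω y₁).smulRight v) + ω v x₁ • f
       map_add' := fun v w => by
         rw [SymplecticWitness.pairOp_add_left, map_add, LinearMap.add_apply, add_smul]
         abel
       map_smul' := fun c v => by
         rw [SymplecticWitness.pairOp_smul_left, map_smul, LinearMap.smul_apply, smul_eq_mul, RingHom.id_apply]
         module }, fun v => rfl⟩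
  have hX𝔰 : ∀ v, X v ∈ 𝔰 := fun v => by
    rw [hX]
    exact 𝔰.add_mem (𝔰.neg_mem (hY𝔰 v y₁)) (𝔰.smul_mem _ hf𝔰)
  have hfx₁ : f x₁ = y₁ := by rw [hfapp, hy1x, neg_smul, one_smul, neg_neg]
  have hXx : ∀ v, X v x₁ = v := fun v => by
    rw [hX, LinearMap.add_apply, LinearMap.neg_apply, LinearMap.add_apply, LinearMap.smulRight_apply,
      LinearMap.smulRight_apply, LinearMap.smul_apply, hfx₁, hy1x]
    module
  have hXx₁ : X x₁ = h₀ := by rw [hX, hx1x1, zero_smul, add_zero, hh₀Y]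
  have hXy₁ : X y₁ = f := by
    rw [hX, hy1x]
    apply LinearMap.ext
    intro v
    simp only [LinearMap.add_apply, LinearMap.neg_apply, LinearMap.smul_apply, LinearMap.smulRight_apply, hfapp]
    module
  -- the witness `F v = ρ(X_v) a`
  obtain ⟨Fm, hFm⟩ : ∃ Fm : M →ₗ[ℂ] W, ∀ v, Fm v = ρ (X v) (ρ e u) :=
    ⟨{ toFun := fun v => ρ (X v) (ρ e u)
       map_add' := fun v w => by rw [map_add, map_add, LinearMap.add_apply]
       map_smul' := fun c v => by rw [map_smul, map_smul, LinearMap.smul_apply, RingHom.id_apply] },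
      fun v => rfl⟩
  have hFm0 : Fm ≠ 0 := by
    intro h0
    have h := hFm x₁
    rw [h0, LinearMap.zero_apply, hXx₁, hHa] at h
    exact hu h.symm
  -- (i) equivariance for the stabiliser of `x₁`
  have hstep1 : ∀ Z ∈ 𝔰, Z x₁ = 0 → ∀ v, ρ Z (Fm v) = Fm (Z v) := by
    intro Z hZ hZx v
    rw [hFm, hFm]
    have h1 : ρ Z (ρ e u) = 0 := by rw [← Module.End.mul_apply, hKL Z hZ hZx, LinearMap.zero_apply]
    have hDmem : Z * X v - X v * Z - X (Z v) ∈ 𝔰 := 𝔰.sub_mem (h𝔰br Z hZ _ (hX𝔰 v)) (hX𝔰 _)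
    have hDx : (Z * X v - X v * Z - X (Z v)) x₁ = 0 := by
      rw [LinearMap.sub_apply, LinearMap.sub_apply, Module.End.mul_apply, Module.End.mul_apply, hXx, hZx,
        map_zero, hXx, sub_zero, sub_self]
    have h2 := hKL _ hDmem hDx
    rw [map_sub, hρbr Z hZ _ (hX𝔰 v), sub_mul, sub_mul] at h2
    have h3 := congrArg (fun S : Module.End ℂ W => S u) h2
    simp only [LinearMap.sub_apply, Module.End.mul_apply, LinearMap.zero_apply, h1, map_zero, sub_zero] at h3
    exact sub_eq_zero.1 h3
  -- (ii) equivariance for `f`: `ρ(f) ρ(Y_{v,y₁}) ρ(e) = ω(y₁, v) ρ(f) ρ(e)`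
  have hC : ∀ v, ρ f * ρ ((ω v).smulRight y₁ + (ω y₁).smulRight v) * ρ e = ω y₁ v • (ρ f * ρ e) := by
    -- on `Q`: two lowering operators
    have hCQ : ∀ v ∈ Q, ρ f * ρ ((ω v).smulRight y₁ + (ω y₁).smulRight v) * ρ e = ω y₁ v • (ρ f * ρ e) := by
      intro v hv
      rw [SymplecticWitness.mul_eq_zero_of_lower hFΘ (hlowerρ _ (hY𝔰 v y₁) (hTY_QQ v hv y₁ hy₁)).1, zero_mul,
        hQQ y₁ hy₁ v hv, zero_smul]
    -- on `P ∩ y₁^⊥`: the `h`-weight `-2` is impossible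
    have hCP' : ∀ v ∈ P, ω v y₁ = 0 → ρ f * ρ ((ω v).smulRight y₁ + (ω y₁).smulRight v) * ρ e = 0 := by
      intro v hv hvy
      obtain ⟨Y', hY'⟩ : ∃ Y' : Module.End ℂ M, Y' = (ω v).smulRight y₁ + (ω y₁).smulRight v := ⟨_, rfl⟩
      rw [← hY']
      have hY'𝔰 : Y' ∈ 𝔰 := hY' ▸ hY𝔰 v y₁
      have hhY' : h₀ * Y' - Y' * h₀ = -Y' := by
        have hbr := SymplecticIdeal.pairOp_bracket ω hωalt hPP hQQ hx₁ hv hy₁ hy₁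
        rw [hh₀Y, hY', neg_mul, mul_neg, ← neg_sub', hbr, h11, one_smul, hvy, zero_smul, sub_zero]
      have hHY' : ρ h₀ * ρ Y' = ρ Y' * ρ h₀ - ρ Y' := by
        have h1 := hρbr h₀ hh₀𝔰 Y' hY'𝔰
        rw [hhY', map_neg] at h1
        rw [sub_eq_iff_eq_add.1 h1.symm]
        abel
      have hHF : ρ h₀ * ρ f = ρ f * ρ h₀ - (2 : ℂ) • ρ f := by
        rw [sub_eq_iff_eq_add.1 hHF2]
        abel
      obtain ⟨V, hV⟩ : ∃ V : Module.End ℂ W, V = ρ f * ρ Y' * ρ e := ⟨_, rfl⟩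
      rw [← hV]
      have hHV : ρ h₀ * V = (-2 : ℂ) • V := by
        have hfYe : ρ f * ρ Y' * ρ h₀ * ρ e = V := by rw [mul_assoc, hHE, hV]
        calc ρ h₀ * V = ρ h₀ * ρ f * ρ Y' * ρ e := by rw [hV, ← mul_assoc, ← mul_assoc]
          _ = (ρ f * ρ h₀ - (2 : ℂ) • ρ f) * ρ Y' * ρ e := by rw [hHF]
          _ = ρ f * (ρ h₀ * ρ Y') * ρ e - (2 : ℂ) • (ρ f * ρ Y' * ρ e) := by
              rw [sub_mul, sub_mul, smul_mul_assoc, smul_mul_assoc, mul_assoc (ρ f) (ρ h₀) (ρ Y')]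
          _ = ρ f * (ρ Y' * ρ h₀ - ρ Y') * ρ e - (2 : ℂ) • V := by rw [hHY', hV]
          _ = ρ f * ρ Y' * ρ h₀ * ρ e - V - (2 : ℂ) • V := by
              rw [mul_sub, sub_mul, ← mul_assoc (ρ f) (ρ Y') (ρ h₀), hV]
          _ = (-2 : ℂ) • V := by rw [hfYe]; module
      have hPiV : (ρ e * ρ f + ρ f * ρ e) * V = (4 : ℂ) • V := by
        rw [← hH2, mul_assoc, hHV, mul_smul_comm, hHV, smul_smul]
        norm_num
      have h16 : (4 : ℂ) • ((4 : ℂ) • V) = (4 : ℂ) • V := by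
        calc (4 : ℂ) • ((4 : ℂ) • V) = (ρ e * ρ f + ρ f * ρ e) * ((ρ e * ρ f + ρ f * ρ e) * V) := by
              rw [hPiV, mul_smul_comm, hPiV]
          _ = (ρ e * ρ f + ρ f * ρ e) * V := by rw [← mul_assoc, hPiPi]
          _ = (4 : ℂ) • V := hPiV
      have h12 : ((4 : ℂ) * 4 - 4) • V = 0 := by rw [sub_smul, mul_smul, h16, sub_self]
      exact (smul_eq_zero.1 h12).resolve_left (by norm_num)
    intro v
    -- split `v` along `M = P ⊕ Q` and `P = ℂ x₁ ⊕ (P ∩ y₁^⊥)`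
    obtain ⟨vP, hvP⟩ : ∃ w : M, w = (2 : ℂ)⁻¹ • (v + T v) := ⟨_, rfl⟩
    obtain ⟨vQ, hvQ⟩ : ∃ w : M, w = (2 : ℂ)⁻¹ • (v - T v) := ⟨_, rfl⟩
    have hvPP : vP ∈ P := hvP ▸ hPmem v
    have hvQQ : vQ ∈ Q := hvQ ▸ hQmem v
    obtain ⟨v', hv'⟩ : ∃ w : M, w = vP - ω vP y₁ • x₁ := ⟨_, rfl⟩
    have hv'P : v' ∈ P := hv' ▸ P.sub_mem hvPP (P.smul_mem _ hx₁)
    have hv'y : ω v' y₁ = 0 := by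
      rw [hv', map_sub, map_smul, LinearMap.sub_apply, LinearMap.smul_apply, h11, smul_eq_mul, mul_one, sub_self]
    have hvdec : v = v' + ω vP y₁ • x₁ + vQ := by
      rw [hv', sub_add_cancel, hvP, hvQ]
      module
    have hωv : ω y₁ v = -ω vP y₁ := by
      rw [hvdec, map_add, map_add, map_smul, hQQ y₁ hy₁ vQ hvQQ, add_zero, smul_eq_mul, hy1x, mul_neg, mul_one,
        hωalt y₁ v', hv'y, neg_zero, zero_add]
    have hsplit : (ω v).smulRight y₁ + (ω y₁).smulRight v =
        ((ω v').smulRight y₁ + (ω y₁).smulRight v') - ω vP y₁ • h₀ + ((ω vQ).smulRight y₁ + (ω y₁).smulRight vQ) := by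
      conv_lhs => rw [hvdec]
      rw [SymplecticWitness.pairOp_add_left, SymplecticWitness.pairOp_add_left,
        SymplecticWitness.pairOp_smul_left, hh₀Y, smul_neg, sub_neg_eq_add]
    rw [hωv, hsplit, map_add, map_sub, map_smul, mul_add, mul_sub, add_mul, sub_mul, hCP' v' hv'P hv'y,
      hCQ vQ hvQQ, hQQ y₁ hy₁ vQ hvQQ, zero_smul, add_zero, mul_smul_comm, smul_mul_assoc, mul_assoc, hHE,
      zero_sub, neg_smul]
  have hstep2 : ∀ v, ρ f (Fm v) = Fm (f v) := by
    intro v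
    have hL : ρ f (Fm v) = (ρ f * ρ (X v) * ρ e) u := by
      rw [hFm, Module.End.mul_apply, Module.End.mul_apply]
    have hR : Fm (f v) = -(ω y₁ v • (ρ f * ρ e) u) := by
      rw [hFm, hfapp, map_neg, map_smul, hXy₁, map_neg, map_smul, LinearMap.neg_apply, LinearMap.smul_apply,
        Module.End.mul_apply]
    rw [hL, hR, hX, map_add, map_neg, map_smul, mul_add, mul_neg, add_mul, neg_mul, hC, mul_smul_comm,
      smul_mul_assoc, hFF, zero_mul, smul_zero, add_zero, LinearMap.neg_apply, LinearMap.smul_apply]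
  -- (iii) `𝔰 = 𝔰_{x₁} + [𝔰_{x₁}, f] + ℂ f`
  refine ⟨Fm, hFm0, fun Y hY => LinearMap.ext fun v => ?_⟩
  rw [LinearMap.comp_apply, LinearMap.comp_apply]
  obtain ⟨w', hw'⟩ : ∃ w : M, w = Y x₁ - ω x₁ (Y x₁) • y₁ := ⟨_, rfl⟩
  have hx1w' : ω x₁ w' = 0 := by
    rw [hw', map_sub, map_smul, h11, smul_eq_mul, mul_one, sub_self]
  have hw'x1 : ω w' x₁ = 0 := by rw [hωalt, hx1w', neg_zero]
  obtain ⟨Z₂, hZ₂⟩ : ∃ Z : Module.End ℂ M, Z = ((ω x₁).smulRight w' + (ω w').smulRight x₁) - ω w' y₁ • e :=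
    ⟨_, rfl⟩
  have hZ₂𝔰 : Z₂ ∈ 𝔰 := hZ₂ ▸ 𝔰.sub_mem (hY𝔰 x₁ w') (𝔰.smul_mem _ he𝔰)
  have hZ₂x : Z₂ x₁ = 0 := by
    rw [hZ₂, LinearMap.sub_apply, LinearMap.add_apply, LinearMap.smulRight_apply, LinearMap.smulRight_apply,
      LinearMap.smul_apply, heapp, hx1x1, hw'x1, zero_smul, zero_smul, smul_zero, add_zero, sub_zero]
  have hZ₂y : Z₂ y₁ = w' := by
    rw [hZ₂, LinearMap.sub_apply, LinearMap.add_apply, LinearMap.smulRight_apply, LinearMap.smulRight_apply,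
      LinearMap.smul_apply, heapp, h11, one_smul, smul_smul, mul_one, add_sub_cancel_right]
  obtain ⟨Z₁, hZ₁⟩ : ∃ Z : Module.End ℂ M, Z = Y - (Z₂ * f - f * Z₂) - ω x₁ (Y x₁) • f := ⟨_, rfl⟩
  have hZ₁𝔰 : Z₁ ∈ 𝔰 := hZ₁ ▸ 𝔰.sub_mem (𝔰.sub_mem hY (h𝔰br Z₂ hZ₂𝔰 f hf𝔰)) (𝔰.smul_mem _ hf𝔰)
  have hZ₁x : Z₁ x₁ = 0 := by
    rw [hZ₁, LinearMap.sub_apply, LinearMap.sub_apply, LinearMap.sub_apply, Module.End.mul_apply,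
      Module.End.mul_apply, LinearMap.smul_apply, hfx₁, hZ₂y, hZ₂x, map_zero, sub_zero, hw']
    abel
  have hYdec : Y = Z₁ + (Z₂ * f - f * Z₂) + ω x₁ (Y x₁) • f := by rw [hZ₁]; abel
  calc ρ Y (Fm v) = (ρ Z₁ + (ρ Z₂ * ρ f - ρ f * ρ Z₂) + ω x₁ (Y x₁) • ρ f) (Fm v) := by
        rw [← hρbr Z₂ hZ₂𝔰 f hf𝔰, ← map_smul, ← map_add, ← map_add, ← hYdec]
    _ = ρ Z₁ (Fm v) + (ρ Z₂ (ρ f (Fm v)) - ρ f (ρ Z₂ (Fm v))) + ω x₁ (Y x₁) • ρ f (Fm v) := by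
        simp only [LinearMap.add_apply, LinearMap.sub_apply, LinearMap.smul_apply, Module.End.mul_apply]
    _ = Fm (Z₁ v) + (Fm (Z₂ (f v)) - Fm (f (Z₂ v))) + ω x₁ (Y x₁) • Fm (f v) := by
        simp only [hstep2, hstep1 Z₁ hZ₁𝔰 hZ₁x, hstep1 Z₂ hZ₂𝔰 hZ₂x]
    _ = Fm (Y v) := by
        conv_rhs => rw [hYdec]
        simp only [LinearMap.add_apply, LinearMap.sub_apply, LinearMap.smul_apply, Module.End.mul_apply, map_add,
          map_sub, map_smul]

end Witness

/-! ### §4 The Goursat step for a rigid symplectic second factor: `Hom = 0` excludes the graph -/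

section Goursat

universe u

variable {U V₁ V₂ : Type u} [AddCommGroup U] [Module ℚ U] [AddCommGroup V₁] [Module ℚ V₁]
  [AddCommGroup V₂] [Module ℚ V₂] [Module.Finite ℚ U] [Module.Finite ℚ V₁] [Module.Finite ℚ V₂]
  [HodgeTensorFacts.{u, u}] {n : ℤ}

set_option maxHeartbeats 400000 in
/-- **The Goursat step with a rigid symplectic second factor (Moonen–Zarhin Lemma (3.4), Lie form, any
rank).** Let `U = ι₁V₁ ⊕ ι₂V₂` and let `𝔞 ⊆ End_ℚ(U)` be a bracket-closed space of block-diagonal operators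
with `ψ_i`-skew corners, whose complex span contains an operator `Θ_U` inducing the Hodge operators `Θ₁`, `Θ₂`
of the effective weight-one structures `H₁`, `H₂` on the blocks; `V₂ ≠ 0`, and (RIGID): every bracket-closed
rational `ψ₂`-skew `𝔤₂` with `Θ₂ ∈ (𝔤₂)_ℂ` has `(𝔤₂)_ℂ ⊇ 𝔰𝔭(V₂ ⊗ ℂ, ψ₂)` (the tree's theorems for
`dim V₂ = 2, 4, 6` and `End_Hdg(V₂) = ℚ`: `hg(X₂) = 𝔰𝔭_{2g}`, `g ≤ 3`). If NO non-zero `ℚ`-linear `f : V₂ → V₁`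
intertwines `Θ₂` and `Θ₁` («`Hom(X₂, X₁) = 0`»), then `ι₁ c₁X π₁ ∈ 𝔞` for all `X ∈ 𝔞` and `ι₂ Z π₂ ∈ 𝔞` for
every rational `ψ₂`-skew `Z` («`Hg(X₁ × X₂) = Hg(X₁) × Hg(X₂)`»). PROOF. If the kernel `K = 𝔞 ∩ ker c₁` is
non-zero: (IDEAL) `SymplecticIdeal.theta_mem_of_ne_bot_hodge`, (RIGID), descent — the tree's
`goursat_incl_corner_mem`. THE GRAPH CASE `K = 0` («`hg(X₁ × X₂) = 𝔤₁ ⊕ Γ_φ`», `Γ_φ` the graph of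
`hg(X₂) = 𝔰𝔭 → 𝔤₃ ⊂ hg(X₁)`) is impossible: the ideal `𝔨₁ = c₁(𝔞 ∩ ker c₂)` of `𝔤₁ = c₁(𝔞)` has a complementary
ideal `𝔤₃` (`exists_ideal_compl`, Deligne I 3.6 in Lie form), `𝔞₃ = 𝔞 ∩ c₁⁻¹(𝔤₃)` is an ideal of `𝔞` on which
`c₂` is a bijection `(𝔞₃)_ℂ ≅ 𝔰𝔭(V₂ ⊗ ℂ)`; `ρ = c₁ ∘ c₂⁻¹` is then a bracket-preserving linear map
`𝔰𝔭(V₂ ⊗ ℂ) → End(V₁ ⊗ ℂ)` with `ρ[Θ₂, Y] = [Θ₁, ρY]`, injective (`c₁` is). By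
`SymplecticWitness.exists_equivariant_ne_zero` (the standard representation is the only length-one
representation: «`V_{X₂}` is the only irreducible `hg(X₂)`-module which is a length 1 representation of
non-compact type») there is a non-zero `ρ`-equivariant `F : V₂ ⊗ ℂ → V₁ ⊗ ℂ`, so `Z' = ι₁ F π₂ ≠ 0` commutes
with `(𝔞₃)_ℂ`; whereas every RATIONAL `Z` commuting with `𝔞₃` has `π₁Zι₂ = 0` — its complexification is
`ρ`-equivariant, hence intertwines `Θ₂` and `Θ₁` (`SymplecticWitness.theta_comp_eq_of_equivariant`; «the
`𝔤₃`-invariants of `Hom(V_{X₂}, V_{X₁})` are Hodge classes») and (HOM) applies — contradicting descent of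
commutants (`mem_span_baseChange_of_forall_commute`).
[cite: MoonenZarhin1999LowDim, §3 (3.1), Lemma (3.3), Lemma (3.4)] [cite: Hazama1989, Thm. (= Gordon 7.6.2)]
[cite: Deligne1982HodgeCycles, I §3 (proof of Prop. 3.4) and Prop. 3.6] -/
theorem goursat_incl_corner_mem_of_hom_eq_zero_of_rigid (hn : n = 1) (H₁ : HodgeStructure V₁ n)
    (H₂ : HodgeStructure V₂ n) (heff₁ : H₁.IsEffective) (heff₂ : H₂.IsEffective)
    {ι₁ : V₁ →ₗ[ℚ] U} {π₁ : U →ₗ[ℚ] V₁} {ι₂ : V₂ →ₗ[ℚ] U} {π₂ : U →ₗ[ℚ] V₂}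
    (hπι₁ : π₁ ∘ₗ ι₁ = LinearMap.id) (hπι₂ : π₂ ∘ₗ ι₂ = LinearMap.id) (hπ₁ι₂ : π₁ ∘ₗ ι₂ = 0)
    (hπ₂ι₁ : π₂ ∘ₗ ι₁ = 0) (hsum : ι₁ ∘ₗ π₁ + ι₂ ∘ₗ π₂ = LinearMap.id)
    (𝔞 : Submodule ℚ (Module.End ℚ U)) (hbr : ∀ X ∈ 𝔞, ∀ X' ∈ 𝔞, X * X' - X' * X ∈ 𝔞)
    (hP₁ : ∀ X ∈ 𝔞, X * (ι₁ ∘ₗ π₁) = (ι₁ ∘ₗ π₁) * X) (hP₂ : ∀ X ∈ 𝔞, X * (ι₂ ∘ₗ π₂) = (ι₂ ∘ₗ π₂) * X)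
    (ψ₁ : H₁.Polarization) (ψ₂ : H₂.Polarization)
    (hskew₁ : ∀ X ∈ 𝔞, ∀ v w, ψ₁.form ((π₁ ∘ₗ X ∘ₗ ι₁) v) w + ψ₁.form v ((π₁ ∘ₗ X ∘ₗ ι₁) w) = 0)
    (hskew₂ : ∀ X ∈ 𝔞, ∀ v w, ψ₂.form ((π₂ ∘ₗ X ∘ₗ ι₂) v) w + ψ₂.form v ((π₂ ∘ₗ X ∘ₗ ι₂) w) = 0)
    (hV₂ : Module.finrank ℚ V₂ ≠ 0)
    {Θ₁ : Module.End ℂ (ℂ ⊗[ℚ] V₁)} (hΘ₁ : ∀ p, ∀ x ∈ H₁.piece p (n - p), Θ₁ x = ((2 * p - n : ℤ) : ℂ) • x)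
    {Θ₂ : Module.End ℂ (ℂ ⊗[ℚ] V₂)} (hΘ₂ : ∀ p, ∀ x ∈ H₂.piece p (n - p), Θ₂ x = ((2 * p - n : ℤ) : ℂ) • x)
    (hrigid : ∀ 𝔤₂ : Submodule ℚ (Module.End ℚ V₂), (∀ X ∈ 𝔤₂, ∀ X' ∈ 𝔤₂, X * X' - X' * X ∈ 𝔤₂) →
      (∀ X ∈ 𝔤₂, ∀ v w, ψ₂.form (X v) w + ψ₂.form v (X w) = 0) → Θ₂ ∈ spanC 𝔤₂ →
      ∀ Y : Module.End ℂ (ℂ ⊗[ℚ] V₂),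
        (∀ x y, ψ₂.form.baseChange ℂ (Y x) y + ψ₂.form.baseChange ℂ x (Y y) = 0) → Y ∈ spanC 𝔤₂)
    {ΘU : Module.End ℂ (ℂ ⊗[ℚ] U)} (hΘU𝔞 : ΘU ∈ spanC 𝔞)
    (hΘUι₁ : ∀ x, ΘU (ι₁.baseChange ℂ x) = ι₁.baseChange ℂ (Θ₁ x))
    (hΘUι₂ : ∀ x, ΘU (ι₂.baseChange ℂ x) = ι₂.baseChange ℂ (Θ₂ x))
    (hHom : ∀ f : V₂ →ₗ[ℚ] V₁, Θ₁ ∘ₗ f.baseChange ℂ = f.baseChange ℂ ∘ₗ Θ₂ → f = 0) :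
    (∀ X ∈ 𝔞, ι₁ ∘ₗ (π₁ ∘ₗ X ∘ₗ ι₁) ∘ₗ π₁ ∈ 𝔞) ∧
      ∀ Z₂ : Module.End ℚ V₂, (∀ v w, ψ₂.form (Z₂ v) w + ψ₂.form v (Z₂ w) = 0) → ι₂ ∘ₗ Z₂ ∘ₗ π₂ ∈ 𝔞 := by
  classical
  have hsum' : ι₂ ∘ₗ π₂ + ι₁ ∘ₗ π₁ = LinearMap.id := by rw [add_comm]; exact hsum
  -- the corner maps as linear maps, rational and complex
  obtain ⟨cL₁, hcL₁⟩ : ∃ L : Module.End ℚ U →ₗ[ℚ] Module.End ℚ V₁, ∀ X, L X = π₁ ∘ₗ X ∘ₗ ι₁ :=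
    ⟨{ toFun := fun X => π₁ ∘ₗ X ∘ₗ ι₁
       map_add' := fun X X' => by rw [LinearMap.add_comp, LinearMap.comp_add]
       map_smul' := fun c X => by rw [LinearMap.smul_comp, LinearMap.comp_smul, RingHom.id_apply] },
      fun X => rfl⟩
  obtain ⟨cL₂, hcL₂⟩ : ∃ L : Module.End ℚ U →ₗ[ℚ] Module.End ℚ V₂, ∀ X, L X = π₂ ∘ₗ X ∘ₗ ι₂ :=
    ⟨{ toFun := fun X => π₂ ∘ₗ X ∘ₗ ι₂
       map_add' := fun X X' => by rw [LinearMap.add_comp, LinearMap.comp_add]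
       map_smul' := fun c X => by rw [LinearMap.smul_comp, LinearMap.comp_smul, RingHom.id_apply] },
      fun X => rfl⟩
  obtain ⟨LC₁, hLC₁⟩ : ∃ L : Module.End ℂ (ℂ ⊗[ℚ] U) →ₗ[ℂ] Module.End ℂ (ℂ ⊗[ℚ] V₁),
      ∀ T, L T = π₁.baseChange ℂ ∘ₗ T ∘ₗ ι₁.baseChange ℂ :=
    ⟨{ toFun := fun T => π₁.baseChange ℂ ∘ₗ T ∘ₗ ι₁.baseChange ℂ
       map_add' := fun T T' => by rw [LinearMap.add_comp, LinearMap.comp_add]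
       map_smul' := fun c T => by rw [LinearMap.smul_comp, LinearMap.comp_smul, RingHom.id_apply] },
      fun T => rfl⟩
  obtain ⟨LC₂, hLC₂⟩ : ∃ L : Module.End ℂ (ℂ ⊗[ℚ] U) →ₗ[ℂ] Module.End ℂ (ℂ ⊗[ℚ] V₂),
      ∀ T, L T = π₂.baseChange ℂ ∘ₗ T ∘ₗ ι₂.baseChange ℂ :=
    ⟨{ toFun := fun T => π₂.baseChange ℂ ∘ₗ T ∘ₗ ι₂.baseChange ℂ
       map_add' := fun T T' => by rw [LinearMap.add_comp, LinearMap.comp_add]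
       map_smul' := fun c T => by rw [LinearMap.smul_comp, LinearMap.comp_smul, RingHom.id_apply] },
      fun T => rfl⟩
  have hLC₁c : ∀ X : Module.End ℚ U, LC₁ (X.baseChange ℂ) = (cL₁ X).baseChange ℂ := fun X => by
    rw [hLC₁, hcL₁, LinearMap.baseChange_comp, LinearMap.baseChange_comp]
  have hLC₂c : ∀ X : Module.End ℚ U, LC₂ (X.baseChange ℂ) = (cL₂ X).baseChange ℂ := fun X => by
    rw [hLC₂, hcL₂, LinearMap.baseChange_comp, LinearMap.baseChange_comp]
  -- corners of brackets
  have hc₁br : ∀ X ∈ 𝔞, ∀ X' ∈ 𝔞, π₁ ∘ₗ (X * X' - X' * X) ∘ₗ ι₁ =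
      (π₁ ∘ₗ X ∘ₗ ι₁) * (π₁ ∘ₗ X' ∘ₗ ι₁) - (π₁ ∘ₗ X' ∘ₗ ι₁) * (π₁ ∘ₗ X ∘ₗ ι₁) := fun X hX X' hX' =>
    corner_bracket hπι₁ hπι₂ hπ₁ι₂ hsum (hP₁ X hX) (hP₂ X hX) (hP₁ X' hX') (hP₂ X' hX')
  have hc₂br : ∀ X ∈ 𝔞, ∀ X' ∈ 𝔞, π₂ ∘ₗ (X * X' - X' * X) ∘ₗ ι₂ =
      (π₂ ∘ₗ X ∘ₗ ι₂) * (π₂ ∘ₗ X' ∘ₗ ι₂) - (π₂ ∘ₗ X' ∘ₗ ι₂) * (π₂ ∘ₗ X ∘ₗ ι₂) := fun X hX X' hX' =>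
    corner_bracket hπι₂ hπι₁ hπ₂ι₁ hsum' (hP₂ X hX) (hP₁ X hX) (hP₂ X' hX') (hP₁ X' hX')
  -- the corner algebras `𝔤₁ = c₁(𝔞)`, `𝔤₂ = c₂(𝔞)`
  set 𝔤₁ : Submodule ℚ (Module.End ℚ V₁) := 𝔞.map cL₁ with h𝔤₁
  have h𝔤₁mem : ∀ {Y}, Y ∈ 𝔤₁ ↔ ∃ X ∈ 𝔞, π₁ ∘ₗ X ∘ₗ ι₁ = Y := by
    intro Y
    rw [h𝔤₁, Submodule.mem_map]
    simp only [hcL₁]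
  have hbr𝔤₁ : ∀ Y ∈ 𝔤₁, ∀ Y' ∈ 𝔤₁, Y * Y' - Y' * Y ∈ 𝔤₁ := by
    intro Y hY Y' hY'
    obtain ⟨X, hX, rfl⟩ := h𝔤₁mem.1 hY
    obtain ⟨X', hX', rfl⟩ := h𝔤₁mem.1 hY'
    exact h𝔤₁mem.2 ⟨_, hbr X hX X' hX', hc₁br X hX X' hX'⟩
  have hskew𝔤₁ : ∀ Y ∈ 𝔤₁, ∀ v w, ψ₁.form (Y v) w + ψ₁.form v (Y w) = 0 := by
    intro Y hY v w
    obtain ⟨X, hX, rfl⟩ := h𝔤₁mem.1 hY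
    exact hskew₁ X hX v w
  set 𝔤₂ : Submodule ℚ (Module.End ℚ V₂) := 𝔞.map cL₂ with h𝔤₂
  have h𝔤₂mem : ∀ {Y}, Y ∈ 𝔤₂ ↔ ∃ X ∈ 𝔞, π₂ ∘ₗ X ∘ₗ ι₂ = Y := by
    intro Y
    rw [h𝔤₂, Submodule.mem_map]
    simp only [hcL₂]
  have hbr𝔤₂ : ∀ Y ∈ 𝔤₂, ∀ Y' ∈ 𝔤₂, Y * Y' - Y' * Y ∈ 𝔤₂ := by
    intro Y hY Y' hY'
    obtain ⟨X, hX, rfl⟩ := h𝔤₂mem.1 hY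
    obtain ⟨X', hX', rfl⟩ := h𝔤₂mem.1 hY'
    exact h𝔤₂mem.2 ⟨_, hbr X hX X' hX', hc₂br X hX X' hX'⟩
  have hskew𝔤₂ : ∀ Y ∈ 𝔤₂, ∀ v w, ψ₂.form (Y v) w + ψ₂.form v (Y w) = 0 := by
    intro Y hY v w
    obtain ⟨X, hX, rfl⟩ := h𝔤₂mem.1 hY
    exact hskew₂ X hX v w
  -- `Θ_i = c_i(Θ_U) ∈ (𝔤_i)_ℂ`
  have hΘ₁eq : LC₁ ΘU = Θ₁ := by
    rw [hLC₁]
    apply LinearMap.ext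
    intro x
    rw [LinearMap.comp_apply, LinearMap.comp_apply, hΘUι₁, proj_incl_baseChange hπι₁]
  have hΘ₂eq : LC₂ ΘU = Θ₂ := by
    rw [hLC₂]
    apply LinearMap.ext
    intro x
    rw [LinearMap.comp_apply, LinearMap.comp_apply, hΘUι₂, proj_incl_baseChange hπι₂]
  have hΘ𝔤₁ : Θ₁ ∈ spanC 𝔤₁ := by rw [← hΘ₁eq]; exact map_mem_spanC_map cL₁ LC₁ hLC₁c 𝔞 hΘU𝔞
  have hΘ𝔤₂ : Θ₂ ∈ spanC 𝔤₂ := by rw [← hΘ₂eq]; exact map_mem_spanC_map cL₂ LC₂ hLC₂c 𝔞 hΘU𝔞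
  -- (RIGID) for the second corner algebra
  have hfull₂ : ∀ Y : Module.End ℂ (ℂ ⊗[ℚ] V₂),
      (∀ x y, ψ₂.form.baseChange ℂ (Y x) y + ψ₂.form.baseChange ℂ x (Y y) = 0) → Y ∈ spanC 𝔤₂ :=
    hrigid 𝔤₂ hbr𝔤₂ hskew𝔤₂ hΘ𝔤₂
  -- `Θ² = 1` on the blocks and on `U`
  have hΘΘ₁ : ∀ v, Θ₁ (Θ₁ v) = v := theta_theta_apply H₁ hn heff₁ hΘ₁
  have hΘΘ₂ : ∀ v, Θ₂ (Θ₂ v) = v := theta_theta_apply H₂ hn heff₂ hΘ₂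
  have hΘΘUapp : ∀ y, ΘU (ΘU y) = y := by
    intro y
    conv_lhs => rw [← incl_proj_add_baseChange hsum y]
    rw [map_add, map_add, hΘUι₁, hΘUι₁, hΘΘ₁, hΘUι₂, hΘUι₂, hΘΘ₂]
    exact incl_proj_add_baseChange hsum y
  have hΘΘU : ΘU * ΘU = 1 := LinearMap.ext fun y => hΘΘUapp y
  -- block calculus for elements of `𝔞_ℂ`
  have hPC₁ : ∀ T ∈ spanC 𝔞, T * (ι₁.baseChange ℂ ∘ₗ π₁.baseChange ℂ) = (ι₁.baseChange ℂ ∘ₗ π₁.baseChange ℂ) * T := by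
    intro T hT
    have h := mul_baseChange_eq_of_mem_spanC hP₁ hT
    rwa [LinearMap.baseChange_comp] at h
  have hPC₂ : ∀ T ∈ spanC 𝔞, T * (ι₂.baseChange ℂ ∘ₗ π₂.baseChange ℂ) = (ι₂.baseChange ℂ ∘ₗ π₂.baseChange ℂ) * T := by
    intro T hT
    have h := mul_baseChange_eq_of_mem_spanC hP₂ hT
    rwa [LinearMap.baseChange_comp] at h
  have happlyι₁ : ∀ T ∈ spanC 𝔞, ∀ v, T (ι₁.baseChange ℂ v) = ι₁.baseChange ℂ (LC₁ T v) := by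
    intro T hT v
    have h := congrArg (fun S : Module.End ℂ (ℂ ⊗[ℚ] U) => S (ι₁.baseChange ℂ v)) (hPC₁ T hT)
    simp only [Module.End.mul_apply, LinearMap.comp_apply, proj_incl_baseChange hπι₁] at h
    rw [hLC₁, LinearMap.comp_apply, LinearMap.comp_apply]
    exact h
  have happlyι₂ : ∀ T ∈ spanC 𝔞, ∀ v, T (ι₂.baseChange ℂ v) = ι₂.baseChange ℂ (LC₂ T v) := by
    intro T hT v
    have h := congrArg (fun S : Module.End ℂ (ℂ ⊗[ℚ] U) => S (ι₂.baseChange ℂ v)) (hPC₂ T hT)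
    simp only [Module.End.mul_apply, LinearMap.comp_apply, proj_incl_baseChange hπι₂] at h
    rw [hLC₂, LinearMap.comp_apply, LinearMap.comp_apply]
    exact h
  have hprojT₁ : ∀ T ∈ spanC 𝔞, ∀ y, π₁.baseChange ℂ (T y) = LC₁ T (π₁.baseChange ℂ y) := by
    intro T hT y
    conv_lhs => rw [← incl_proj_add_baseChange hsum y]
    rw [map_add, happlyι₁ T hT, happlyι₂ T hT, map_add, proj_incl_baseChange hπι₁,
      proj_incl_baseChange_eq_zero hπ₁ι₂, add_zero]
  have hprojT₂ : ∀ T ∈ spanC 𝔞, ∀ y, π₂.baseChange ℂ (T y) = LC₂ T (π₂.baseChange ℂ y) := by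
    intro T hT y
    conv_lhs => rw [← incl_proj_add_baseChange hsum y]
    rw [map_add, happlyι₁ T hT, happlyι₂ T hT, map_add, proj_incl_baseChange_eq_zero hπ₂ι₁,
      proj_incl_baseChange hπι₂, zero_add]
  have hLC₁mul : ∀ T T' : Module.End ℂ (ℂ ⊗[ℚ] U), T' ∈ spanC 𝔞 → LC₁ (T * T') = LC₁ T * LC₁ T' := by
    intro T T' hT'
    rw [hLC₁, hLC₁, hLC₁]
    exact cornerC_mul hπι₁ (hPC₁ T' hT')
  have hLC₂mul : ∀ T T' : Module.End ℂ (ℂ ⊗[ℚ] U), T' ∈ spanC 𝔞 → LC₂ (T * T') = LC₂ T * LC₂ T' := by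
    intro T T' hT'
    rw [hLC₂, hLC₂, hLC₂]
    exact cornerC_mul hπι₂ (hPC₂ T' hT')
  -- the kernel `K = 𝔞 ∩ ker c₁`
  set K : Submodule ℚ (Module.End ℚ U) := 𝔞 ⊓ LinearMap.ker cL₁ with hK
  have hKmem : ∀ {X}, X ∈ K ↔ X ∈ 𝔞 ∧ π₁ ∘ₗ X ∘ₗ ι₁ = 0 := by
    intro X
    rw [hK, Submodule.mem_inf, LinearMap.mem_ker, hcL₁]
  have hKideal : ∀ X' ∈ 𝔞, ∀ X ∈ K, X' * X - X * X' ∈ K := by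
    intro X' hX' X hX
    obtain ⟨hX𝔞, hc₁X⟩ := hKmem.1 hX
    refine hKmem.2 ⟨hbr X' hX' X hX𝔞, ?_⟩
    rw [hc₁br X' hX' X hX𝔞, hc₁X, mul_zero, zero_mul, sub_zero]
  -- THE NEW STEP: `K ≠ 0`, the graph case being excluded by `Hom = 0`
  have hK0 : K ≠ ⊥ := by
    intro hKbot
    have hinj : ∀ X ∈ 𝔞, cL₁ X = 0 → X = 0 := fun X hX h0 => by
      have hXK : X ∈ K := hKmem.2 ⟨hX, by rw [← hcL₁]; exact h0⟩
      rw [hKbot] at hXK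
      exact (Submodule.mem_bot ℚ).1 hXK
    have hinjC : ∀ T ∈ spanC 𝔞, LC₁ T = 0 → T = 0 := fun T hT hT0 =>
      eq_zero_of_map_eq_zero_of_mem_spanC cL₁ LC₁ hLC₁c 𝔞 hinj hT hT0
    -- `𝔞₀ = 𝔞 ∩ ker c₂` and the ideal `𝔨₁ = c₁(𝔞₀)` of `𝔤₁`
    set 𝔞₀ : Submodule ℚ (Module.End ℚ U) := 𝔞 ⊓ LinearMap.ker cL₂ with h𝔞₀
    have h𝔞₀mem : ∀ {X}, X ∈ 𝔞₀ ↔ X ∈ 𝔞 ∧ π₂ ∘ₗ X ∘ₗ ι₂ = 0 := by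
      intro X
      rw [h𝔞₀, Submodule.mem_inf, LinearMap.mem_ker, hcL₂]
    have h𝔞₀ideal : ∀ X' ∈ 𝔞, ∀ X ∈ 𝔞₀, X' * X - X * X' ∈ 𝔞₀ := by
      intro X' hX' X hX
      obtain ⟨hX𝔞, hc₂X⟩ := h𝔞₀mem.1 hX
      refine h𝔞₀mem.2 ⟨hbr X' hX' X hX𝔞, ?_⟩
      rw [hc₂br X' hX' X hX𝔞, hc₂X, mul_zero, zero_mul, sub_zero]
    set 𝔨₁ : Submodule ℚ (Module.End ℚ V₁) := 𝔞₀.map cL₁ with h𝔨₁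
    have h𝔨₁mem : ∀ {Y}, Y ∈ 𝔨₁ ↔ ∃ X ∈ 𝔞₀, π₁ ∘ₗ X ∘ₗ ι₁ = Y := by
      intro Y
      rw [h𝔨₁, Submodule.mem_map]
      simp only [hcL₁]
    have h𝔨₁le : 𝔨₁ ≤ 𝔤₁ := Submodule.map_mono inf_le_left
    have h𝔨₁ideal : ∀ Y ∈ 𝔤₁, ∀ Y' ∈ 𝔨₁, Y * Y' - Y' * Y ∈ 𝔨₁ := by
      intro Y hY Y' hY'
      obtain ⟨X, hX, rfl⟩ := h𝔤₁mem.1 hY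
      obtain ⟨X', hX', rfl⟩ := h𝔨₁mem.1 hY'
      exact h𝔨₁mem.2 ⟨_, h𝔞₀ideal X hX X' hX', hc₁br X hX X' (h𝔞₀mem.1 hX').1⟩
    -- the complementary ideal `𝔤₃` and `𝔞₃ = 𝔞 ∩ c₁⁻¹(𝔤₃)`
    obtain ⟨𝔤₃, -, h𝔤₃ideal, h𝔨𝔤₃inf, h𝔨𝔤₃sup⟩ :=
      exists_ideal_compl H₁ hn heff₁ ψ₁ 𝔤₁ hbr𝔤₁ hΘ₁ hΘ𝔤₁ hskew𝔤₁ h𝔨₁le h𝔨₁ideal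
    set 𝔞₃ : Submodule ℚ (Module.End ℚ U) := 𝔞 ⊓ 𝔤₃.comap cL₁ with h𝔞₃
    have h𝔞₃mem : ∀ {X}, X ∈ 𝔞₃ ↔ X ∈ 𝔞 ∧ π₁ ∘ₗ X ∘ₗ ι₁ ∈ 𝔤₃ := by
      intro X
      rw [h𝔞₃, Submodule.mem_inf, Submodule.mem_comap, hcL₁]
    have h𝔞₃le : 𝔞₃ ≤ 𝔞 := inf_le_left
    have h𝔞₃leC : spanC 𝔞₃ ≤ spanC 𝔞 := spanC_mono h𝔞₃le
    have h𝔞₃ideal : ∀ X' ∈ 𝔞, ∀ X ∈ 𝔞₃, X' * X - X * X' ∈ 𝔞₃ := by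
      intro X' hX' X hX
      obtain ⟨hX𝔞, hc₁X⟩ := h𝔞₃mem.1 hX
      refine h𝔞₃mem.2 ⟨hbr X' hX' X hX𝔞, ?_⟩
      rw [hc₁br X' hX' X hX𝔞]
      exact h𝔤₃ideal _ (h𝔤₁mem.2 ⟨X', hX', rfl⟩) _ hc₁X
    have hbr𝔞₃ : ∀ X ∈ 𝔞₃, ∀ X' ∈ 𝔞₃, X * X' - X' * X ∈ 𝔞₃ := fun X hX X' hX' =>
      h𝔞₃ideal X (h𝔞₃le hX) X' hX'
    -- `c₂` is injective on `𝔞₃` (`𝔨₁ ∩ 𝔤₃ = 0`, `c₁` injective) and on `(𝔞₃)_ℂ`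
    have h𝔞₃inj : ∀ X ∈ 𝔞₃, cL₂ X = 0 → X = 0 := by
      intro X hX h0
      obtain ⟨hX𝔞, hc₁X⟩ := h𝔞₃mem.1 hX
      have hX0 : X ∈ 𝔞₀ := h𝔞₀mem.2 ⟨hX𝔞, by rw [← hcL₂]; exact h0⟩
      have hzero : π₁ ∘ₗ X ∘ₗ ι₁ ∈ 𝔨₁ ⊓ 𝔤₃ := Submodule.mem_inf.2 ⟨h𝔨₁mem.2 ⟨X, hX0, rfl⟩, hc₁X⟩
      rw [h𝔨𝔤₃inf, Submodule.mem_bot] at hzero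
      exact hinj X hX𝔞 (by rw [hcL₁]; exact hzero)
    have h𝔞₃injC : ∀ T ∈ spanC 𝔞₃, LC₂ T = 0 → T = 0 := fun T hT hT0 =>
      eq_zero_of_map_eq_zero_of_mem_spanC cL₂ LC₂ hLC₂c 𝔞₃ h𝔞₃inj hT hT0
    -- `𝔞 ⊆ 𝔞₀ + 𝔞₃`, so `c₂(𝔞) ⊆ c₂(𝔞₃)` and (RIGID) holds for `c₂(𝔞₃)`
    have h𝔞le : 𝔞 ≤ 𝔞₀ ⊔ 𝔞₃ := by
      intro X hX
      have hc₁ : π₁ ∘ₗ X ∘ₗ ι₁ ∈ 𝔨₁ ⊔ 𝔤₃ := by rw [h𝔨𝔤₃sup]; exact h𝔤₁mem.2 ⟨X, hX, rfl⟩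
      obtain ⟨k, hk, g, hg, hkg⟩ := Submodule.mem_sup.1 hc₁
      obtain ⟨X₀, hX₀, rfl⟩ := h𝔨₁mem.1 hk
      have hX₀𝔞 : X₀ ∈ 𝔞 := (h𝔞₀mem.1 hX₀).1
      refine Submodule.mem_sup.2 ⟨X₀, hX₀, X - X₀, h𝔞₃mem.2 ⟨Submodule.sub_mem _ hX hX₀𝔞, ?_⟩, by abel⟩
      have e : π₁ ∘ₗ (X - X₀) ∘ₗ ι₁ = g := by
        rw [LinearMap.sub_comp, LinearMap.comp_sub, ← hkg]
        abel
      rw [e]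
      exact hg
    set 𝔤₂₃ : Submodule ℚ (Module.End ℚ V₂) := 𝔞₃.map cL₂ with h𝔤₂₃
    have h𝔤₂₃mem : ∀ {Y}, Y ∈ 𝔤₂₃ ↔ ∃ X ∈ 𝔞₃, π₂ ∘ₗ X ∘ₗ ι₂ = Y := by
      intro Y
      rw [h𝔤₂₃, Submodule.mem_map]
      simp only [hcL₂]
    have h𝔤₂le : 𝔤₂ ≤ 𝔤₂₃ := by
      intro Y hY
      obtain ⟨X, hX, rfl⟩ := h𝔤₂mem.1 hY
      obtain ⟨X₀, hX₀, X₃, hX₃, rfl⟩ := Submodule.mem_sup.1 (h𝔞le hX)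
      refine h𝔤₂₃mem.2 ⟨X₃, hX₃, ?_⟩
      rw [LinearMap.add_comp, LinearMap.comp_add, (h𝔞₀mem.1 hX₀).2, zero_add]
    have hbr𝔤₂₃ : ∀ Y ∈ 𝔤₂₃, ∀ Y' ∈ 𝔤₂₃, Y * Y' - Y' * Y ∈ 𝔤₂₃ := by
      intro Y hY Y' hY'
      obtain ⟨X, hX, rfl⟩ := h𝔤₂₃mem.1 hY
      obtain ⟨X', hX', rfl⟩ := h𝔤₂₃mem.1 hY'
      exact h𝔤₂₃mem.2 ⟨_, hbr𝔞₃ X hX X' hX', hc₂br X (h𝔞₃le hX) X' (h𝔞₃le hX')⟩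
    have hskew𝔤₂₃ : ∀ Y ∈ 𝔤₂₃, ∀ v w, ψ₂.form (Y v) w + ψ₂.form v (Y w) = 0 := by
      intro Y hY v w
      obtain ⟨X, hX, rfl⟩ := h𝔤₂₃mem.1 hY
      exact hskew₂ X (h𝔞₃le hX) v w
    have hΘ𝔤₂₃ : Θ₂ ∈ spanC 𝔤₂₃ := spanC_mono h𝔤₂le hΘ𝔤₂
    have hfull₃ : ∀ Y : Module.End ℂ (ℂ ⊗[ℚ] V₂),
        (∀ x y, ψ₂.form.baseChange ℂ (Y x) y + ψ₂.form.baseChange ℂ x (Y y) = 0) → Y ∈ spanC 𝔤₂₃ :=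
      hrigid 𝔤₂₃ hbr𝔤₂₃ hskew𝔤₂₃ hΘ𝔤₂₃
    have hskewC₃ : ∀ T ∈ spanC 𝔞₃, ∀ x y,
        ψ₂.form.baseChange ℂ (LC₂ T x) y + ψ₂.form.baseChange ℂ x (LC₂ T y) = 0 := fun T hT =>
      ThetaSubalgebra.formBaseChange_add_eq_zero_of_mem_spanC ψ₂ hskew𝔤₂₃ (map_mem_spanC_map cL₂ LC₂ hLC₂c 𝔞₃ hT)
    -- THE GRAPH IS EXCLUDED. Data of `V₂ ⊗ ℂ`: `ω = ψ₂ ⊗ ℂ`, the Lagrangian pair `V₂^{1,0}`, `V₂^{0,1}` of `Θ₂`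
    obtain ⟨hPmem, hQmem, hΘ10, hΘ01, hΘΘ₂'⟩ := UnitaryTheta.theta_facts H₂ hn heff₂ hΘ₂
    have hΘ₂C : Θ₂ ∈ H₂.hodgeLieC := H₂.mem_hodgeLieC_of_forall_piece hΘ₂
    have hodd : Odd n := by rw [hn]; exact odd_one
    set ω := ψ₂.form.baseChange ℂ with hω
    have hωnd : ω.Nondegenerate := ψ₂.nondegenerate_baseChange
    have hωalt : ∀ x y, ω x y = -ω y x := fun x y => form_baseChange_swap_of_odd H₂ hodd ψ₂ y x
    have hΘskew : ∀ x y, ω (Θ₂ x) y + ω x (Θ₂ y) = 0 := fun x y => by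
      rw [hω, formBaseChange_skew_of_mem_hodgeLieC ψ₂ hΘ₂C x y, neg_add_cancel]
    have hP0 : H₂.piece 1 0 ≠ ⊥ := by
      intro hbot
      have h01 : H₂.piece 0 1 = ⊥ := by
        have h : Module.finrank ℂ (H₂.piece 1 0) = Module.finrank ℂ (H₂.piece 0 1) := hodgeNumber_symm_holds H₂ 1 0
        rw [hbot, finrank_bot] at h
        exact Submodule.finrank_eq_zero.1 h.symm
      have htop : (⊤ : Submodule ℂ (ℂ ⊗[ℚ] V₂)) = ⊥ := by
        rw [eq_bot_iff]
        intro v _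
        have hv : (2 : ℂ)⁻¹ • (v + Θ₂ v) + (2 : ℂ)⁻¹ • (v - Θ₂ v) = v := by module
        rw [← hv]
        have h1 : (2 : ℂ)⁻¹ • (v + Θ₂ v) ∈ (⊥ : Submodule ℂ (ℂ ⊗[ℚ] V₂)) := by rw [← hbot]; exact hPmem v
        have h2 : (2 : ℂ)⁻¹ • (v - Θ₂ v) ∈ (⊥ : Submodule ℂ (ℂ ⊗[ℚ] V₂)) := by rw [← h01]; exact hQmem v
        exact Submodule.add_mem _ h1 h2
      have h0 : Module.finrank ℂ (ℂ ⊗[ℚ] V₂) = 0 := by rw [← finrank_top, htop, finrank_bot]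
      rw [Module.finrank_baseChange] at h0
      exact hV₂ h0
    -- the complex skew operators `𝔰C = 𝔰𝔭(V₂ ⊗ ℂ, ψ₂)`
    let 𝔰C : Submodule ℂ (Module.End ℂ (ℂ ⊗[ℚ] V₂)) :=
      { carrier := {Y | ∀ x y, ω (Y x) y + ω x (Y y) = 0}
        zero_mem' := fun x y => by simp
        add_mem' := by
          intro Y Y' hY hY' x y
          simp only [LinearMap.add_apply, map_add]
          have h1 := hY x y
          have h2 := hY' x y
          linear_combination h1 + h2
        smul_mem' := by
          intro c Y hY x y
          simp only [LinearMap.smul_apply, map_smul, smul_eq_mul]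
          have h1 := hY x y
          linear_combination c * h1 }
    have h𝔰C : ∀ Y, Y ∈ 𝔰C ↔ ∀ x y, ω (Y x) y + ω x (Y y) = 0 := fun Y => Iff.rfl
    -- `ρ = c₁ ∘ (c₂|_{(𝔞₃)_ℂ})⁻¹ : 𝔰C → End(V₁ ⊗ ℂ)` (`c₂` is a bijection `(𝔞₃)_ℂ ≅ 𝔰C`)
    set f₃ : ↥(spanC 𝔞₃) →ₗ[ℂ] ↥𝔰C :=
      (LC₂.domRestrict (spanC 𝔞₃)).codRestrict 𝔰C (fun T => (h𝔰C _).2 (hskewC₃ T.1 T.2)) with hf₃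
    have hf₃apply : ∀ T : ↥(spanC 𝔞₃), (f₃ T : Module.End ℂ (ℂ ⊗[ℚ] V₂)) = LC₂ T := fun T => rfl
    have hf₃inj : Function.Injective f₃ := by
      intro T T' h
      have h' : LC₂ (T : Module.End ℂ (ℂ ⊗[ℚ] U)) = LC₂ (T' : Module.End ℂ (ℂ ⊗[ℚ] U)) := by
        rw [← hf₃apply, ← hf₃apply, h]
      apply Subtype.ext
      have h0 := h𝔞₃injC _ (Submodule.sub_mem _ T.2 T'.2) (by rw [map_sub, h', sub_self])
      exact sub_eq_zero.1 h0
    have hf₃surj : Function.Surjective f₃ := by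
      rintro ⟨Y, hY⟩
      obtain ⟨T, hT, hTY⟩ := exists_mem_spanC_map_eq cL₂ LC₂ hLC₂c 𝔞₃ (hfull₃ Y ((h𝔰C Y).1 hY))
      exact ⟨⟨T, hT⟩, Subtype.ext (by rw [hf₃apply]; exact hTY)⟩
    obtain ⟨eqv, heqv⟩ : ∃ e : ↥(spanC 𝔞₃) ≃ₗ[ℂ] ↥𝔰C, ∀ T, (e T : Module.End ℂ (ℂ ⊗[ℚ] V₂)) = LC₂ T :=
      ⟨LinearEquiv.ofBijective f₃ ⟨hf₃inj, hf₃surj⟩, fun T => rfl⟩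
    obtain ⟨K𝔰, hK𝔰⟩ := Submodule.exists_isCompl 𝔰C
    obtain ⟨ρ, hρdef⟩ : ∃ ρ : Module.End ℂ (ℂ ⊗[ℚ] V₂) →ₗ[ℂ] Module.End ℂ (ℂ ⊗[ℚ] V₁),
        ∀ Y, ρ Y = LC₁ ((eqv.symm (Submodule.projectionOnto 𝔰C K𝔰 hK𝔰 Y) : ↥(spanC 𝔞₃)) :
          Module.End ℂ (ℂ ⊗[ℚ] U)) :=
      ⟨LC₁ ∘ₗ (spanC 𝔞₃).subtype ∘ₗ eqv.symm.toLinearMap ∘ₗ Submodule.projectionOnto 𝔰C K𝔰 hK𝔰,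
        fun Y => rfl⟩
    have hρ : ∀ Y ∈ 𝔰C, ∃ T ∈ spanC 𝔞₃, LC₂ T = Y ∧ ρ Y = LC₁ T := by
      intro Y hY
      refine ⟨(eqv.symm ⟨Y, hY⟩ : ↥(spanC 𝔞₃)), (eqv.symm ⟨Y, hY⟩).2, ?_, ?_⟩
      · rw [← heqv, LinearEquiv.apply_symm_apply]
      · rw [hρdef, Submodule.projectionOnto_apply_of_mem_left hK𝔰 hY]
    have hρT : ∀ T ∈ spanC 𝔞₃, ρ (LC₂ T) = LC₁ T := by
      intro T hT
      obtain ⟨T', hT', hT'Y, hρY⟩ := hρ (LC₂ T) ((h𝔰C _).2 (hskewC₃ T hT))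
      have hTT' : T' = T := by
        have h := h𝔞₃injC (T' - T) (Submodule.sub_mem _ hT' hT) (by rw [map_sub, hT'Y, sub_self])
        exact sub_eq_zero.1 h
      rw [hρY, hTT']
    -- `ρ` preserves brackets, transports `ad Θ₂` to `ad Θ₁`, and is injective on `𝔰C`
    have hρbr : ∀ Y ∈ 𝔰C, ∀ Y' ∈ 𝔰C, ρ (Y * Y' - Y' * Y) = ρ Y * ρ Y' - ρ Y' * ρ Y := by
      intro Y hY Y' hY'
      obtain ⟨T, hT, rfl, hρY⟩ := hρ Y hY
      obtain ⟨T', hT', rfl, hρY'⟩ := hρ Y' hY'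
      rw [hρY, hρY', ← hLC₂mul T T' (h𝔞₃leC hT'), ← hLC₂mul T' T (h𝔞₃leC hT), ← map_sub,
        hρT _ (bracket_mem_spanC_of_forall hbr𝔞₃ hT hT'), map_sub, hLC₁mul T T' (h𝔞₃leC hT'),
        hLC₁mul T' T (h𝔞₃leC hT)]
    have hρΘ : ∀ Y ∈ 𝔰C, ρ (Θ₂ * Y - Y * Θ₂) = Θ₁ * ρ Y - ρ Y * Θ₁ := by
      intro Y hY
      obtain ⟨T, hT, rfl, hρY⟩ := hρ Y hY
      rw [hρY, ← hΘ₂eq, ← hLC₂mul ΘU T (h𝔞₃leC hT), ← hLC₂mul T ΘU hΘU𝔞, ← map_sub,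
        hρT _ (bracket_mem_spanC_of_forall h𝔞₃ideal hΘU𝔞 hT), map_sub, hLC₁mul ΘU T (h𝔞₃leC hT),
        hLC₁mul T ΘU hΘU𝔞, hΘ₁eq]
    have hρinj : ∀ Y ∈ 𝔰C, ρ Y = 0 → Y = 0 := by
      intro Y hY h0
      obtain ⟨T, hT, rfl, hρY⟩ := hρ Y hY
      rw [hρY] at h0
      rw [hinjC T (h𝔞₃leC hT) h0, map_zero]
    -- THE WITNESS: a non-zero `ρ`-equivariant `F : V₂ ⊗ ℂ → V₁ ⊗ ℂ` (the standard representation occurs)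
    obtain ⟨Fm, hFmne, hFmeq⟩ := SymplecticWitness.exists_equivariant_ne_zero ω hωnd hωalt hΘΘ₂' hΘskew hΘ10
      hΘ01 hPmem hQmem hP0 𝔰C h𝔰C hΘΘ₁ ρ hρbr hρΘ hρinj
    obtain ⟨Z', hZ'⟩ : ∃ Z' : Module.End ℂ (ℂ ⊗[ℚ] U), Z' = ι₁.baseChange ℂ ∘ₗ Fm ∘ₗ π₂.baseChange ℂ :=
      ⟨_, rfl⟩
    have hcommZ' : ∀ T ∈ spanC 𝔞, LC₁ T ∘ₗ Fm = Fm ∘ₗ LC₂ T → T * Z' = Z' * T := by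
      intro T hT hTF
      apply LinearMap.ext
      intro y
      rw [Module.End.mul_apply, Module.End.mul_apply, hZ', LinearMap.comp_apply, LinearMap.comp_apply,
        happlyι₁ T hT, LinearMap.comp_apply, LinearMap.comp_apply, hprojT₂ T hT, ← LinearMap.comp_apply (f := LC₁ T),
        hTF, LinearMap.comp_apply]
    have hcomm₃ : ∀ T ∈ spanC 𝔞₃, T * Z' = Z' * T := by
      intro T hT
      refine hcommZ' T (h𝔞₃leC hT) ?_
      have h := hFmeq (LC₂ T) ((h𝔰C _).2 (hskewC₃ T hT))
      rw [hρT T hT] at h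
      exact h
    -- descent: `Z'` lies in the complex span of the RATIONAL operators commuting with `𝔞₃` ...
    have hZ'span := mem_span_baseChange_of_forall_commute (𝔞₃ : Set (Module.End ℚ U)) (Y := Z')
      (fun X hX => (hcomm₃ _ (baseChange_mem_spanC hX)).symm)
    -- ... whose `(1,2)`-blocks vanish by `Hom = 0`: they are `ρ`-equivariant, hence intertwine `Θ₂`, `Θ₁`
    have hblock : ∀ Z : Module.End ℚ U, (∀ X ∈ (𝔞₃ : Set (Module.End ℚ U)), Z * X = X * Z) →
        π₁ ∘ₗ Z ∘ₗ ι₂ = 0 := by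
      intro Z hZ
      have hZC : ∀ T ∈ spanC 𝔞₃, T * Z.baseChange ℂ = Z.baseChange ℂ * T := fun T hT =>
        (commute_of_mem_spanC (𝔤 := 𝔞₃) (T := Z.baseChange ℂ) (fun X hX => by
          rw [← LinearMap.baseChange_mul, hZ X hX, LinearMap.baseChange_mul]) hT).symm
      have hfT : ∀ T ∈ spanC 𝔞₃, ∀ x, (π₁ ∘ₗ Z ∘ₗ ι₂).baseChange ℂ (LC₂ T x) =
          LC₁ T ((π₁ ∘ₗ Z ∘ₗ ι₂).baseChange ℂ x) := by
        intro T hT x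
        have hT𝔞 : T ∈ spanC 𝔞 := h𝔞₃leC hT
        rw [LinearMap.baseChange_comp, LinearMap.baseChange_comp, LinearMap.comp_apply, LinearMap.comp_apply,
          LinearMap.comp_apply, LinearMap.comp_apply, ← happlyι₂ T hT𝔞, ← Module.End.mul_apply (f := Z.baseChange ℂ),
          ← hZC T hT, Module.End.mul_apply, hprojT₁ T hT𝔞]
      refine hHom _ (SymplecticWitness.theta_comp_eq_of_equivariant ω hωnd hωalt hΘskew hΘ10 hΘ01 hPmem hQmem
        𝔰C h𝔰C hΘΘ₁ ρ hρΘ _ fun Y hY => ?_)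
      obtain ⟨T, hT, rfl, hρY⟩ := hρ Y hY
      rw [hρY]
      exact LinearMap.ext fun x => (hfT T hT x).symm
    -- hence the `(1,2)`-block `Fm` of `Z'` vanishes: contradiction
    obtain ⟨Φ, hΦ⟩ : ∃ L : Module.End ℂ (ℂ ⊗[ℚ] U) →ₗ[ℂ] (ℂ ⊗[ℚ] V₂ →ₗ[ℂ] ℂ ⊗[ℚ] V₁),
        ∀ T, L T = π₁.baseChange ℂ ∘ₗ T ∘ₗ ι₂.baseChange ℂ :=
      ⟨{ toFun := fun T => π₁.baseChange ℂ ∘ₗ T ∘ₗ ι₂.baseChange ℂ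
         map_add' := fun T T' => by rw [LinearMap.add_comp, LinearMap.comp_add]
         map_smul' := fun c T => by rw [LinearMap.smul_comp, LinearMap.comp_smul, RingHom.id_apply] },
        fun T => rfl⟩
    have hΦspan : ∀ T ∈ Submodule.span ℂ ((fun Z : Module.End ℚ U => Z.baseChange ℂ) ''
        {Z | ∀ X ∈ (𝔞₃ : Set (Module.End ℚ U)), Z * X = X * Z}), Φ T = 0 := by
      intro T hT
      induction hT using Submodule.span_induction with
      | mem T' hT' =>
        obtain ⟨Z, hZ, rfl⟩ := hT'
        rw [hΦ, ← LinearMap.baseChange_comp, ← LinearMap.baseChange_comp, hblock Z hZ, LinearMap.baseChange_zero]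
      | zero => rw [map_zero]
      | add T' T'' _ _ h' h'' => rw [map_add, h', h'', add_zero]
      | smul c T' _ h' => rw [map_smul, h', smul_zero]
    have hFm0' : Fm = 0 := by
      have h := hΦspan Z' hZ'span
      rw [hΦ, hZ'] at h
      have h' : π₁.baseChange ℂ ∘ₗ (ι₁.baseChange ℂ ∘ₗ Fm ∘ₗ π₂.baseChange ℂ) ∘ₗ ι₂.baseChange ℂ = Fm := by
        apply LinearMap.ext
        intro x
        simp only [LinearMap.comp_apply, proj_incl_baseChange hπι₁, proj_incl_baseChange hπι₂]
      rw [h'] at h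
      exact h
    exact hFmne hFm0' 
  -- FROM HERE ON: the tree's Goursat argument (`goursat_incl_corner_mem`) verbatim
  obtain ⟨X₀, hX₀K, hX₀ne⟩ := (Submodule.ne_bot_iff K).1 hK0
  set 𝔤K : Submodule ℚ (Module.End ℚ V₂) := K.map cL₂ with h𝔤K
  have h𝔤Kmem : ∀ {Y}, Y ∈ 𝔤K ↔ ∃ X ∈ K, π₂ ∘ₗ X ∘ₗ ι₂ = Y := by
    intro Y
    rw [h𝔤K, Submodule.mem_map]
    simp only [hcL₂]
  have h𝔤Kle : 𝔤K ≤ 𝔤₂ := Submodule.map_mono inf_le_left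
  have hideal𝔤K : ∀ Y ∈ 𝔤₂, ∀ Y' ∈ 𝔤K, Y * Y' - Y' * Y ∈ 𝔤K := by
    intro Y hY Y' hY'
    obtain ⟨X, hX, rfl⟩ := h𝔤₂mem.1 hY
    obtain ⟨X', hX', rfl⟩ := h𝔤Kmem.1 hY'
    exact h𝔤Kmem.2 ⟨_, hKideal X hX X' hX', hc₂br X hX X' (hKmem.1 hX').1⟩
  have hskew𝔤K : ∀ Y ∈ 𝔤K, ∀ v w, ψ₂.form (Y v) w + ψ₂.form v (Y w) = 0 :=
    fun Y hY => hskew𝔤₂ Y (h𝔤Kle hY)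
  have hc₂X₀ : π₂ ∘ₗ X₀ ∘ₗ ι₂ ≠ 0 := by
    intro h0
    obtain ⟨hX₀𝔞, hc₁X₀⟩ := hKmem.1 hX₀K
    apply hX₀ne
    rw [eq_incl_corner_add hπι₁ hπι₂ hsum (hP₁ X₀ hX₀𝔞) (hP₂ X₀ hX₀𝔞), hc₁X₀, h0]
    simp only [LinearMap.zero_comp, LinearMap.comp_zero, add_zero]
  have hI0 : spanC 𝔤K ≠ ⊥ := by
    intro hbot
    apply hc₂X₀
    have hmem : (π₂ ∘ₗ X₀ ∘ₗ ι₂).baseChange ℂ ∈ spanC 𝔤K := baseChange_mem_spanC (h𝔤Kmem.2 ⟨X₀, hX₀K, rfl⟩)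
    rw [hbot, Submodule.mem_bot] at hmem
    have h : π₂ ∘ₗ X₀ ∘ₗ ι₂ ∈ (⊥ : Submodule ℚ (Module.End ℚ V₂)) :=
      mem_of_baseChange_mem_spanC ⊥ (by rw [hmem]; exact Submodule.zero_mem _)
    exact (Submodule.mem_bot ℚ).1 h
  have hIskew : ∀ Y ∈ spanC 𝔤K, ∀ x y, ψ₂.form.baseChange ℂ (Y x) y + ψ₂.form.baseChange ℂ x (Y y) = 0 :=
    fun Y hY => ThetaSubalgebra.formBaseChange_add_eq_zero_of_mem_spanC ψ₂ hskew𝔤K hY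
  have hIideal : ∀ Zc : Module.End ℂ (ℂ ⊗[ℚ] V₂),
      (∀ x y, ψ₂.form.baseChange ℂ (Zc x) y + ψ₂.form.baseChange ℂ x (Zc y) = 0) →
        ∀ Y ∈ spanC 𝔤K, Zc * Y - Y * Zc ∈ spanC 𝔤K :=
    fun Zc hZc Y hY => bracket_mem_spanC_of_forall hideal𝔤K (hfull₂ Zc hZc) hY
  -- (IDEAL): `Θ₂ ∈ c₂(K)_ℂ`; (RIGID): `c₂(K)_ℂ` is everything skew
  have hΘK : Θ₂ ∈ spanC 𝔤K :=
    SymplecticIdeal.theta_mem_of_ne_bot_hodge H₂ hn heff₂ ψ₂ hΘ₂ _ hIskew hIideal hI0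
  have hbr𝔤K : ∀ Y ∈ 𝔤K, ∀ Y' ∈ 𝔤K, Y * Y' - Y' * Y ∈ 𝔤K := fun Y hY Y' hY' =>
    hideal𝔤K Y (h𝔤Kle hY) Y' hY'
  have hfullK : ∀ Y : Module.End ℂ (ℂ ⊗[ℚ] V₂),
      (∀ x y, ψ₂.form.baseChange ℂ (Y x) y + ψ₂.form.baseChange ℂ x (Y y) = 0) → Y ∈ spanC 𝔤K :=
    hrigid 𝔤K hbr𝔤K hskew𝔤K hΘK
  -- descent: every rational skew `Z₂` is `c₂` of an element `ι₂ Z₂ π₂` of `K`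
  have hconcl₂ : ∀ Z₂ : Module.End ℚ V₂, (∀ v w, ψ₂.form (Z₂ v) w + ψ₂.form v (Z₂ w) = 0) →
      ι₂ ∘ₗ Z₂ ∘ₗ π₂ ∈ 𝔞 := by
    intro Z₂ hZ₂
    have hmemC : Z₂.baseChange ℂ ∈ spanC 𝔤K :=
      hfullK _ (ThetaSubalgebra.formBaseChange_add_eq_zero_of_skew ψ₂ hZ₂)
    obtain ⟨X, hXK, hXeq⟩ := h𝔤Kmem.1 (mem_of_baseChange_mem_spanC 𝔤K hmemC)
    obtain ⟨hX𝔞, hc₁X⟩ := hKmem.1 hXK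
    have hdec := eq_incl_corner_add hπι₁ hπι₂ hsum (hP₁ X hX𝔞) (hP₂ X hX𝔞)
    rw [hc₁X, hXeq] at hdec
    simp only [LinearMap.zero_comp, LinearMap.comp_zero, zero_add] at hdec
    rw [← hdec]
    exact hX𝔞
  refine ⟨fun X hX => ?_, hconcl₂⟩
  have hdec := eq_incl_corner_add hπι₁ hπι₂ hsum (hP₁ X hX) (hP₂ X hX)
  have h2 : ι₂ ∘ₗ (π₂ ∘ₗ X ∘ₗ ι₂) ∘ₗ π₂ ∈ 𝔞 := hconcl₂ _ (hskew₂ X hX)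
  have heq : ι₁ ∘ₗ (π₁ ∘ₗ X ∘ₗ ι₁) ∘ₗ π₁ = X - ι₂ ∘ₗ (π₂ ∘ₗ X ∘ₗ ι₂) ∘ₗ π₂ :=
    eq_sub_of_add_eq hdec.symm
  rw [heq]
  exact Submodule.sub_mem _ hX h2

end Goursat

/-! ### §5 The theorems: `hg(X₁) ⊕ 0` and `0 ⊕ 𝔰𝔭(V₂ ⊗ ℂ)` kill every rational tensor killed by `Θ_U` -/

section Main

universe u

variable {U V₁ V₂ : Type u} [AddCommGroup U] [Module ℚ U] [AddCommGroup V₁] [Module ℚ V₁]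
  [AddCommGroup V₂] [Module ℚ V₂] [Module.Finite ℚ U] [Module.Finite ℚ V₁] [Module.Finite ℚ V₂]
  [HodgeTensorFacts.{u, u}] {n : ℤ}
variable {M d m : ℕ}


omit [Module.Finite ℚ U] [Module.Finite ℚ V₁] [Module.Finite ℚ V₂] [HodgeTensorFacts.{u, u}] in
/-- Complexification of a sum of bilinear forms, evaluated (a copy of the private lemma of
`HodgeThetaAnnihilatorRealBlocksTimesSymplectic`). [folklore] -/
private theorem baseChange_add_apply' (B B' : LinearMap.BilinForm ℚ U) (x y : ℂ ⊗[ℚ] U) :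
    LinearMap.BilinForm.baseChange ℂ (B + B') x y =
      LinearMap.BilinForm.baseChange ℂ B x y + LinearMap.BilinForm.baseChange ℂ B' x y := by
  induction x using TensorProduct.induction_on with
  | zero => simp
  | tmul c v =>
    induction y using TensorProduct.induction_on with
    | zero => simp
    | tmul d w =>
      simp only [LinearMap.BilinForm.baseChange_tmul, LinearMap.add_apply, add_smul]
    | add y y' hy hy' => rw [map_add, map_add, map_add, hy, hy']; abel
  | add x x' hx hx' =>
    rw [map_add, LinearMap.add_apply, map_add, map_add, LinearMap.add_apply, LinearMap.add_apply, hx, hx']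
    abel

/-- **The core (Moonen–Zarhin Lemma (3.4) for a rigid symplectic second factor, Lie form, word model).** For the
annihilator algebra `𝔞 = annLie φ eQ aF q` of a rational tensor `q` on `U = ι₁V₁ ⊕ ι₂V₂` killed by `Θ_U`
(`φ = ψ₁(π₁·,π₁·) + ψ₂(π₂·,π₂·)`; `aF` = the Hodge endomorphisms `ι₁ a π₁`, `a ∈ End_Hdg(V₁)`, and the two
projectors), where `V₂ ≠ 0` satisfies (RIGID) (every admissible rational Lie algebra of `(V₂, ψ₂)` complexifies
onto `𝔰𝔭(V₂ ⊗ ℂ)`: `hg(X₂) = 𝔰𝔭_{2g}` for EVERY admissible algebra — the tree's theorems for `g ≤ 3`,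
`End⁰(X₂) = ℚ`) and `Hom_Hdg(V₂, V₁) = 0`: `ι₁ c₁X π₁ ∈ 𝔞` for all `X ∈ 𝔞`, `ι₂ Z π₂ ∈ 𝔞` for all rational
`ψ₂`-skew `Z`, and `Θ_U ∈ 𝔞_ℂ` («either `Hg(X) = Hg(X₁) × Hg(X₂)` or `Hom(X₂, X₁) ≠ 0`»).
[cite: MoonenZarhin1999LowDim, §3 (3.1) and Lemma (3.4)] [cite: Deligne1982HodgeCycles, I §3 (proof of Prop. 3.4)] -/
theorem incl_corner_mem_annLie_of_times_rigidSymplectic (hn : n = 1) (HU : HodgeStructure U n)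
    (H₁ : HodgeStructure V₁ n) (H₂ : HodgeStructure V₂ n) (heff₁ : H₁.IsEffective) (heff₂ : H₂.IsEffective)
    {ι₁ : V₁ →ₗ[ℚ] U} {π₁ : U →ₗ[ℚ] V₁} {ι₂ : V₂ →ₗ[ℚ] U} {π₂ : U →ₗ[ℚ] V₂}
    (hπι₁ : π₁ ∘ₗ ι₁ = LinearMap.id) (hπι₂ : π₂ ∘ₗ ι₂ = LinearMap.id) (hπ₁ι₂ : π₁ ∘ₗ ι₂ = 0)
    (hπ₂ι₁ : π₂ ∘ₗ ι₁ = 0) (hsum : ι₁ ∘ₗ π₁ + ι₂ ∘ₗ π₂ = LinearMap.id)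
    (hι₁F : ∀ p, ∀ x ∈ H₁.piece p (n - p), ι₁.baseChange ℂ x ∈ HU.piece p (n - p))
    (hι₂F : ∀ p, ∀ x ∈ H₂.piece p (n - p), ι₂.baseChange ℂ x ∈ HU.piece p (n - p))
    (ψ₁ : H₁.Polarization) (ψ₂ : H₂.Polarization)
    (hV₂ : Module.finrank ℚ V₂ ≠ 0)
    (hrigid : ∀ {Θ₂ : Module.End ℂ (ℂ ⊗[ℚ] V₂)}, (∀ p, ∀ x ∈ H₂.piece p (n - p), Θ₂ x = ((2 * p - n : ℤ) : ℂ) • x) →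
      ∀ 𝔤₂ : Submodule ℚ (Module.End ℚ V₂), (∀ X ∈ 𝔤₂, ∀ X' ∈ 𝔤₂, X * X' - X' * X ∈ 𝔤₂) →
      (∀ X ∈ 𝔤₂, ∀ v w, ψ₂.form (X v) w + ψ₂.form v (X w) = 0) → Θ₂ ∈ spanC 𝔤₂ →
      ∀ Y : Module.End ℂ (ℂ ⊗[ℚ] V₂),
        (∀ x y, ψ₂.form.baseChange ℂ (Y x) y + ψ₂.form.baseChange ℂ x (Y y) = 0) → Y ∈ spanC 𝔤₂)
    (hHom : ∀ f : V₂ →ₗ[ℚ] V₁,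
      (∀ p, ∀ x ∈ H₂.piece p (n - p), f.baseChange ℂ x ∈ H₁.piece p (n - p)) → f = 0)
    (eQ : Module.Basis (Fin M) ℚ U) (q : (Fin d → Fin m × Fin M) → ℚ)
    {ΘU : Module.End ℂ (ℂ ⊗[ℚ] U)} (hΘU : ∀ p, ∀ x ∈ HU.piece p (n - p), ΘU x = ((2 * p - n : ℤ) : ℂ) • x)
    (hΘq : ∀ u : Fin d → Fin m, wordDerAt ℂ (fun _ : Fin d =>
      LinearMap.toMatrix (Algebra.TensorProduct.basis ℂ eQ) (Algebra.TensorProduct.basis ℂ eQ) ΘU)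
      (wordSlice (fun w => algebraMap ℚ ℂ (q w)) u) = 0) :
    (∀ X ∈ annLie (ψ₁.form.compl₁₂ π₁ π₁ + ψ₂.form.compl₁₂ π₂ π₂) eQ
        (Sum.elim (fun a : H₁.endAlg => ι₁ ∘ₗ (a : Module.End ℚ V₁) ∘ₗ π₁)
          (Sum.elim (fun _ : Unit => ι₁ ∘ₗ π₁) (fun _ : Unit => ι₂ ∘ₗ π₂))) q,
      ι₁ ∘ₗ (π₁ ∘ₗ X ∘ₗ ι₁) ∘ₗ π₁ ∈ annLie (ψ₁.form.compl₁₂ π₁ π₁ + ψ₂.form.compl₁₂ π₂ π₂) eQ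
        (Sum.elim (fun a : H₁.endAlg => ι₁ ∘ₗ (a : Module.End ℚ V₁) ∘ₗ π₁)
          (Sum.elim (fun _ : Unit => ι₁ ∘ₗ π₁) (fun _ : Unit => ι₂ ∘ₗ π₂))) q) ∧
    (∀ Z₂ : Module.End ℚ V₂, (∀ v w, ψ₂.form (Z₂ v) w + ψ₂.form v (Z₂ w) = 0) →
      ι₂ ∘ₗ Z₂ ∘ₗ π₂ ∈ annLie (ψ₁.form.compl₁₂ π₁ π₁ + ψ₂.form.compl₁₂ π₂ π₂) eQ
        (Sum.elim (fun a : H₁.endAlg => ι₁ ∘ₗ (a : Module.End ℚ V₁) ∘ₗ π₁)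
          (Sum.elim (fun _ : Unit => ι₁ ∘ₗ π₁) (fun _ : Unit => ι₂ ∘ₗ π₂))) q) ∧
    ΘU ∈ spanC (annLie (ψ₁.form.compl₁₂ π₁ π₁ + ψ₂.form.compl₁₂ π₂ π₂) eQ
        (Sum.elim (fun a : H₁.endAlg => ι₁ ∘ₗ (a : Module.End ℚ V₁) ∘ₗ π₁)
          (Sum.elim (fun _ : Unit => ι₁ ∘ₗ π₁) (fun _ : Unit => ι₂ ∘ₗ π₂))) q) := by
  classical
  obtain ⟨Θ₁, hΘ₁⟩ := exists_hodgeTheta H₁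
  obtain ⟨Θ₂, hΘ₂⟩ := exists_hodgeTheta H₂
  have hΘ₁C : Θ₁ ∈ H₁.hodgeLieC := H₁.mem_hodgeLieC_of_forall_piece hΘ₁
  have hΘ₂C : Θ₂ ∈ H₂.hodgeLieC := H₂.mem_hodgeLieC_of_forall_piece hΘ₂
  have hsum' : ι₂ ∘ₗ π₂ + ι₁ ∘ₗ π₁ = LinearMap.id := by rw [add_comm]; exact hsum
  have e11 : ∀ v, π₁ (ι₁ v) = v := fun v => by
    rw [← LinearMap.comp_apply (f := π₁), hπι₁, LinearMap.id_apply]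
  have e22 : ∀ w, π₂ (ι₂ w) = w := fun w => by
    rw [← LinearMap.comp_apply (f := π₂), hπι₂, LinearMap.id_apply]
  have e12 : ∀ w, π₁ (ι₂ w) = 0 := fun w => by
    rw [← LinearMap.comp_apply (f := π₁), hπ₁ι₂, LinearMap.zero_apply]
  have e21 : ∀ v, π₂ (ι₁ v) = 0 := fun v => by
    rw [← LinearMap.comp_apply (f := π₂), hπ₂ι₁, LinearMap.zero_apply]
  -- `Θ` through the presentation
  have hΘι₁ := theta_incl_eq HU H₁ hι₁F hΘU hΘ₁
  have hΘι₂ := theta_incl_eq HU H₂ hι₂F hΘU hΘ₂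
  have hΘπ₁ := proj_theta_eq HU H₁ H₂ hπι₁ hπ₁ι₂ hsum hι₁F hι₂F hΘU hΘ₁ hΘ₂
  have hΘπ₂ := proj_theta_eq HU H₂ H₁ hπι₂ hπ₂ι₁ hsum' hι₂F hι₁F hΘU hΘ₂ hΘ₁
  -- the commuting family and the orthogonal-sum form
  set aF : H₁.endAlg ⊕ (Unit ⊕ Unit) → Module.End ℚ U :=
    Sum.elim (fun a : H₁.endAlg => ι₁ ∘ₗ (a : Module.End ℚ V₁) ∘ₗ π₁)
      (Sum.elim (fun _ : Unit => ι₁ ∘ₗ π₁) (fun _ : Unit => ι₂ ∘ₗ π₂)) with haF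
  set φ : LinearMap.BilinForm ℚ U := ψ₁.form.compl₁₂ π₁ π₁ + ψ₂.form.compl₁₂ π₂ π₂ with hφ
  have hφC : ∀ x y, φ.baseChange ℂ x y = ψ₁.form.baseChange ℂ (π₁.baseChange ℂ x) (π₁.baseChange ℂ y) +
      ψ₂.form.baseChange ℂ (π₂.baseChange ℂ x) (π₂.baseChange ℂ y) := fun x y => by
    rw [hφ, baseChange_add_apply', baseChange_compl₁₂_apply, baseChange_compl₁₂_apply]
  have hφapply : ∀ x y, φ x y = ψ₁.form (π₁ x) (π₁ y) + ψ₂.form (π₂ x) (π₂ y) := fun x y => by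
    rw [hφ, LinearMap.add_apply, LinearMap.add_apply, LinearMap.compl₁₂_apply, LinearMap.compl₁₂_apply]
  set 𝔞 : Submodule ℚ (Module.End ℚ U) := annLie φ eQ aF q with h𝔞
  -- `Θ_U ∈ 𝔞_ℂ`
  have hΘ𝔞 : ΘU ∈ spanC 𝔞 := by
    refine mem_spanC_annLie φ eQ aF q hΘq (fun i => ?_) (fun x y => ?_)
    · apply LinearMap.ext
      intro y
      rcases i with a | (_ | _)
      · change ΘU ((ι₁ ∘ₗ (a : Module.End ℚ V₁) ∘ₗ π₁).baseChange ℂ y) =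
          (ι₁ ∘ₗ (a : Module.End ℚ V₁) ∘ₗ π₁).baseChange ℂ (ΘU y)
        simp only [LinearMap.baseChange_comp, LinearMap.comp_apply]
        rw [hΘι₁, ← Module.End.mul_apply (f := Θ₁), commute_baseChange_of_mem_hodgeLieC H₁ hΘ₁C a,
          Module.End.mul_apply, hΘπ₁]
      · change ΘU ((ι₁ ∘ₗ π₁).baseChange ℂ y) = (ι₁ ∘ₗ π₁).baseChange ℂ (ΘU y)
        simp only [LinearMap.baseChange_comp, LinearMap.comp_apply]
        rw [hΘι₁, hΘπ₁]
      · change ΘU ((ι₂ ∘ₗ π₂).baseChange ℂ y) = (ι₂ ∘ₗ π₂).baseChange ℂ (ΘU y)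
        simp only [LinearMap.baseChange_comp, LinearMap.comp_apply]
        rw [hΘι₂, hΘπ₂]
    · rw [hφC, hφC, hΘπ₁, hΘπ₁, hΘπ₂, hΘπ₂, formBaseChange_skew_of_mem_hodgeLieC ψ₁ hΘ₁C,
        formBaseChange_skew_of_mem_hodgeLieC ψ₂ hΘ₂C]
      ring
  -- what membership in `𝔞` gives
  have hbr𝔞 : ∀ X ∈ 𝔞, ∀ X' ∈ 𝔞, X * X' - X' * X ∈ 𝔞 := fun X hX X' hX' =>
    commutator_mem_annLie φ eQ aF q hX hX'
  have hmem : ∀ X ∈ 𝔞, (∀ i, X * aF i = aF i * X) ∧ ∀ v w, φ (X v) w + φ v (X w) = 0 :=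
    fun X hX => ((mem_annLie_iff φ eQ aF q X).1 hX).2
  have hP₁ : ∀ X ∈ 𝔞, X * (ι₁ ∘ₗ π₁) = (ι₁ ∘ₗ π₁) * X := fun X hX => (hmem X hX).1 (Sum.inr (Sum.inl ()))
  have hP₂ : ∀ X ∈ 𝔞, X * (ι₂ ∘ₗ π₂) = (ι₂ ∘ₗ π₂) * X := fun X hX => (hmem X hX).1 (Sum.inr (Sum.inr ()))
  have hc₁skew : ∀ X ∈ 𝔞, ∀ v w, ψ₁.form ((π₁ ∘ₗ X ∘ₗ ι₁) v) w + ψ₁.form v ((π₁ ∘ₗ X ∘ₗ ι₁) w) = 0 := by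
    intro X hX v w
    have h := (hmem X hX).2 (ι₁ v) (ι₁ w)
    rw [apply_incl_eq_of_commute_projector hπι₁ (hP₁ X hX) v,
      apply_incl_eq_of_commute_projector hπι₁ (hP₁ X hX) w, hφapply, hφapply] at h
    simp only [e11, e21, map_zero, add_zero] at h
    simpa only [LinearMap.comp_apply] using h
  have hc₂skew : ∀ X ∈ 𝔞, ∀ v w, ψ₂.form ((π₂ ∘ₗ X ∘ₗ ι₂) v) w + ψ₂.form v ((π₂ ∘ₗ X ∘ₗ ι₂) w) = 0 := by
    intro X hX v w
    have h := (hmem X hX).2 (ι₂ v) (ι₂ w)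
    rw [apply_incl_eq_of_commute_projector hπι₂ (hP₂ X hX) v,
      apply_incl_eq_of_commute_projector hπι₂ (hP₂ X hX) w, hφapply, hφapply] at h
    simp only [e22, e12, map_zero, zero_add] at h
    simpa only [LinearMap.comp_apply] using h
  -- (HOM) in the `Θ`-form and the Goursat step
  have hHom' : ∀ f : V₂ →ₗ[ℚ] V₁, Θ₁ ∘ₗ f.baseChange ℂ = f.baseChange ℂ ∘ₗ Θ₂ → f = 0 := fun f hf =>
    eq_zero_of_theta_comp_eq_of_hom_eq_zero hn H₁ H₂ heff₁ heff₂ hΘ₁ hΘ₂ hHom hf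
  obtain ⟨h1, h2⟩ := goursat_incl_corner_mem_of_hom_eq_zero_of_rigid hn H₁ H₂ heff₁ heff₂ hπι₁ hπι₂ hπ₁ι₂ hπ₂ι₁ hsum 𝔞
    hbr𝔞 hP₁ hP₂ ψ₁ ψ₂ hc₁skew hc₂skew hV₂ hΘ₁ hΘ₂ (hrigid hΘ₂) hΘ𝔞 hΘι₁ hΘι₂ hHom'
  exact ⟨h1, h2, hΘ𝔞⟩

/-- **`0 ⊕ 𝔰𝔭(V₂ ⊗ ℂ) ⊆ 𝔞(q)_ℂ`**: with the hypotheses of the core theorem, `ι₂ ∘ Y ∘ π₂ ∈ 𝔞(q)_ℂ` for EVERY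
`ψ₂`-skew operator `Y` of `V₂ ⊗ ℂ` («`Hg(X₁ × X₂) ⊇ 1 × Hg(X₂) = 1 × Sp_{2g}`» read on tensors).
[cite: MoonenZarhin1999LowDim, §3 (3.1) and Lemma (3.4)] [cite: Deligne1982HodgeCycles, I §3 (proof of Prop. 3.4)] -/
theorem incl₂_comp_proj_mem_spanC_annLie_of_times_rigidSymplectic (hn : n = 1) (HU : HodgeStructure U n)
    (H₁ : HodgeStructure V₁ n) (H₂ : HodgeStructure V₂ n) (heff₁ : H₁.IsEffective) (heff₂ : H₂.IsEffective)
    {ι₁ : V₁ →ₗ[ℚ] U} {π₁ : U →ₗ[ℚ] V₁} {ι₂ : V₂ →ₗ[ℚ] U} {π₂ : U →ₗ[ℚ] V₂}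
    (hπι₁ : π₁ ∘ₗ ι₁ = LinearMap.id) (hπι₂ : π₂ ∘ₗ ι₂ = LinearMap.id) (hπ₁ι₂ : π₁ ∘ₗ ι₂ = 0)
    (hπ₂ι₁ : π₂ ∘ₗ ι₁ = 0) (hsum : ι₁ ∘ₗ π₁ + ι₂ ∘ₗ π₂ = LinearMap.id)
    (hι₁F : ∀ p, ∀ x ∈ H₁.piece p (n - p), ι₁.baseChange ℂ x ∈ HU.piece p (n - p))
    (hι₂F : ∀ p, ∀ x ∈ H₂.piece p (n - p), ι₂.baseChange ℂ x ∈ HU.piece p (n - p))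
    (ψ₁ : H₁.Polarization) (ψ₂ : H₂.Polarization)
    (hV₂ : Module.finrank ℚ V₂ ≠ 0)
    (hrigid : ∀ {Θ₂ : Module.End ℂ (ℂ ⊗[ℚ] V₂)}, (∀ p, ∀ x ∈ H₂.piece p (n - p), Θ₂ x = ((2 * p - n : ℤ) : ℂ) • x) →
      ∀ 𝔤₂ : Submodule ℚ (Module.End ℚ V₂), (∀ X ∈ 𝔤₂, ∀ X' ∈ 𝔤₂, X * X' - X' * X ∈ 𝔤₂) →
      (∀ X ∈ 𝔤₂, ∀ v w, ψ₂.form (X v) w + ψ₂.form v (X w) = 0) → Θ₂ ∈ spanC 𝔤₂ →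
      ∀ Y : Module.End ℂ (ℂ ⊗[ℚ] V₂),
        (∀ x y, ψ₂.form.baseChange ℂ (Y x) y + ψ₂.form.baseChange ℂ x (Y y) = 0) → Y ∈ spanC 𝔤₂)
    (hHom : ∀ f : V₂ →ₗ[ℚ] V₁,
      (∀ p, ∀ x ∈ H₂.piece p (n - p), f.baseChange ℂ x ∈ H₁.piece p (n - p)) → f = 0)
    (eQ : Module.Basis (Fin M) ℚ U) (q : (Fin d → Fin m × Fin M) → ℚ)
    {ΘU : Module.End ℂ (ℂ ⊗[ℚ] U)} (hΘU : ∀ p, ∀ x ∈ HU.piece p (n - p), ΘU x = ((2 * p - n : ℤ) : ℂ) • x)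
    (hΘq : ∀ u : Fin d → Fin m, wordDerAt ℂ (fun _ : Fin d =>
      LinearMap.toMatrix (Algebra.TensorProduct.basis ℂ eQ) (Algebra.TensorProduct.basis ℂ eQ) ΘU)
      (wordSlice (fun w => algebraMap ℚ ℂ (q w)) u) = 0)
    {Y : Module.End ℂ (ℂ ⊗[ℚ] V₂)}
    (hY : ∀ x y, ψ₂.form.baseChange ℂ (Y x) y + ψ₂.form.baseChange ℂ x (Y y) = 0) :
    ι₂.baseChange ℂ ∘ₗ Y ∘ₗ π₂.baseChange ℂ ∈ spanC (annLie (ψ₁.form.compl₁₂ π₁ π₁ + ψ₂.form.compl₁₂ π₂ π₂) eQ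
        (Sum.elim (fun a : H₁.endAlg => ι₁ ∘ₗ (a : Module.End ℚ V₁) ∘ₗ π₁)
          (Sum.elim (fun _ : Unit => ι₁ ∘ₗ π₁) (fun _ : Unit => ι₂ ∘ₗ π₂))) q) := by
  classical
  set aF : H₁.endAlg ⊕ (Unit ⊕ Unit) → Module.End ℚ U :=
    Sum.elim (fun a : H₁.endAlg => ι₁ ∘ₗ (a : Module.End ℚ V₁) ∘ₗ π₁)
      (Sum.elim (fun _ : Unit => ι₁ ∘ₗ π₁) (fun _ : Unit => ι₂ ∘ₗ π₂)) with haF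
  set φ : LinearMap.BilinForm ℚ U := ψ₁.form.compl₁₂ π₁ π₁ + ψ₂.form.compl₁₂ π₂ π₂ with hφ
  set 𝔞 : Submodule ℚ (Module.End ℚ U) := annLie φ eQ aF q with h𝔞
  obtain ⟨-, h2, hΘ𝔞⟩ := incl_corner_mem_annLie_of_times_rigidSymplectic hn HU H₁ H₂ heff₁ heff₂ hπι₁ hπι₂ hπ₁ι₂ hπ₂ι₁ hsum hι₁F hι₂F ψ₁ ψ₂ hV₂ hrigid hHom eQ q hΘU hΘq
  obtain ⟨Θ₂, hΘ₂⟩ := exists_hodgeTheta H₂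
  -- the rational Lie algebra of all `ψ₂`-skew operators and (RIGID) for it
  let 𝔰 : Submodule ℚ (Module.End ℚ V₂) :=
    { carrier := {X | ∀ v w, ψ₂.form (X v) w + ψ₂.form v (X w) = 0}
      zero_mem' := fun v w => by simp
      add_mem' := by
        intro X X' hX hX' v w
        simp only [LinearMap.add_apply, map_add]
        have h1 := hX v w
        have h2 := hX' v w
        linear_combination h1 + h2
      smul_mem' := by
        intro c X hX v w
        simp only [LinearMap.smul_apply, map_smul, smul_eq_mul]
        have h1 := hX v w
        linear_combination c * h1 }
  have hmem𝔰 : ∀ X, X ∈ 𝔰 ↔ ∀ v w, ψ₂.form (X v) w + ψ₂.form v (X w) = 0 := fun X => Iff.rfl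
  have h𝔰br : ∀ X ∈ 𝔰, ∀ X' ∈ 𝔰, X * X' - X' * X ∈ 𝔰 := by
    intro X hX X' hX'
    rw [hmem𝔰] at hX hX' ⊢
    intro v w
    simp only [LinearMap.sub_apply, Module.End.mul_apply, map_sub, LinearMap.sub_apply]
    have h1 := hX (X' v) w
    have h2 := hX' v (X w)
    have h3 := hX' (X v) w
    have h4 := hX v (X' w)
    linear_combination h1 - h3 + h4 - h2
  have h𝔰skew : ∀ X ∈ 𝔰, ∀ v w, ψ₂.form (X v) w + ψ₂.form v (X w) = 0 := fun X hX => (hmem𝔰 X).1 hX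
  -- `Θ₂ ∈ 𝔰_ℂ`: the second corners of `𝔞` are `ψ₂`-skew and `Θ₂ = c₂ Θ_U`
  have hΘι₂ := theta_incl_eq HU H₂ hι₂F hΘU hΘ₂
  have e22 : ∀ w, π₂ (ι₂ w) = w := fun w => by
    rw [← LinearMap.comp_apply (f := π₂), hπι₂, LinearMap.id_apply]
  have e12 : ∀ w, π₁ (ι₂ w) = 0 := fun w => by
    rw [← LinearMap.comp_apply (f := π₁), hπ₁ι₂, LinearMap.zero_apply]
  have hmem : ∀ X ∈ 𝔞, (∀ i, X * aF i = aF i * X) ∧ ∀ v w, φ (X v) w + φ v (X w) = 0 :=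
    fun X hX => ((mem_annLie_iff φ eQ aF q X).1 hX).2
  have hP₂ : ∀ X ∈ 𝔞, X * (ι₂ ∘ₗ π₂) = (ι₂ ∘ₗ π₂) * X := fun X hX => (hmem X hX).1 (Sum.inr (Sum.inr ()))
  have hφapply : ∀ x y, φ x y = ψ₁.form (π₁ x) (π₁ y) + ψ₂.form (π₂ x) (π₂ y) := fun x y => by
    rw [hφ, LinearMap.add_apply, LinearMap.add_apply, LinearMap.compl₁₂_apply, LinearMap.compl₁₂_apply]
  have hc₂𝔰 : ∀ X ∈ 𝔞, π₂ ∘ₗ X ∘ₗ ι₂ ∈ 𝔰 := by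
    intro X hX
    rw [hmem𝔰]
    intro v w
    have h := (hmem X hX).2 (ι₂ v) (ι₂ w)
    rw [apply_incl_eq_of_commute_projector hπι₂ (hP₂ X hX) v,
      apply_incl_eq_of_commute_projector hπι₂ (hP₂ X hX) w, hφapply, hφapply] at h
    simp only [e22, e12, map_zero, zero_add] at h
    simpa only [LinearMap.comp_apply] using h
  have hcorner₂ : ∀ T ∈ spanC 𝔞, π₂.baseChange ℂ ∘ₗ T ∘ₗ ι₂.baseChange ℂ ∈ spanC 𝔰 := by
    intro T hT
    induction hT using Submodule.span_induction with
    | mem Z' hZ' =>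
      obtain ⟨X, hX, rfl⟩ := hZ'
      rw [← LinearMap.baseChange_comp, ← LinearMap.baseChange_comp]
      exact baseChange_mem_spanC (hc₂𝔰 X hX)
    | zero => rw [LinearMap.zero_comp, LinearMap.comp_zero]; exact Submodule.zero_mem _
    | add Z' Z'' _ _ hZ' hZ'' => rw [LinearMap.add_comp, LinearMap.comp_add]; exact Submodule.add_mem _ hZ' hZ''
    | smul c Z' _ hZ' => rw [LinearMap.smul_comp, LinearMap.comp_smul]; exact Submodule.smul_mem _ c hZ'
  have hΘ𝔰 : Θ₂ ∈ spanC 𝔰 := by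
    have h : Θ₂ = π₂.baseChange ℂ ∘ₗ ΘU ∘ₗ ι₂.baseChange ℂ := by
      apply LinearMap.ext
      intro x
      rw [LinearMap.comp_apply, LinearMap.comp_apply, hΘι₂, proj_incl_baseChange hπι₂]
    rw [h]
    exact hcorner₂ ΘU hΘ𝔞
  have hY𝔰 : Y ∈ spanC 𝔰 := hrigid hΘ₂ 𝔰 h𝔰br h𝔰skew hΘ𝔰 Y hY
  -- elements of `𝔰_ℂ`, placed on `V₂`, lie in `𝔞_ℂ`
  have hplace : ∀ Y' ∈ spanC 𝔰, ι₂.baseChange ℂ ∘ₗ Y' ∘ₗ π₂.baseChange ℂ ∈ spanC 𝔞 := by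
    intro Y' hY'
    induction hY' using Submodule.span_induction with
    | mem Y₁ hY₁ =>
      obtain ⟨X, hX, rfl⟩ := hY₁
      rw [← LinearMap.baseChange_comp, ← LinearMap.baseChange_comp]
      exact baseChange_mem_spanC (h2 X ((hmem𝔰 X).1 hX))
    | zero => rw [LinearMap.zero_comp, LinearMap.comp_zero]; exact Submodule.zero_mem _
    | add Y₁ Y₂ _ _ hY₁ hY₂ => rw [LinearMap.add_comp, LinearMap.comp_add]; exact Submodule.add_mem _ hY₁ hY₂
    | smul c Y₁ _ hY₁ => rw [LinearMap.smul_comp, LinearMap.comp_smul]; exact Submodule.smul_mem _ c hY₁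
  exact hplace _ hY𝔰

/-- **Theorem (second factor, word model): the rational `Θ_U`-killed tensor `q` on `U = H¹(X₁) ⊕ H¹(X₂)` is
killed by the matrix of `ι₂ ∘ Y ∘ π₂` for EVERY `ψ₂`-skew operator `Y` of `H¹(X₂) ⊗ ℂ`** (`X₂` rigid symplectic,
`Hom(X₁, X₂) = 0`): «`Hg(X₁ × X₂) ⊇ 1 × Sp_{2g}`» read on tensors. [cite: MoonenZarhin1999LowDim, §3 (3.1) and Lemma (3.4)]
[cite: Deligne1982HodgeCycles, I §3 (proof of Prop. 3.4)] -/
theorem wordDerAt_incl₂_eq_zero_of_times_rigidSymplectic (hn : n = 1) (HU : HodgeStructure U n)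
    (H₁ : HodgeStructure V₁ n) (H₂ : HodgeStructure V₂ n) (heff₁ : H₁.IsEffective) (heff₂ : H₂.IsEffective)
    {ι₁ : V₁ →ₗ[ℚ] U} {π₁ : U →ₗ[ℚ] V₁} {ι₂ : V₂ →ₗ[ℚ] U} {π₂ : U →ₗ[ℚ] V₂}
    (hπι₁ : π₁ ∘ₗ ι₁ = LinearMap.id) (hπι₂ : π₂ ∘ₗ ι₂ = LinearMap.id) (hπ₁ι₂ : π₁ ∘ₗ ι₂ = 0)
    (hπ₂ι₁ : π₂ ∘ₗ ι₁ = 0) (hsum : ι₁ ∘ₗ π₁ + ι₂ ∘ₗ π₂ = LinearMap.id)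
    (hι₁F : ∀ p, ∀ x ∈ H₁.piece p (n - p), ι₁.baseChange ℂ x ∈ HU.piece p (n - p))
    (hι₂F : ∀ p, ∀ x ∈ H₂.piece p (n - p), ι₂.baseChange ℂ x ∈ HU.piece p (n - p))
    (ψ₁ : H₁.Polarization) (ψ₂ : H₂.Polarization)
    (hV₂ : Module.finrank ℚ V₂ ≠ 0)
    (hrigid : ∀ {Θ₂ : Module.End ℂ (ℂ ⊗[ℚ] V₂)}, (∀ p, ∀ x ∈ H₂.piece p (n - p), Θ₂ x = ((2 * p - n : ℤ) : ℂ) • x) →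
      ∀ 𝔤₂ : Submodule ℚ (Module.End ℚ V₂), (∀ X ∈ 𝔤₂, ∀ X' ∈ 𝔤₂, X * X' - X' * X ∈ 𝔤₂) →
      (∀ X ∈ 𝔤₂, ∀ v w, ψ₂.form (X v) w + ψ₂.form v (X w) = 0) → Θ₂ ∈ spanC 𝔤₂ →
      ∀ Y : Module.End ℂ (ℂ ⊗[ℚ] V₂),
        (∀ x y, ψ₂.form.baseChange ℂ (Y x) y + ψ₂.form.baseChange ℂ x (Y y) = 0) → Y ∈ spanC 𝔤₂)
    (hHom : ∀ f : V₂ →ₗ[ℚ] V₁,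
      (∀ p, ∀ x ∈ H₂.piece p (n - p), f.baseChange ℂ x ∈ H₁.piece p (n - p)) → f = 0)
    (eQ : Module.Basis (Fin M) ℚ U) (q : (Fin d → Fin m × Fin M) → ℚ)
    {ΘU : Module.End ℂ (ℂ ⊗[ℚ] U)} (hΘU : ∀ p, ∀ x ∈ HU.piece p (n - p), ΘU x = ((2 * p - n : ℤ) : ℂ) • x)
    (hΘq : ∀ u : Fin d → Fin m, wordDerAt ℂ (fun _ : Fin d =>
      LinearMap.toMatrix (Algebra.TensorProduct.basis ℂ eQ) (Algebra.TensorProduct.basis ℂ eQ) ΘU)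
      (wordSlice (fun w => algebraMap ℚ ℂ (q w)) u) = 0)
    {Y : Module.End ℂ (ℂ ⊗[ℚ] V₂)}
    (hY : ∀ x y, ψ₂.form.baseChange ℂ (Y x) y + ψ₂.form.baseChange ℂ x (Y y) = 0) (u : Fin d → Fin m) :
    wordDerAt ℂ (fun _ : Fin d =>
      LinearMap.toMatrix (Algebra.TensorProduct.basis ℂ eQ) (Algebra.TensorProduct.basis ℂ eQ)
        (ι₂.baseChange ℂ ∘ₗ Y ∘ₗ π₂.baseChange ℂ))
      (wordSlice (fun w => algebraMap ℚ ℂ (q w)) u) = 0 :=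
  wordDerAt_eq_zero_of_mem_spanC_annLie _ eQ _ q
    (incl₂_comp_proj_mem_spanC_annLie_of_times_rigidSymplectic hn HU H₁ H₂ heff₁ heff₂ hπι₁ hπι₂ hπ₁ι₂ hπ₂ι₁ hsum hι₁F hι₂F ψ₁ ψ₂ hV₂ hrigid hHom eQ q hΘU hΘq hY) u

/-- **`Θ_{X₁} ⊕ 0 ∈ 𝔞(q)_ℂ`**: with the hypotheses of the core theorem, the partial Hodge operator
`ι₁ ∘ Θ₁ ∘ π₁ = Θ_U - ι₂ ∘ Θ₂ ∘ π₂` of the first factor lies in `𝔞(q)_ℂ` («`Hg(X₁ × X₂) ⊇ Hg(X₁) × 1 ∋` the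
circle `Θ_{X₁}`»). [cite: MoonenZarhin1999LowDim, §3 (3.1) and Lemma (3.4)] [cite: Deligne1982HodgeCycles, I §3 (proof of Prop. 3.4)] -/
theorem incl₁_theta_proj_mem_spanC_annLie_of_times_rigidSymplectic (hn : n = 1) (HU : HodgeStructure U n)
    (H₁ : HodgeStructure V₁ n) (H₂ : HodgeStructure V₂ n) (heff₁ : H₁.IsEffective) (heff₂ : H₂.IsEffective)
    {ι₁ : V₁ →ₗ[ℚ] U} {π₁ : U →ₗ[ℚ] V₁} {ι₂ : V₂ →ₗ[ℚ] U} {π₂ : U →ₗ[ℚ] V₂}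
    (hπι₁ : π₁ ∘ₗ ι₁ = LinearMap.id) (hπι₂ : π₂ ∘ₗ ι₂ = LinearMap.id) (hπ₁ι₂ : π₁ ∘ₗ ι₂ = 0)
    (hπ₂ι₁ : π₂ ∘ₗ ι₁ = 0) (hsum : ι₁ ∘ₗ π₁ + ι₂ ∘ₗ π₂ = LinearMap.id)
    (hι₁F : ∀ p, ∀ x ∈ H₁.piece p (n - p), ι₁.baseChange ℂ x ∈ HU.piece p (n - p))
    (hι₂F : ∀ p, ∀ x ∈ H₂.piece p (n - p), ι₂.baseChange ℂ x ∈ HU.piece p (n - p))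
    (ψ₁ : H₁.Polarization) (ψ₂ : H₂.Polarization)
    (hV₂ : Module.finrank ℚ V₂ ≠ 0)
    (hrigid : ∀ {Θ₂ : Module.End ℂ (ℂ ⊗[ℚ] V₂)}, (∀ p, ∀ x ∈ H₂.piece p (n - p), Θ₂ x = ((2 * p - n : ℤ) : ℂ) • x) →
      ∀ 𝔤₂ : Submodule ℚ (Module.End ℚ V₂), (∀ X ∈ 𝔤₂, ∀ X' ∈ 𝔤₂, X * X' - X' * X ∈ 𝔤₂) →
      (∀ X ∈ 𝔤₂, ∀ v w, ψ₂.form (X v) w + ψ₂.form v (X w) = 0) → Θ₂ ∈ spanC 𝔤₂ →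
      ∀ Y : Module.End ℂ (ℂ ⊗[ℚ] V₂),
        (∀ x y, ψ₂.form.baseChange ℂ (Y x) y + ψ₂.form.baseChange ℂ x (Y y) = 0) → Y ∈ spanC 𝔤₂)
    (hHom : ∀ f : V₂ →ₗ[ℚ] V₁,
      (∀ p, ∀ x ∈ H₂.piece p (n - p), f.baseChange ℂ x ∈ H₁.piece p (n - p)) → f = 0)
    (eQ : Module.Basis (Fin M) ℚ U) (q : (Fin d → Fin m × Fin M) → ℚ)
    {ΘU : Module.End ℂ (ℂ ⊗[ℚ] U)} (hΘU : ∀ p, ∀ x ∈ HU.piece p (n - p), ΘU x = ((2 * p - n : ℤ) : ℂ) • x)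
    (hΘq : ∀ u : Fin d → Fin m, wordDerAt ℂ (fun _ : Fin d =>
      LinearMap.toMatrix (Algebra.TensorProduct.basis ℂ eQ) (Algebra.TensorProduct.basis ℂ eQ) ΘU)
      (wordSlice (fun w => algebraMap ℚ ℂ (q w)) u) = 0)
    {Θ₁ : Module.End ℂ (ℂ ⊗[ℚ] V₁)} (hΘ₁ : ∀ p, ∀ x ∈ H₁.piece p (n - p), Θ₁ x = ((2 * p - n : ℤ) : ℂ) • x) :
    ι₁.baseChange ℂ ∘ₗ Θ₁ ∘ₗ π₁.baseChange ℂ ∈ spanC (annLie (ψ₁.form.compl₁₂ π₁ π₁ + ψ₂.form.compl₁₂ π₂ π₂) eQ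
        (Sum.elim (fun a : H₁.endAlg => ι₁ ∘ₗ (a : Module.End ℚ V₁) ∘ₗ π₁)
          (Sum.elim (fun _ : Unit => ι₁ ∘ₗ π₁) (fun _ : Unit => ι₂ ∘ₗ π₂))) q) := by
  obtain ⟨Θ₂, hΘ₂⟩ := exists_hodgeTheta H₂
  have hΘ₂C : Θ₂ ∈ H₂.hodgeLieC := H₂.mem_hodgeLieC_of_forall_piece hΘ₂
  have hΘ𝔞 := (incl_corner_mem_annLie_of_times_rigidSymplectic hn HU H₁ H₂ heff₁ heff₂ hπι₁ hπι₂ hπ₁ι₂ hπ₂ι₁ hsum hι₁F hι₂F ψ₁ ψ₂ hV₂ hrigid hHom eQ q hΘU hΘq).2.2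
  have h2 := incl₂_comp_proj_mem_spanC_annLie_of_times_rigidSymplectic hn HU H₁ H₂ heff₁ heff₂ hπι₁ hπι₂ hπ₁ι₂ hπ₂ι₁ hsum hι₁F hι₂F ψ₁ ψ₂ hV₂ hrigid hHom eQ q hΘU hΘq (Y := Θ₂)
    (fun x y => by rw [formBaseChange_skew_of_mem_hodgeLieC ψ₂ hΘ₂C, neg_add_cancel])
  have hΘι₁ := theta_incl_eq HU H₁ hι₁F hΘU hΘ₁
  have hΘι₂ := theta_incl_eq HU H₂ hι₂F hΘU hΘ₂
  have hΘUy : ∀ y, ΘU y = ι₁.baseChange ℂ (Θ₁ (π₁.baseChange ℂ y)) + ι₂.baseChange ℂ (Θ₂ (π₂.baseChange ℂ y)) := by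
    intro y
    conv_lhs => rw [← incl_proj_add_baseChange hsum y]
    rw [map_add, hΘι₁, hΘι₂]
  have hdec : ι₁.baseChange ℂ ∘ₗ Θ₁ ∘ₗ π₁.baseChange ℂ = ΘU - ι₂.baseChange ℂ ∘ₗ Θ₂ ∘ₗ π₂.baseChange ℂ := by
    apply LinearMap.ext
    intro y
    simp only [LinearMap.sub_apply, LinearMap.comp_apply, hΘUy, add_sub_cancel_right]
  rw [hdec]
  exact Submodule.sub_mem _ hΘ𝔞 h2

/-- **Theorem (first factor, word model; Moonen–Zarhin Lemma (3.4) with a rigid symplectic factor).** Let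
`U = ι₁V₁ ⊕ ι₂V₂` be a presentation compatible with effective weight-one Hodge structures `H_U`, `H₁`, `H₂`,
polarizations `ψ₁`, `ψ₂`, with `V₂ ≠ 0` rigid symplectic (RIGID) and `Hom_Hdg(V₂, V₁) = 0` («`hg(X₂)` is a
`ℚ`-simple Lie algebra of non-compact type and, up to isomorphism, `V_{X₂}` is the only irreducible
`hg(X₂)`-module which is a length 1 representation of non-compact type … and `Hom(X₂, X₁) = 0`»). If a RATIONAL
coefficient tensor `q` on `U` is killed, slice by slice, by the matrix of the Hodge operator `Θ_U`, then it is
killed by the matrix of the partial Hodge operator `ι₁ ∘ Θ₁ ∘ π₁` of the first factor — the conclusion of the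
tree's `wordDerAt_incl_proj_eq_zero_of_forall_lie` and `wordDerAt_incl_proj_theta_eq_zero_of_times_nonCMCurve`,
so the typed-Künneth pipeline of programmes R5/R22 applies verbatim to `X₁ × X₂`. The hypotheses on `X₁` are
NONE (Moonen–Zarhin use `hg(X₁)` only through the reductivity of `hg`, supplied by `exists_ideal_compl`).
[cite: MoonenZarhin1999LowDim, §3 (3.1), Lemma (3.3), Lemma (3.4)] [cite: Deligne1982HodgeCycles, I §3 Prop. 3.4 and Prop. 3.6]
[cite: Hazama1989, Thm. (= Gordon 7.6.2)] -/
theorem wordDerAt_incl_proj_theta_eq_zero_of_times_rigidSymplectic (hn : n = 1) (HU : HodgeStructure U n)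
    (H₁ : HodgeStructure V₁ n) (H₂ : HodgeStructure V₂ n) (heff₁ : H₁.IsEffective) (heff₂ : H₂.IsEffective)
    {ι₁ : V₁ →ₗ[ℚ] U} {π₁ : U →ₗ[ℚ] V₁} {ι₂ : V₂ →ₗ[ℚ] U} {π₂ : U →ₗ[ℚ] V₂}
    (hπι₁ : π₁ ∘ₗ ι₁ = LinearMap.id) (hπι₂ : π₂ ∘ₗ ι₂ = LinearMap.id) (hπ₁ι₂ : π₁ ∘ₗ ι₂ = 0)
    (hπ₂ι₁ : π₂ ∘ₗ ι₁ = 0) (hsum : ι₁ ∘ₗ π₁ + ι₂ ∘ₗ π₂ = LinearMap.id)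
    (hι₁F : ∀ p, ∀ x ∈ H₁.piece p (n - p), ι₁.baseChange ℂ x ∈ HU.piece p (n - p))
    (hι₂F : ∀ p, ∀ x ∈ H₂.piece p (n - p), ι₂.baseChange ℂ x ∈ HU.piece p (n - p))
    (ψ₁ : H₁.Polarization) (ψ₂ : H₂.Polarization)
    (hV₂ : Module.finrank ℚ V₂ ≠ 0)
    (hrigid : ∀ {Θ₂ : Module.End ℂ (ℂ ⊗[ℚ] V₂)}, (∀ p, ∀ x ∈ H₂.piece p (n - p), Θ₂ x = ((2 * p - n : ℤ) : ℂ) • x) →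
      ∀ 𝔤₂ : Submodule ℚ (Module.End ℚ V₂), (∀ X ∈ 𝔤₂, ∀ X' ∈ 𝔤₂, X * X' - X' * X ∈ 𝔤₂) →
      (∀ X ∈ 𝔤₂, ∀ v w, ψ₂.form (X v) w + ψ₂.form v (X w) = 0) → Θ₂ ∈ spanC 𝔤₂ →
      ∀ Y : Module.End ℂ (ℂ ⊗[ℚ] V₂),
        (∀ x y, ψ₂.form.baseChange ℂ (Y x) y + ψ₂.form.baseChange ℂ x (Y y) = 0) → Y ∈ spanC 𝔤₂)
    (hHom : ∀ f : V₂ →ₗ[ℚ] V₁,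
      (∀ p, ∀ x ∈ H₂.piece p (n - p), f.baseChange ℂ x ∈ H₁.piece p (n - p)) → f = 0)
    (eQ : Module.Basis (Fin M) ℚ U) (q : (Fin d → Fin m × Fin M) → ℚ)
    {ΘU : Module.End ℂ (ℂ ⊗[ℚ] U)} (hΘU : ∀ p, ∀ x ∈ HU.piece p (n - p), ΘU x = ((2 * p - n : ℤ) : ℂ) • x)
    (hΘq : ∀ u : Fin d → Fin m, wordDerAt ℂ (fun _ : Fin d =>
      LinearMap.toMatrix (Algebra.TensorProduct.basis ℂ eQ) (Algebra.TensorProduct.basis ℂ eQ) ΘU)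
      (wordSlice (fun w => algebraMap ℚ ℂ (q w)) u) = 0)
    {Θ₁ : Module.End ℂ (ℂ ⊗[ℚ] V₁)} (hΘ₁ : ∀ p, ∀ x ∈ H₁.piece p (n - p), Θ₁ x = ((2 * p - n : ℤ) : ℂ) • x)
    (u : Fin d → Fin m) :
    wordDerAt ℂ (fun _ : Fin d =>
      LinearMap.toMatrix (Algebra.TensorProduct.basis ℂ eQ) (Algebra.TensorProduct.basis ℂ eQ)
        (ι₁.baseChange ℂ ∘ₗ Θ₁ ∘ₗ π₁.baseChange ℂ))
      (wordSlice (fun w => algebraMap ℚ ℂ (q w)) u) = 0 :=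
  wordDerAt_eq_zero_of_mem_spanC_annLie _ eQ _ q
    (incl₁_theta_proj_mem_spanC_annLie_of_times_rigidSymplectic hn HU H₁ H₂ heff₁ heff₂ hπι₁ hπι₂ hπ₁ι₂ hπ₂ι₁ hsum hι₁F hι₂F ψ₁ ψ₂ hV₂ hrigid hHom eQ q hΘU hΘq hΘ₁) u

end Main

/-! ### §6 Low rank: `dim V₂ ∈ {2, 4, 6}` and `End_Hdg(V₂) = ℚ` (generic curves, surfaces, threefolds) -/

section LowRank

universe u

variable {U V₁ V₂ : Type u} [AddCommGroup U] [Module ℚ U] [AddCommGroup V₁] [Module ℚ V₁]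
  [AddCommGroup V₂] [Module ℚ V₂] [Module.Finite ℚ U] [Module.Finite ℚ V₁] [Module.Finite ℚ V₂]
  [HodgeTensorFacts.{u, u}] {n : ℤ}
variable {M d m : ℕ}

omit [Module.Finite ℚ U] [Module.Finite ℚ V₁] [HodgeTensorFacts.{u, u}] in
/-- **(RIGID) in rank `2`, `4`, `6` with `End_Hdg = ℚ`** — the tree's theorems `RankTwoTheta.mem_spanC_of_skew`
(`hg(E) = 𝔰𝔩₂`, a non-CM elliptic curve; MZ99 Remark (3.5)), `SymplecticTheta.mem_spanC_of_skew` (MZ99 (2.2) Type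
I(1): an abelian surface with `End⁰ = ℚ` has `Hg = Sp₄`) and `SymplecticThetaSix.mem_spanC_of_skew` (MZ99 (2.3)
Type I(1): an abelian threefold with `End⁰ = ℚ` has `Hg = Sp₆`), assembled: for an effective polarized weight-one
`ℚ`-Hodge structure of rank `2`, `4` or `6` with `End_Hdg(V₂) = ℚ`, EVERY bracket-closed rational `ψ₂`-skew
`𝔤₂` whose complex span contains the Hodge operator complexifies onto all `ψ₂ ⊗ ℂ`-skew operators. (MZ99 (2.4)
(3): «If `Hg(X)` is `ℚ`-simple then (up to isomorphism) there is exactly one faithful irreducible representation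
of `hg(X)` over `ℚ` which is of length 1» — for `End⁰(X) = ℚ`, `g ≤ 3`, `hg(X) = 𝔰𝔭_{2g}`.)
[cite: MoonenZarhin1999LowDim, §2 (2.1)–(2.4) and §3 Remark (3.5)] [cite: Deligne1982HodgeCycles, I §3 Prop. 3.4] -/
theorem LowRankGeneric.mem_spanC_of_skew (H₂ : HodgeStructure V₂ n) (hn : n = 1) (heff₂ : H₂.IsEffective)
    (ψ₂ : H₂.Polarization) (hE₂ : ∀ a ∈ H₂.endAlg, ∃ x : ℚ, a = x • 1)
    (hV₂ : Module.finrank ℚ V₂ = 2 ∨ Module.finrank ℚ V₂ = 4 ∨ Module.finrank ℚ V₂ = 6)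
    {Θ₂ : Module.End ℂ (ℂ ⊗[ℚ] V₂)} (hΘ₂ : ∀ p, ∀ x ∈ H₂.piece p (n - p), Θ₂ x = ((2 * p - n : ℤ) : ℂ) • x)
    (𝔤₂ : Submodule ℚ (Module.End ℚ V₂)) (hbr : ∀ X ∈ 𝔤₂, ∀ X' ∈ 𝔤₂, X * X' - X' * X ∈ 𝔤₂)
    (hskew : ∀ X ∈ 𝔤₂, ∀ v w, ψ₂.form (X v) w + ψ₂.form v (X w) = 0) (hΘ𝔤 : Θ₂ ∈ spanC 𝔤₂)
    (Y : Module.End ℂ (ℂ ⊗[ℚ] V₂))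
    (hY : ∀ x y, ψ₂.form.baseChange ℂ (Y x) y + ψ₂.form.baseChange ℂ x (Y y) = 0) : Y ∈ spanC 𝔤₂ := by
  rcases hV₂ with h2 | h4 | h6
  · exact RankTwoTheta.mem_spanC_of_skew H₂ hn heff₂ ψ₂ hE₂ h2 𝔤₂ hbr hΘ₂ hΘ𝔤 hskew hY
  · exact SymplecticTheta.mem_spanC_of_skew H₂ hn heff₂ ψ₂ hE₂ h4 𝔤₂ hbr hΘ₂ hΘ𝔤 hskew hY
  · exact SymplecticThetaSix.mem_spanC_of_skew H₂ hn heff₂ ψ₂ hE₂ h6 𝔤₂ hbr hΘ₂ hΘ𝔤 hskew hY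

/-- **Theorem (second factor, word model; `X₂` a non-CM elliptic curve, or an abelian surface or threefold with
`End⁰(X₂) = ℚ`, and `Hom(X₁, X₂) = 0`):** the rational `Θ_U`-killed tensor `q` on `U = H¹(X₁) ⊕ H¹(X₂)` is killed
by the matrix of `ι₂ ∘ Y ∘ π₂` for EVERY `ψ₂`-skew operator `Y` of `H¹(X₂) ⊗ ℂ` («`Hg(X₁ × X₂) ⊇ 1 × Sp_{2g}`»).
The statement of `wordDerAt_incl₂_eq_zero_of_times_nonCMCurve` with `dim V₂ = 2` replaced by
`dim V₂ ∈ {2, 4, 6}`. [cite: MoonenZarhin1999LowDim, §2 (2.4), §3 (3.1) and Lemma (3.4)]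
[cite: Deligne1982HodgeCycles, I §3 (proof of Prop. 3.4)] -/
theorem wordDerAt_incl₂_eq_zero_of_times_lowRankGeneric (hn : n = 1) (HU : HodgeStructure U n)
    (H₁ : HodgeStructure V₁ n) (H₂ : HodgeStructure V₂ n) (heff₁ : H₁.IsEffective) (heff₂ : H₂.IsEffective)
    {ι₁ : V₁ →ₗ[ℚ] U} {π₁ : U →ₗ[ℚ] V₁} {ι₂ : V₂ →ₗ[ℚ] U} {π₂ : U →ₗ[ℚ] V₂}
    (hπι₁ : π₁ ∘ₗ ι₁ = LinearMap.id) (hπι₂ : π₂ ∘ₗ ι₂ = LinearMap.id) (hπ₁ι₂ : π₁ ∘ₗ ι₂ = 0)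
    (hπ₂ι₁ : π₂ ∘ₗ ι₁ = 0) (hsum : ι₁ ∘ₗ π₁ + ι₂ ∘ₗ π₂ = LinearMap.id)
    (hι₁F : ∀ p, ∀ x ∈ H₁.piece p (n - p), ι₁.baseChange ℂ x ∈ HU.piece p (n - p))
    (hι₂F : ∀ p, ∀ x ∈ H₂.piece p (n - p), ι₂.baseChange ℂ x ∈ HU.piece p (n - p))
    (ψ₁ : H₁.Polarization) (ψ₂ : H₂.Polarization)
    (hE₂ : ∀ a ∈ H₂.endAlg, ∃ x : ℚ, a = x • 1)
    (hV₂ : Module.finrank ℚ V₂ = 2 ∨ Module.finrank ℚ V₂ = 4 ∨ Module.finrank ℚ V₂ = 6)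
    (hHom : ∀ f : V₂ →ₗ[ℚ] V₁,
      (∀ p, ∀ x ∈ H₂.piece p (n - p), f.baseChange ℂ x ∈ H₁.piece p (n - p)) → f = 0)
    (eQ : Module.Basis (Fin M) ℚ U) (q : (Fin d → Fin m × Fin M) → ℚ)
    {ΘU : Module.End ℂ (ℂ ⊗[ℚ] U)} (hΘU : ∀ p, ∀ x ∈ HU.piece p (n - p), ΘU x = ((2 * p - n : ℤ) : ℂ) • x)
    (hΘq : ∀ u : Fin d → Fin m, wordDerAt ℂ (fun _ : Fin d =>
      LinearMap.toMatrix (Algebra.TensorProduct.basis ℂ eQ) (Algebra.TensorProduct.basis ℂ eQ) ΘU)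
      (wordSlice (fun w => algebraMap ℚ ℂ (q w)) u) = 0)
    {Y : Module.End ℂ (ℂ ⊗[ℚ] V₂)}
    (hY : ∀ x y, ψ₂.form.baseChange ℂ (Y x) y + ψ₂.form.baseChange ℂ x (Y y) = 0) (u : Fin d → Fin m) :
    wordDerAt ℂ (fun _ : Fin d =>
      LinearMap.toMatrix (Algebra.TensorProduct.basis ℂ eQ) (Algebra.TensorProduct.basis ℂ eQ)
        (ι₂.baseChange ℂ ∘ₗ Y ∘ₗ π₂.baseChange ℂ))
      (wordSlice (fun w => algebraMap ℚ ℂ (q w)) u) = 0 :=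
  wordDerAt_incl₂_eq_zero_of_times_rigidSymplectic hn HU H₁ H₂ heff₁ heff₂ hπι₁ hπι₂ hπ₁ι₂ hπ₂ι₁ hsum hι₁F hι₂F
    ψ₁ ψ₂ (by rcases hV₂ with h | h | h <;> omega)
    (fun hΘ₂ 𝔤₂ hbr hskew hΘ𝔤 Y' hY' => LowRankGeneric.mem_spanC_of_skew H₂ hn heff₂ ψ₂ hE₂ hV₂ hΘ₂ 𝔤₂ hbr hskew
      hΘ𝔤 Y' hY') hHom eQ q hΘU hΘq hY u

/-- **Theorem (first factor, word model; Moonen–Zarhin Lemma (3.4) with a non-CM elliptic curve, a generic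
abelian surface or a generic abelian threefold).** Let `U = ι₁V₁ ⊕ ι₂V₂` be a presentation compatible with
effective weight-one Hodge structures `H_U`, `H₁`, `H₂`, polarizations `ψ₁`, `ψ₂`, with `dim V₂ ∈ {2, 4, 6}`,
`End_Hdg(V₂) = ℚ` and `Hom_Hdg(V₂, V₁) = 0` («`X₂` a simple abelian variety of dimension `≤ 3` with
`End⁰(X₂) = ℚ` — then `hg(X₂) = 𝔰𝔭_{2g}` and `V_{X₂}` is its only length 1 irreducible representation (MZ99
(2.4)(3)) — and `Hom(X₂, X₁) = 0`»). If a RATIONAL coefficient tensor `q` on `U` is killed, slice by slice, by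
the matrix of the Hodge operator `Θ_U`, then it is killed by the matrix of the partial Hodge operator
`ι₁ ∘ Θ₁ ∘ π₁` of the first factor: the statement of `wordDerAt_incl_proj_theta_eq_zero_of_times_nonCMCurve` with
`dim V₂ = 2` replaced by `dim V₂ ∈ {2, 4, 6}` (so that programme R22's geometric pipeline runs verbatim for
`X × S`, `S` a generic surface or threefold). [cite: MoonenZarhin1999LowDim, §2 (2.4), §3 (3.1), Lemma (3.4), §5 (5.4)]
[cite: Deligne1982HodgeCycles, I §3 Prop. 3.4 and Prop. 3.6] [cite: Hazama1989, Thm. (= Gordon 7.6.2)] -/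
theorem wordDerAt_incl_proj_theta_eq_zero_of_times_lowRankGeneric (hn : n = 1) (HU : HodgeStructure U n)
    (H₁ : HodgeStructure V₁ n) (H₂ : HodgeStructure V₂ n) (heff₁ : H₁.IsEffective) (heff₂ : H₂.IsEffective)
    {ι₁ : V₁ →ₗ[ℚ] U} {π₁ : U →ₗ[ℚ] V₁} {ι₂ : V₂ →ₗ[ℚ] U} {π₂ : U →ₗ[ℚ] V₂}
    (hπι₁ : π₁ ∘ₗ ι₁ = LinearMap.id) (hπι₂ : π₂ ∘ₗ ι₂ = LinearMap.id) (hπ₁ι₂ : π₁ ∘ₗ ι₂ = 0)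
    (hπ₂ι₁ : π₂ ∘ₗ ι₁ = 0) (hsum : ι₁ ∘ₗ π₁ + ι₂ ∘ₗ π₂ = LinearMap.id)
    (hι₁F : ∀ p, ∀ x ∈ H₁.piece p (n - p), ι₁.baseChange ℂ x ∈ HU.piece p (n - p))
    (hι₂F : ∀ p, ∀ x ∈ H₂.piece p (n - p), ι₂.baseChange ℂ x ∈ HU.piece p (n - p))
    (ψ₁ : H₁.Polarization) (ψ₂ : H₂.Polarization)
    (hE₂ : ∀ a ∈ H₂.endAlg, ∃ x : ℚ, a = x • 1)
    (hV₂ : Module.finrank ℚ V₂ = 2 ∨ Module.finrank ℚ V₂ = 4 ∨ Module.finrank ℚ V₂ = 6)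
    (hHom : ∀ f : V₂ →ₗ[ℚ] V₁,
      (∀ p, ∀ x ∈ H₂.piece p (n - p), f.baseChange ℂ x ∈ H₁.piece p (n - p)) → f = 0)
    (eQ : Module.Basis (Fin M) ℚ U) (q : (Fin d → Fin m × Fin M) → ℚ)
    {ΘU : Module.End ℂ (ℂ ⊗[ℚ] U)} (hΘU : ∀ p, ∀ x ∈ HU.piece p (n - p), ΘU x = ((2 * p - n : ℤ) : ℂ) • x)
    (hΘq : ∀ u : Fin d → Fin m, wordDerAt ℂ (fun _ : Fin d =>
      LinearMap.toMatrix (Algebra.TensorProduct.basis ℂ eQ) (Algebra.TensorProduct.basis ℂ eQ) ΘU)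
      (wordSlice (fun w => algebraMap ℚ ℂ (q w)) u) = 0)
    {Θ₁ : Module.End ℂ (ℂ ⊗[ℚ] V₁)} (hΘ₁ : ∀ p, ∀ x ∈ H₁.piece p (n - p), Θ₁ x = ((2 * p - n : ℤ) : ℂ) • x)
    (u : Fin d → Fin m) :
    wordDerAt ℂ (fun _ : Fin d =>
      LinearMap.toMatrix (Algebra.TensorProduct.basis ℂ eQ) (Algebra.TensorProduct.basis ℂ eQ)
        (ι₁.baseChange ℂ ∘ₗ Θ₁ ∘ₗ π₁.baseChange ℂ))
      (wordSlice (fun w => algebraMap ℚ ℂ (q w)) u) = 0 :=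
  wordDerAt_incl_proj_theta_eq_zero_of_times_rigidSymplectic hn HU H₁ H₂ heff₁ heff₂ hπι₁ hπι₂ hπ₁ι₂ hπ₂ι₁ hsum
    hι₁F hι₂F ψ₁ ψ₂ (by rcases hV₂ with h | h | h <;> omega)
    (fun hΘ₂ 𝔤₂ hbr hskew hΘ𝔤 Y' hY' => LowRankGeneric.mem_spanC_of_skew H₂ hn heff₂ ψ₂ hE₂ hV₂ hΘ₂ 𝔤₂ hbr hskew
      hΘ𝔤 Y' hY') hHom eQ q hΘU hΘq hΘ₁ u

end LowRank

end HodgeStructure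

end Literature.AlgebraicGeometry.Motives

end
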